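import Literature.MathematicalPhysics.QuantumFieldTheory.BalabanImbrieJaffe1984to88.BIJ88Ineq238FlatTorus
import Literature.MathematicalPhysics.QuantumFieldTheory.BalabanImbrieJaffe1984to88.BIJ85Ineq732SmallFieldRegion
import Literature.MathematicalPhysics.QuantumFieldTheory.BalabanImbrieJaffe1984to88.BIJ88Decay241SmallFieldTorus

/-!
# `BalabanImbrieJaffe1984to88.BIJ88DeltaLocClose235General` — T. Bałaban, J. Imbrie, A. Jaffe, *Effective action and cluster properties of
the abelian Higgs model*, Commun. Math. Phys. **114** (1988) 257–315 [BalabanImbrieJaffe1988], Sect. 2 pp. 263–264 [PDF 7–8], (4.9) p. 275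
[PDF 19]: **THE HENCE-STEPS (2.30), (2.31), (2.35), (2.36), (2.38), (2.40), (2.41) AND (4.9)_{j≥1} FOR THE CONCRETE TORUS OBJECTS OF RECORD AT AN
ARBITRARY `U(1)` BACKGROUND `u`, FROM [6]'s TWO INPUTS (1.10) AND (1.11)–(1.12) FOR THE REGION PROPAGATORS `G_k(X,u)` AS DISPLAYED
HYPOTHESES** — gen 17/18's flat assembly (`BIJ88NeumannPropagatorFlatClose231` §5–§6, `BIJ88DeltaLocFlatClose235` §3–§7,
`BIJ88Ineq238FlatTorus`, `BIJ88Eq240FlatTorus` §4) with the pure-gauge background `1^h` replaced by an arbitrary `u : GaugeField P 0 U1`, the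
zero-field box theorems of [6] replaced by the two input SHAPES they inhabit (stated for `u`, in the level-`k` units of the lane owner's UNITS
NOTE, at fixed constants `δ₀, c₀`), the no-wrap box `Ω₀` / nested cubes replaced by ARBITRARY finite sets `Ω ⊇ □_α` where the hence-steps do
not use their shape ((2.30)/(2.31)/(2.35)/(2.36)) and by unions of `k`-blocks where they do ((2.38)/(2.40)/(4.9)), and the two small-field
members already in the tree for a general `u` plugged in where they enter: [I] (7.3.2) for the region form `Δ_k(Ω,u)` at a small-plaquette `u`
(this seat's `BIJ85Ineq732SmallFieldRegion`, p344913) for (2.38), and (2.40)/(4.9) for any Hermitian `Δ` with a (2.38)-shape bound at a small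
bond field (this seat's `BIJ88Decay241SmallFieldTorus` §7 `Z49_smallField_eq`, p344337).

statement-level skeleton of published theorems with citation tags; proofs where landed; nothing here is a claim about the Yang–Mills mass gap

PDF held: `paper:balaban1988-cmp114-bij-abelian-higgs-effective-action` (journal page = PDF page + 256); pp. 263–264 [PDF 7–8] as re-read and
quoted verbatim in gen 17's two headers (same seat; the quotations below are copied from there); [6] = [Balaban1983RegularityDecay] (CMP **89**)
p. 573 as transcribed in `Balaban1983to89.B4Delta112ZeroBox`; [I] = [BalabanImbrieJaffe1985] (CMP **97**) (7.3.2) p. 326 as quoted in p11's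
`BIJ85Ineq732General`.

CITATION HEADER (lean-in-tree rule).  Part of the lit-balaban TYPED SKELETON (HOME `run/shared/lean/pub/lit-balaban/`), PHASE-2 proof seat
p31 gen 20 (unit `lit-balaban-p31-g20`; TAKING #3 line HOME/STATUS.md 2026-08-23; free-target protocol G.5-34(d) — item 2 (ii) of the owner's
`HOME/lit-balaban-r18/C2S14-CLOSURE.md` §5, *"the DECAY inputs (2.30)/(2.31) ⟹ (2.35)/(2.36)/(2.38)/(2.41)/(4.9)_{j≥1} as torus theorems"*,
AT A GENERAL BACKGROUND — the ASSEMBLY half: everything downstream of [6] for the concrete objects, so that the non-flat [6]-members of the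
lane — p34's Kato/Agmon route for the cube propagators at small fields (`BIJ88NeumannPropagatorSmallFieldRegion`, kernel form landed, the
`k`-uniform `‖f‖_∞` member announced 2026-08-22T23:53Z as successor-sized), r01's (2.23)-regular route (`BIJ85NeumannPropagatorRegularDecay`),
p30's derivative members — instantiate the whole chain BY NAME the moment they land in the operator form below).  WHAT IS REPRODUCED: rows
**C2.Eq2.30**, **C2.Eq2.31**, **C2.Eq2.35**, **C2.Eq2.36**, **C2.Eq2.38**, **C2.Eq2.40**, **C2.Eq2.41**, **C2.Eq4.9** (`HOME/lit-balaban-r18/ROWS-C2.md`, owner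
r18; heads unchanged = p02's/r18's abstract hence-steps and the flat located members) as located members AT A GENERAL BACKGROUND for gen 15's
objects WITH BODIES — `BIJ88DeltaLoc234Torus.gLocT` (2.28), `deltaLocT` (2.34), `deltaRegion` (Δ_k(Ω,u), [I] (4.6.4)) over
`BIJ88NeumannPropagator227Torus.gBox` (G_k(X,u)) — CLOSED MODULO the two [6]-inputs for `gBox … u k X`.  Kind «model-level theorems only» (no
definition, no `Prop`-valued fact introduced; the inputs are hypotheses of the theorems, displayed).

THE PRINTED TEXT (verbatim, p. 263 [PDF 7]).  *"The boundary conditions are always at a distance O(r(e_k)) from x₁, x₂, so a straightforward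
application of the random walk expansion of [6] shows that |(G_{k,loc}(u)f)(x)| ≦ ce^{−c dist(suppt f,x)}‖f‖_∞, (2.30) |(G_{k,loc}(u)f −
G_k(Ω,u)f)(x)| ≦ e^{−cr(e_k)}e^{−c dist(suppt f,x)}‖f‖_∞, (2.31) for dist(x,Ω^c) ≧ O(r(e_k)). [Each G_k(□_α,u) is close to G_k(Ω,u) for the
relevant x₁, x₂, therefore the convex combination and G_{k,loc} are close also.] We assume that u is smooth in the □_α's entering the sum in
(2.27); for (2.31) we assume smoothness throughout the subset Ω ⊂ T_η."* … *"Here we have simply replaced G_k(Ω,u) with G_{k,loc} in the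
definition of Δ_k(Ω,u); see (I.4.6.4). Hence |Δ_{k,loc}(u;x₁,x₂) − Δ_k(Ω,u;x₁,x₂)| ≦ e^{−cr(e_k)}e^{−c|x₁−x₂|} for dist({x₁,x₂},Ω^c) >
O(r(e_k)), (2.35) |Δ_{k,loc}(u;x₁,x₂)| ≦ ce^{−c|x₁−x₂|}, (2.36)"*; p. 264 [PDF 8]: *"Again we assume u is smooth in the relevant regions"* …
*"Finally, in view of (2.35), the lower bound (I.7.3.2) applies to Δ_{k,loc}(u) as well. Let φ be supported in a region having an r(e_k)
neighborhood where u is smooth. Then ⟨φ, Δ_{k,loc}(u)φ⟩ ≧ c Σ_{b∈T₁^{(k)*}} |u(⟨b₋,b₊⟩)φ(b₊) − φ(b₋)|² − ce_k²p(e_k)² Σ_{x∈T₁^{(k)}} |φ(x)|².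
(2.38) … Let C^{(k)}_Λ(u) = (Λ(Δ_{k,loc}(u) + a_kL^{−2}P(u))Λ)^{−1} … (2.40) by (2.38), C^{(k)}_Λ(u)^{−1} is bounded below"*.  [6] p. 573 (as
transcribed in `B4Delta112ZeroBox`): *"If Ω ⊂ Ω₀, then for δG_k(Ω, Ω₀, A) … G_k(Ω, A) − G_k(Ω₀, A), (1.11) we have the inequalities [(1.9) and
(1.10)] … with the additional factor exp(−δ₀ dist(supp f, Ω^c) − δ₀ dist(supp f, Ω^c)) (1.12)"*.

THE TWO INPUT SHAPES (hypotheses `hG…`, `hC` of the theorems; `X, □, Ω` finite sets of fine torus sites, `s_k = L^kε = P.spacing k`, `|·|_T` =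
p38's sup torus metric `B5Ineq137Torus.T P 0` in lattice units, so `|·|_T/L^k` is the distance in the `η = L^{−k}`-units of the print's `T_η`):
* (H1.10) for `G_k(X,u) = gBox A c′ u k X`:  for every row `x`, every complex source `f` with `‖f‖ ≤ F` supported at sup-torus distance `≥ D`
  from `x`:  `‖(G_k(X,u)f)(x)‖ ≤ s_k²·c₀·e^{−δ₀D/L^k}·F`  — the shape of gen 17's `decay110_flat_cube_level` ([6] (1.10), value member, for
  the torus cubes at `u = 1^h`, PROVED there from p38's zero-field box theorem);
* (H1.12) for the pair `□ ⊆ Ω`:  for every row `x ∈ □`, every `f` supported in `□` with `‖f‖ ≤ F` at distance `≥ D` from `x`, all `D_b, D_f`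
  dominated by the sup-torus distances from `x`, resp. from `supp f`, to `Ω∖□`:  `‖(G_k(□,u)f)(x) − (G_k(Ω,u)f)(x)‖ ≤
  s_k²·c₀·e^{−δ₀D/L^k}·e^{−δ₀(D_b+D_f)/L^k}·F`  — the shape of gen 17's `close112_flat_cube_level` ([6] (1.11)–(1.12) at `A = 0` for nested
  torus cubes, PROVED there from r01/b04's `B4Delta112ZeroBox`).
Both at ONE pair of constants `δ₀, c₀ ≥ 0` (a provider with two pairs weakens to `(min δ, max c)`: `input110_mono`, `input112_mono`).  The
print's *"we assume that u is smooth in the □_α's … for (2.31) … throughout the subset Ω"* is exactly WHERE these inputs are asserted; the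
theorems below are agnostic of how they are obtained.

THE MECHANISM = gen 17/18's, verbatim up to `1^h ↦ u` (every identity used — `gLocT_sub_eq`, `gLocT_mulVec_apply`, `gLocT_sub_mulVec_apply`,
the sandwich `qMq_apply`/`norm_qMq_apply_le`, the block metric `blockLower_le_T`/`exp_blockLower_level_le`, `scale_identity`,
`deltaRegion_apply`/`deltaLocT_apply`/`deltaLocT_sub_deltaRegion_apply`, `deltaLocT_conjTranspose` — was already stated there for an arbitrary
`U`; only the two inputs were flat): (§1) (2.30) operator form — `(G_{k,loc}f)(x) = Σ_α(G_k(□_α)g_α)(x)` with the row sources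
`g_α = ζ″(x,·)λ_α(x,·)f`, (H1.10) cube by cube on the active set `S`; (§2) (2.31) operator and kernel forms — `G_{k,loc} − G_k(Ω) =
ζ″Σ_αλ_α(G_k(□_α) − G_k(Ω)) + (ζ″ − 1)G_k(Ω)` under the row hypotheses (i) completeness of the weights where `ζ″ ≠ 0`, (ii) every active cube
contains `x, y` at distance `≥ R` from `Ω∖□_α`, (iii) `ζ″ = 1` within `R₁`: (H1.12) on the active cubes, (H1.10) for `Ω` on the tail beyond
`R₁`; (§3) (2.36) for `Δ_k(Ω,u)` and for `Δ_{k,loc}(u)` — the `Q_k(u)(·)Q_k(u)ᴴ` sandwich of (H1.10)/§1 at the block lower bound of the metric,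
prefactor `A²·s_k²·L^{−kd} = A·a_k`; (§4) (2.35) — the sandwich of §2; (§5) (2.38) — (I.7.3.2) for `Δ_k(Ω,u)` at a small-plaquette `u`
(`ineq238_deltaRegion_smallField_region`) and §4 combined by p02's `abs_kform_sub_le`; (§6) (2.40)/(4.9) — §7's `Z49_smallField_eq` on the
Hermitian `Δ_{k,loc}(u)` with §5 as its (2.38)-hypothesis, the (2.40) constant's homogeneity (gen 19's `BIJ88Decay241FlatTorus.c240_smul`) cancelling the normalization `A/a_k`.
Constants: the outputs carry `(δ₀, c₀)` of the inputs explicitly (rates `δ₀`, `δ₀/2`; constants `c₀`, `c₀e^{δ₀}`, `c₀e^{δ₀/2}`, `#S·…`), no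
existential packaging; every torus / level / region / data for which the inputs hold.

WHAT IS PROVED (theorems only; 0 `sorry`; standard axioms).
* §0 `input110_mono`, `input112_mono` (weakening the constants of the input shapes), `input110_kernel`, `input112_kernel` (the kernel
  entries from the value members: sources `δ_y`).
* §1 **`opDecay230_of_input`** — (2.30), operator form, at `u`: `‖(G_{k,loc}(u)f)(x)‖ ≤ s_k²·#S·c₀e^{−δ₀D/L^k}‖f‖_∞`, `S ∋` the cubes active on
  the row of `x` against `supp f`; any finite family `cube : ι → Finset`, `Σ_α|λ_α| ≤ 1`, `|ζ″| ≤ 1`, (H1.10) for every `□_α`; any `A, c′, k`.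
* §2 **`opClose231_of_inputs`** — (2.31), operator form, at `u`: `‖(G_{k,loc}(u)f − G_k(Ω,u)f)(x)‖ ≤ s_k²·c₀(#S·e^{−2δ₀R/L^k} +
  e^{−(δ₀/2)R₁/L^k})e^{−(δ₀/2)D/L^k}‖f‖_∞` under (i)–(iii) on the row of `x`, from (H1.12) for every pair `□_α ⊆ Ω` and (H1.10) for `Ω`;
  **`close231_kernel_of_inputs`** — (2.31), kernel form: `‖G_{k,loc}(u;x,y) − G_k(Ω,u;x,y)‖ ≤ s_k²·c₀(e^{−2δ₀R/L^k} + e^{−(δ₀/2)R₁/L^k})·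
  e^{−(δ₀/2)|x−y|_T/L^k}`.
* §3 **`decay236_region_of_input`** — (2.36) for `Δ_k(Ω,u) = deltaRegion A c′ u k Ω`, `A = α_kL^{kd}`: `‖Δ_k(Ω,u;y₁,y₂)‖ ≤ A·([y₁ = y₂] +
  a_k·c₀e^{δ₀}·e^{−δ₀|y₁−y₂|_{T^{(k)}}})` for ALL `y₁, y₂`, from (H1.10) for `Ω`; **`decay236_of_input`** — (2.36) for `Δ_{k,loc}(u)`:
  `‖Δ_{k,loc}(u;y₁,y₂)‖ ≤ A·([y₁ = y₂] + #S·a_k·c₀e^{δ₀}·e^{−δ₀|y₁−y₂|_{T^{(k)}}})`, `S ∋` the cubes active on the rows `x ∈ B^k(y₁)`.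
* §4 **`close235_of_inputs`** — (2.35): under (i)–(iii) on every row `x ∈ B^k(y₁)` and `S` as in §3,
  `‖Δ_{k,loc}(u;y₁,y₂) − Δ_k(Ω,u;y₁,y₂)‖ ≤ A·a_k·c₀e^{δ₀/2}(#S·e^{−2δ₀R/L^k} + e^{−(δ₀/2)R₁/L^k})·e^{−(δ₀/2)|y₁−y₂|_{T^{(k)}}}` — at the
  printed radii `R, R₁ = r(e_k)L^k` the bracket is print's `e^{−cr(e_k)}` at every level `k` (owner's UNITS NOTE), IN THE COUNTING
  NORMALIZATION of gen 15 (`deltaLocT = (A/a_k)×` the printed kernel, gen 17 header).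
* §5 **`ineq238_of_inputs`** — (2.38) for `Δ_{k,loc}(u)`, `Ω` a `k`-block union, `u` with plaquettes within `θ` of `1`: for every admissible `φ`
  (row hypotheses with multiplicity `≤ m` on the block rows of `supp φ`, unit bonds meeting `supp φ` inside `Ω^{(k)*}`),
  `(A/a_k)·(γ₀·Σ_{b∈T₁^{(k)*}}|u_k(b)φ(b₊) − φ(b₋)|² − ((4/3)d⁴(L^{2k}θ)² + a_k²c₀e^{δ₀/2}K_d(δ₀/2)(m·e^{−2δ₀R/L^k} + e^{−(δ₀/2)R₁/L^k}))·Σ|φ|²)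
  ≤ Re⟨φ, Δ_{k,loc}(u)φ⟩`, `γ₀ = min(a/(9(d+1)), 1/12)`, `u_k = lineIter u k`.
* §8 (v1.1) **`decay241_of_inputs`** — (2.41) for `C^{(k)}_Λ(u) = ((Δ_{k,loc}(u) + (A/a_k)κ′P(u_k))|_Λ)^{−1}`: under the data of §6 without
  the symmetry hypotheses, plus (H1.10) for every cube, for every rate `0 ≤ ϑ ≤ δ₀/4` with the explicit smallness
  `ϑ(4/δ₀)2K_d(δ₀/2)(a_k(1 + m·a_kc₀e^{δ₀}) + κ′L^{−2d}e^{δ₀(L−1)}) ≤ (c₀^{(2.40)}(γ₀,κ′)(1−σ) − E₀)/2`: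
  `‖C^{(k)}_Λ(u;x₁,x₂)‖ ≤ (A/a_k)^{−1}(4/(c₀^{(2.40)}(γ₀,κ′)(1−σ) − E₀))e^{−ϑ|x₁−x₂|_{T^{(k)}}}` — gen 19's abstract `decay241_smallField` BY NAME
  on §3 + §5 (row C2.Eq2.41 located member at a general `u` modulo [6]).
* §9 (v1.1) `input110_of_local` — adapter: the local form of (H1.10) on a `k`-block union `X` (rows in `X`, sources controlled on `X`; p27's
  announced shape) implies (H1.10).
* §10 (v1.1) THE `_gen` FAMILY for depth-restricted providers ([6] p. 573 *"with the same restrictions on x"*; r01 g26's SHAPE NOTE for the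
  (2.23)-regular members `BIJ85NeumannPropagatorRegularDecay`/`…RegularClose`): the same eight members with (H1.10″) asked only on a ROW SET
  (`X₀` for `Ω`, `X_α` for `□_α`) and with the binder `0 ≤ D`, (H1.12″) asked only on the rows `X_α` with `0 ≤ D, D_b, D_f` and the depths
  measured to `T∖□_α` (all `w ∉ □_α`), under the row hypothesis (ii″) (active cube ⟹ `x ∈ X_α`, `y ∈ □_α`, `x, y` at distance `≥ R` from
  `T∖□_α`) and at rows / entries / supports inside the row sets: `input110_kernel_gen`, `input112_kernel_gen`, **`opDecay230_gen`**,
  **`opClose231_gen`**, **`close231_kernel_gen`**, **`decay236_region_gen`**, **`decay236_gen`**, **`close235_gen`**, **`ineq238_gen`**,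
  **`Z49_gen`**, **`decay241_gen`**.
* §7 **`inputs_flat`** — NON-VACUITY: (H1.10) for `G_k(Ω₀,1^h)`/`G_k(□,1^h)` and (H1.12) for every nested pair `□ ⊆ Ω₀` of no-wrap
  torus cubes at every pure-gauge `u = 1^h`, at ONE pair of constants from `(d, ℓ, a)` — gen 17's `decay110_flat_cube_level` /
  `close112_flat_cube_level` BY NAME through §0; so every member of §1–§6 is hypothesis-free at flat `u` for that data.
* §6 **`Z49_of_inputs`** — (2.40) positivity and (4.9)_{j≥1} closed form / positivity for
  `realify((Δ_{k,loc}(u) + (A/a_k)κ′P(u_k))|_Λ)` at cubes that are `k`-block unions, symmetric `λ, ζ″`, row hypotheses on the block rows of `Λ`,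
  unit bonds meeting `Λ` inside `Ω^{(k)*}`, `u_k` small inside the `L`-blocks of `T^{(k)}` (`T₁, δ₁, σ`), `κ′ ≥ 0`, under the explicit SMALLNESS
  `(4/3)d⁴(L^{2k}θ)² + a_k²c₀e^{δ₀/2}K_d(δ₀/2)(m·e^{−2δ₀R/L^k} + e^{−(δ₀/2)R₁/L^k}) < c₀^{(2.40)}(γ₀, κ′)·(1 − σ)`.
HONEST SCOPE.  (i) NOTHING of [6] is proved here: (H1.10)/(H1.12) are HYPOTHESES on `u` (and on `X, □, Ω`); the file is the hence-step half
of the owner's item 2 (ii) at a general background.  In the tree they are THEOREMS at flat `u = 1^h` for no-wrap torus cubes nested in a box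
(gen 17 `decay110_flat_cube_level` / `close112_flat_cube_level`, whence gen 17/18's flat members and p29's `…_cwt` instances — not restated
here) and for cubes against the whole torus (r01 `B4Delta112ZeroTorusCube`, whence r18's `BIJ88Close231WholeTorusFlat`); at non-flat `u` the
KERNEL form of (1.10) is a theorem at bondwise-small fields (p34 `BIJ88NeumannPropagatorSmallFieldRegion.decay_kernel_smallField_region`,
every `k`-block union) but the `k`-UNIFORM `‖f‖_∞` form (H1.10) and any non-flat (H1.12) are NOT in the tree (p34 2026-08-22T23:53Z:
successor-sized; r01's `BIJ85NeumannPropagatorRegularDecay` gives (H1.10)-type bounds at (2.23)-regular `A` on rows deep inside big-block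
regions — the row-restricted variant with torus-exterior depths is §10's `_gen` family (v1.1); §1–§8 ask (H1.10) on every row).  Why the kernel form is not used: in
the `Q_kGQ_kᴴ` sandwich a kernel bound `s_k²c₀e^{−…}` summed over the `L^{kd}` points of a block against the weight `L^{−kd}` of `Q_k` loses
the factor `L^{−kd}` that the `‖f‖_∞` form keeps (`‖g_{y₂}‖_∞ ≤ L^{−kd}`) — the `k`-uniformity of (2.35)/(2.36) lives in (H1.10)/(H1.12) as
stated.  (ii) Value members only (no covariant-derivative / Hölder members of (2.30)/(2.31) — p29/r18/p30's department; their inputs would be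
the derivative shapes of gen 17 §4).  (iii) Fine level `j = 0`, unit-lattice level `k` with `1 ≤ k`, `0 + k ≤ m + K` (§3–§5; `+1` in §6 for the
`L`-blocks of `P(u_k)`); `A = α_kL^{kd}` (`α_k = a_k s_k^{−2}`, pv07's `B1RG242Torus.α`) from §3 on, `c′` arbitrary in §1–§4 and `ε^{−1}` in
§5–§6; complex sources; explicit constants for print's one-letter `c` (p02's two-constant reading of (2.38), HOME/GAPS.md G-C2-06).  (iv) The
row hypotheses (i)–(iii), the multiplicity `m`/set `S` and the radii are properties of the DATA `cube, λ, ζ″` exactly as in gen 17/18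
(discharged for the printed torus data by p29's `BIJ88LocWeights227Torus.rowHyp_i/ii/iii`, `card_activeLabels_le` and
`BIJ88Ineq238FlatCwtTorus.rowHyps_of_deep` — those discharges do not depend on `u` and apply verbatim to the members below).  (v) In (2.38)
print's `ce_k²p(e_k)²` is read as the plaquette term `(4/3)d⁴(L^{2k}θ)²` of p11's general-background (7.3.2) (`L^{2k}θ` = the `k`-block-scale
field strength; at (2.33)-regular `u`, `|F| < p(e_k)`, it is `O(e_kp(e_k))`) plus the (2.35) error; the smallness of §6 is the located form of
*"by (2.38), C^{(k)}_Λ(u)^{−1} is bounded below"* (small plaquettes, rows deep inside `Ω`, radii `≫ L^k`).  (vi) §6's bond-smallness of `u_k`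
inside the `L`-blocks of `T^{(k)}` (`T₁, δ₁`) is the hypothesis of §7's `Z49_smallField_eq` (p33's bondwise regime one level up), displayed.
Imports: gen 18's `BIJ88Ineq238FlatTorus` (→ gen 17 `BIJ88DeltaLocFlatClose235` → `BIJ88NeumannPropagatorFlatClose231`, p02 `BIJ88Ineq238Proof`),
this seat's `BIJ85Ineq732SmallFieldRegion` (p344913) and `BIJ88Decay241SmallFieldTorus` (§7, p344337).  Literature + Mathlib only.  Unit
`lit-balaban-p31` (literature-prover-lit-balaban-p31-g20-0), 2026-08-23.  v1.1 = v1 (p345856) + §8 (row C2.Eq2.41), §9 (adapter) and §10 (the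
row-restricted `_gen` family) appended and this docstring's §8–§10 lines; every v1 declaration byte-identical.  NOT summit progress.
-/

open scoped BigOperators Matrix ComplexConjugate
open Finset Matrix

namespace Literature.MathematicalPhysics.QuantumFieldTheory.BalabanImbrieJaffe1984to88.BIJ88DeltaLocClose235General

open Literature.MathematicalPhysics.QuantumFieldTheory.Balaban1983to89
open BIJ88Sect3Statements (U1 toC)
open BIJ85BlockAveragesTorus BIJ85BlockAveragesTorusK
open BIJ88NeumannPropagator227Torus
open BIJ88DeltaLoc234Torus (gTilde gLocT gTilde_apply gLocT_apply qMatT qMatT_apply deltaLocT deltaRegion)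
open BIJ88NeumannPropagatorFlatClose231 (gLocT_sub_eq gLocT_mulVec_apply gLocT_sub_mulVec_apply abs_lam_le_one norm_rowSource_le
  rowSource_ne_zero)
open BIJ88DeltaLocFlatClose235 (blockLower_le_T exp_blockLower_level_le norm_conj_qMatT_le conj_qMatT_ne_zero norm_qMq_apply_le
  scale_identity norm_coe_mul_one_apply deltaRegion_apply deltaLocT_apply deltaLocT_sub_deltaRegion_apply)

noncomputable section

variable {P : Params}

/-! ## §0 The two input shapes: weakening the constants, kernel entries -/

section Inputs

/-- kernel: `e^{−δ′E} ≤ e^{−δE}` for `δ ≤ δ′`, `E ≥ 0`. [folklore] -/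
private theorem exp_le_exp_of_rate {δ δ' E : ℝ} (hδ : δ ≤ δ') (hE : 0 ≤ E) : Real.exp (-(δ' * E)) ≤ Real.exp (-(δ * E)) :=
  Real.exp_le_exp.2 (neg_le_neg (mul_le_mul_of_nonneg_right hδ hE))

/-- kernel: `e^{−δ′E₊} ≤ e^{−δE}` for `0 ≤ δ ≤ δ′`, `E ≤ E₊`, `0 ≤ E₊`. [folklore] -/
private theorem exp_le_exp_of_rate_of_le {δ δ' E E' : ℝ} (hδ0 : 0 ≤ δ) (hδ : δ ≤ δ') (hE : E ≤ E') (hE' : 0 ≤ E') :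
    Real.exp (-(δ' * E')) ≤ Real.exp (-(δ * E)) :=
  Real.exp_le_exp.2 (neg_le_neg ((mul_le_mul_of_nonneg_left hE hδ0).trans (mul_le_mul_of_nonneg_right hδ hE')))

/-- **(H1.10) is monotone in its constants**: the shape at `(δ′, c′)` (`c′ ≥ 0`) implies the shape at any `0 ≤ δ ≤ δ′`, `c ≥ c′` — how a
provider of the two inputs with different constants meets the common pair `(min δ, max c)` asked below.
[cite: Balaban1983RegularityDecay, (1.10) p.573] -/
theorem input110_mono {k : ℕ} {A c' : ℝ} {U : GaugeField P 0 U1} {X : Finset (Balaban1983to89.Site P 0)} {δ δ' c c₀' : ℝ}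
    (hδ0 : 0 ≤ δ) (hδ : δ ≤ δ') (hc0 : 0 ≤ c₀') (hc : c₀' ≤ c)
    (hG : ∀ (x : Balaban1983to89.Site P 0) (f : Balaban1983to89.Site P 0 → ℂ) (F D : ℝ), (∀ y, ‖f y‖ ≤ F) →
      (∀ y, f y ≠ 0 → D ≤ B5Ineq137Torus.T P 0 x y) →
      ‖(gBox A c' U k X *ᵥ f) x‖ ≤ P.spacing k ^ 2 * (c₀' * Real.exp (-(δ' * (((P.L : ℝ) ^ k)⁻¹ * D))) * F))
    (x : Balaban1983to89.Site P 0) (f : Balaban1983to89.Site P 0 → ℂ) (F D : ℝ) (hF : ∀ y, ‖f y‖ ≤ F)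
    (hsupp : ∀ y, f y ≠ 0 → D ≤ B5Ineq137Torus.T P 0 x y) :
    ‖(gBox A c' U k X *ᵥ f) x‖ ≤ P.spacing k ^ 2 * (c * Real.exp (-(δ * (((P.L : ℝ) ^ k)⁻¹ * D))) * F) := by
  have hF0 : 0 ≤ F := (norm_nonneg _).trans (hF x)
  have hL : 0 ≤ ((P.L : ℝ) ^ k)⁻¹ := inv_nonneg.2 (pow_nonneg P.cast_L_pos.le _)
  have h1 := hG x f F (max D 0) hF fun y hy => max_le (hsupp y hy) (B5Ineq137Torus.T_nonneg P 0 x y)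
  refine h1.trans (mul_le_mul_of_nonneg_left (mul_le_mul_of_nonneg_right (mul_le_mul hc
    (exp_le_exp_of_rate_of_le hδ0 hδ (mul_le_mul_of_nonneg_left (le_max_left D 0) hL) (mul_nonneg hL (le_max_right D 0)))
    (Real.exp_nonneg _) (hc0.trans hc)) hF0) (sq_nonneg _))

/-- **(H1.12) is monotone in its constants** (same weakening; the reals `D, D_b, D_f` of the shape are arbitrary, the hypothesis is used
at their positive parts). [cite: Balaban1983RegularityDecay, (1.11)–(1.12) p.573] -/
theorem input112_mono {k : ℕ} {A c' : ℝ} {U : GaugeField P 0 U1} {B X : Finset (Balaban1983to89.Site P 0)} {δ δ' c c₀' : ℝ}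
    (hδ0 : 0 ≤ δ) (hδ : δ ≤ δ') (hc0 : 0 ≤ c₀') (hc : c₀' ≤ c)
    (hC : ∀ x ∈ B, ∀ (f : Balaban1983to89.Site P 0 → ℂ) (F D Db Df : ℝ), (∀ y, ‖f y‖ ≤ F) → (∀ y, y ∉ B → f y = 0) →
      (∀ y, f y ≠ 0 → D ≤ B5Ineq137Torus.T P 0 x y) → (∀ w ∈ X, w ∉ B → Db ≤ B5Ineq137Torus.T P 0 x w) →
      (∀ y, f y ≠ 0 → ∀ w ∈ X, w ∉ B → Df ≤ B5Ineq137Torus.T P 0 y w) →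
      ‖(gBox A c' U k B *ᵥ f) x - (gBox A c' U k X *ᵥ f) x‖ ≤
        P.spacing k ^ 2 * (c₀' * Real.exp (-(δ' * (((P.L : ℝ) ^ k)⁻¹ * D))) * Real.exp (-(δ' * (((P.L : ℝ) ^ k)⁻¹ * (Db + Df)))) * F))
    (x : Balaban1983to89.Site P 0) (hx : x ∈ B) (f : Balaban1983to89.Site P 0 → ℂ) (F D Db Df : ℝ) (hF : ∀ y, ‖f y‖ ≤ F)
    (hfs : ∀ y, y ∉ B → f y = 0) (hsD : ∀ y, f y ≠ 0 → D ≤ B5Ineq137Torus.T P 0 x y)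
    (hsDb : ∀ w ∈ X, w ∉ B → Db ≤ B5Ineq137Torus.T P 0 x w) (hsDf : ∀ y, f y ≠ 0 → ∀ w ∈ X, w ∉ B → Df ≤ B5Ineq137Torus.T P 0 y w) :
    ‖(gBox A c' U k B *ᵥ f) x - (gBox A c' U k X *ᵥ f) x‖ ≤
      P.spacing k ^ 2 * (c * Real.exp (-(δ * (((P.L : ℝ) ^ k)⁻¹ * D))) * Real.exp (-(δ * (((P.L : ℝ) ^ k)⁻¹ * (Db + Df)))) * F) := by
  have hF0 : 0 ≤ F := (norm_nonneg _).trans (hF x)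
  have hL : 0 ≤ ((P.L : ℝ) ^ k)⁻¹ := inv_nonneg.2 (pow_nonneg P.cast_L_pos.le _)
  have h1 := hC x hx f F (max D 0) (max Db 0) (max Df 0) hF hfs (fun y hy => max_le (hsD y hy) (B5Ineq137Torus.T_nonneg P 0 x y))
    (fun w hw hw' => max_le (hsDb w hw hw') (B5Ineq137Torus.T_nonneg P 0 x w))
    (fun y hy w hw hw' => max_le (hsDf y hy w hw hw') (B5Ineq137Torus.T_nonneg P 0 y w))
  refine h1.trans (mul_le_mul_of_nonneg_left (mul_le_mul_of_nonneg_right ?_ hF0) (sq_nonneg _))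
  exact mul_le_mul (mul_le_mul hc (exp_le_exp_of_rate_of_le hδ0 hδ (mul_le_mul_of_nonneg_left (le_max_left D 0) hL)
      (mul_nonneg hL (le_max_right D 0))) (Real.exp_nonneg _) (hc0.trans hc))
    (exp_le_exp_of_rate_of_le hδ0 hδ (mul_le_mul_of_nonneg_left (add_le_add (le_max_left Db 0) (le_max_left Df 0)) hL)
      (mul_nonneg hL (add_nonneg (le_max_right Db 0) (le_max_right Df 0))))
    (Real.exp_nonneg _) (mul_nonneg (hc0.trans hc) (Real.exp_nonneg _))

/-- **(H1.10), KERNEL CONSEQUENCE**: `‖G_k(X,u;x,y)‖ ≤ s_k²·c₀e^{−δ₀|x−y|_T/L^k}` (the value member on the source `δ_y`).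
[cite: Balaban1983RegularityDecay, (1.10) p.573] -/
theorem input110_kernel {k : ℕ} {A c' : ℝ} {U : GaugeField P 0 U1} {X : Finset (Balaban1983to89.Site P 0)} {δ₀ c₀ : ℝ}
    (hG : ∀ (x : Balaban1983to89.Site P 0) (f : Balaban1983to89.Site P 0 → ℂ) (F D : ℝ), (∀ y, ‖f y‖ ≤ F) →
      (∀ y, f y ≠ 0 → D ≤ B5Ineq137Torus.T P 0 x y) →
      ‖(gBox A c' U k X *ᵥ f) x‖ ≤ P.spacing k ^ 2 * (c₀ * Real.exp (-(δ₀ * (((P.L : ℝ) ^ k)⁻¹ * D))) * F))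
    (x y : Balaban1983to89.Site P 0) :
    ‖gBox A c' U k X x y‖ ≤ P.spacing k ^ 2 * (c₀ * Real.exp (-(δ₀ * (((P.L : ℝ) ^ k)⁻¹ * B5Ineq137Torus.T P 0 x y)))) := by
  have h1 := hG x (Pi.single y 1) 1 (B5Ineq137Torus.T P 0 x y) (fun z => by by_cases hz : z = y <;> simp [hz])
    (fun z hz => by
      by_cases hzy : z = y
      · rw [hzy]
      · exact absurd (by simp [hzy]) hz)
  rwa [mulVec_single_one, col_apply, mul_one] at h1

/-- **(H1.12), KERNEL CONSEQUENCE**: for `x, y ∈ □` and `R_x, R_y` dominated by the sup-torus distances from `x`, resp. `y`, to `Ω∖□`: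
`‖G_k(□,u;x,y) − G_k(Ω,u;x,y)‖ ≤ s_k²·c₀e^{−δ₀|x−y|_T/L^k}e^{−δ₀(R_x+R_y)/L^k}`. [cite: Balaban1983RegularityDecay, (1.11)–(1.12) p.573] -/
theorem input112_kernel {k : ℕ} {A c' : ℝ} {U : GaugeField P 0 U1} {B X : Finset (Balaban1983to89.Site P 0)} {δ₀ c₀ : ℝ}
    (hC : ∀ x ∈ B, ∀ (f : Balaban1983to89.Site P 0 → ℂ) (F D Db Df : ℝ), (∀ y, ‖f y‖ ≤ F) → (∀ y, y ∉ B → f y = 0) →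
      (∀ y, f y ≠ 0 → D ≤ B5Ineq137Torus.T P 0 x y) → (∀ w ∈ X, w ∉ B → Db ≤ B5Ineq137Torus.T P 0 x w) →
      (∀ y, f y ≠ 0 → ∀ w ∈ X, w ∉ B → Df ≤ B5Ineq137Torus.T P 0 y w) →
      ‖(gBox A c' U k B *ᵥ f) x - (gBox A c' U k X *ᵥ f) x‖ ≤
        P.spacing k ^ 2 * (c₀ * Real.exp (-(δ₀ * (((P.L : ℝ) ^ k)⁻¹ * D))) * Real.exp (-(δ₀ * (((P.L : ℝ) ^ k)⁻¹ * (Db + Df)))) * F))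
    {x y : Balaban1983to89.Site P 0} (hx : x ∈ B) (hy : y ∈ B) (Rx Ry : ℝ)
    (hR : ∀ w ∈ X, w ∉ B → Rx ≤ B5Ineq137Torus.T P 0 x w ∧ Ry ≤ B5Ineq137Torus.T P 0 y w) :
    ‖gBox A c' U k B x y - gBox A c' U k X x y‖ ≤
      P.spacing k ^ 2 * (c₀ * Real.exp (-(δ₀ * (((P.L : ℝ) ^ k)⁻¹ * B5Ineq137Torus.T P 0 x y))) *
        Real.exp (-(δ₀ * (((P.L : ℝ) ^ k)⁻¹ * (Rx + Ry))))) := by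
  have h1 := hC x hx (Pi.single y 1) 1 (B5Ineq137Torus.T P 0 x y) Rx Ry (fun z => by by_cases hz : z = y <;> simp [hz])
    (fun z hz => by
      by_cases hzy : z = y
      · exact absurd (hzy ▸ hy) hz
      · simp [hzy])
    (fun z hz => by
      by_cases hzy : z = y
      · rw [hzy]
      · exact absurd (by simp [hzy]) hz)
    (fun w hw hw' => (hR w hw hw').1)
    (fun z hz w hw hw' => by
      by_cases hzy : z = y
      · rw [hzy]; exact (hR w hw hw').2
      · exact absurd (by simp [hzy]) hz)
  rwa [mulVec_single_one, mulVec_single_one, col_apply, col_apply, mul_one] at h1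

end Inputs

/-! ## §1 (2.30), operator form, at an arbitrary background -/

section OpDecay230

/-- **(2.30), OPERATOR FORM, AT AN ARBITRARY BACKGROUND `u`, FROM (H1.10) FOR THE CUBES** (p. 263: *"|(G_{k,loc}(u)f)(x)| ≦
ce^{−c dist(suppt f,x)}‖f‖_∞, (2.30) … We assume that u is smooth in the □_α's entering the sum in (2.27)"*): for any finite family of sets
`□_α`, weights `Σ_α|λ_α| ≤ 1`, cut-off `|ζ″| ≤ 1` (gen 15's DATA of `gLocT`), if every `G_k(□_α,u)` satisfies (H1.10) at `(δ₀, c₀)`, then for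
every row `x`, every `f` with `‖f‖ ≤ F` supported at sup-torus distance `≥ D` from `x` and every finite `S ∋` the cubes active on the row of `x`
against `supp f`:  `‖(G_{k,loc}(u)f)(x)‖ ≤ s_k²·#S·c₀e^{−δ₀D/L^k}·F` — gen 17's `opDecay230_flat_level` with `1^h ↦ u`
(`(G_{k,loc}f)(x) = Σ_α(G_k(□_α)g_α)(x)`, `g_α = ζ″(x,·)λ_α(x,·)f`, `gLocT_mulVec_apply`). [cite: BalabanImbrieJaffe1988, (2.30) p.263] -/
theorem opDecay230_of_input {k : ℕ} (A c' : ℝ) (U : GaugeField P 0 U1) {ι : Type*} [Fintype ι]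
    (cube : ι → Finset (Balaban1983to89.Site P 0)) {lam : ι → Balaban1983to89.Site P 0 → Balaban1983to89.Site P 0 → ℝ}
    {ζ'' : Balaban1983to89.Site P 0 → Balaban1983to89.Site P 0 → ℝ} (hlam : ∀ x y, ∑ α, |lam α x y| ≤ 1) (hζ : ∀ x y, |ζ'' x y| ≤ 1)
    {δ₀ c₀ : ℝ}
    (hG : ∀ α (x : Balaban1983to89.Site P 0) (f : Balaban1983to89.Site P 0 → ℂ) (F D : ℝ), (∀ y, ‖f y‖ ≤ F) →
      (∀ y, f y ≠ 0 → D ≤ B5Ineq137Torus.T P 0 x y) →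
      ‖(gBox A c' U k (cube α) *ᵥ f) x‖ ≤ P.spacing k ^ 2 * (c₀ * Real.exp (-(δ₀ * (((P.L : ℝ) ^ k)⁻¹ * D))) * F))
    (x : Balaban1983to89.Site P 0) (f : Balaban1983to89.Site P 0 → ℂ) (F D : ℝ) (hF : ∀ y, ‖f y‖ ≤ F)
    (hsupp : ∀ y, f y ≠ 0 → D ≤ B5Ineq137Torus.T P 0 x y) (S : Finset ι) (hS : ∀ α y, ζ'' x y * lam α x y ≠ 0 → f y ≠ 0 → α ∈ S) :
    ‖(gLocT A c' U k cube lam ζ'' *ᵥ f) x‖ ≤ P.spacing k ^ 2 * (S.card * (c₀ * Real.exp (-(δ₀ * (((P.L : ℝ) ^ k)⁻¹ * D))) * F)) := by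
  have hF0 : 0 ≤ F := (norm_nonneg _).trans (hF x)
  rw [gLocT_mulVec_apply]
  have hterm : ∀ α, ‖(gBox A c' U k (cube α) *ᵥ fun y => (ζ'' x y : ℂ) * (lam α x y : ℂ) * f y) x‖ ≤
      P.spacing k ^ 2 * (c₀ * Real.exp (-(δ₀ * (((P.L : ℝ) ^ k)⁻¹ * D))) * F) := fun α =>
    hG α x _ F D (fun y => norm_rowSource_le (hζ x y) (abs_lam_le_one hlam α x y) hF y) (fun y hy => hsupp y (rowSource_ne_zero hy).2)
  have hzero : ∀ α, α ∉ S → (gBox A c' U k (cube α) *ᵥ fun y => (ζ'' x y : ℂ) * (lam α x y : ℂ) * f y) x = 0 := by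
    intro α hα
    have h0 : (fun y => (ζ'' x y : ℂ) * (lam α x y : ℂ) * f y) = 0 := by
      funext y
      by_contra hne
      exact hα (hS α y (rowSource_ne_zero hne).1 (rowSource_ne_zero hne).2)
    rw [h0, mulVec_zero, Pi.zero_apply]
  rw [← Finset.sum_subset (Finset.subset_univ S) (fun α _ hα => hzero α hα)]
  calc ‖∑ α ∈ S, (gBox A c' U k (cube α) *ᵥ fun y => (ζ'' x y : ℂ) * (lam α x y : ℂ) * f y) x‖
      ≤ ∑ α ∈ S, ‖(gBox A c' U k (cube α) *ᵥ fun y => (ζ'' x y : ℂ) * (lam α x y : ℂ) * f y) x‖ := norm_sum_le _ _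
    _ ≤ ∑ α ∈ S, P.spacing k ^ 2 * (c₀ * Real.exp (-(δ₀ * (((P.L : ℝ) ^ k)⁻¹ * D))) * F) := Finset.sum_le_sum fun α _ => hterm α
    _ = P.spacing k ^ 2 * (S.card * (c₀ * Real.exp (-(δ₀ * (((P.L : ℝ) ^ k)⁻¹ * D))) * F)) := by
        rw [Finset.sum_const, nsmul_eq_mul]; ring

end OpDecay230

/-! ## §2 (2.31), operator and kernel forms, at an arbitrary background -/

section Close231

/-- **(2.31), OPERATOR FORM, AT AN ARBITRARY BACKGROUND `u`, FROM (H1.12) FOR THE PAIRS `□_α ⊆ Ω` AND (H1.10) FOR `Ω`** (p. 263: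
*"|(G_{k,loc}(u)f − G_k(Ω,u)f)(x)| ≦ e^{−cr(e_k)}e^{−c dist(suppt f,x)}‖f‖_∞, (2.31) for dist(x,Ω^c) ≧ O(r(e_k)). [Each G_k(□_α,u) is close
to G_k(Ω,u) for the relevant x₁, x₂, therefore the convex combination and G_{k,loc} are close also.] … for (2.31) we assume smoothness
throughout the subset Ω ⊂ T_η"*): weights `Σ_α|λ_α| ≤ 1`, cut-off `0 ≤ ζ″ ≤ 1`; ON THE ROW OF `x`: (i) `ζ″(x,y) ≠ 0 ⟹ Σ_αλ_α(x,y) = 1`,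
(ii) every active cube (`ζ″(x,y)λ_α(x,y) ≠ 0`) contains `x` and `y` at sup-torus distance `≥ R` from `Ω∖□_α`, (iii) `|x−y|_T ≤ R₁ ⟹
ζ″(x,y) = 1`; then for `f` with `‖f‖ ≤ F` supported at distance `≥ D ≥ 0` from `x` and `S ∋` the active cubes of the row against `supp f`:
`‖(G_{k,loc}(u)f − G_k(Ω,u)f)(x)‖ ≤ s_k²·c₀(#S·e^{−2δ₀R/L^k} + e^{−(δ₀/2)R₁/L^k})·e^{−(δ₀/2)D/L^k}·F` — gen 17's `opClose231_flat_level`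
with `1^h ↦ u` (`gLocT_sub_mulVec_apply`: the active-cube differences by (H1.12), the tail source `(ζ″ − 1)f` beyond `max(D, R₁)` by (H1.10)).
At the printed radii `R, R₁ = r(e_k)L^k` the bracket is print's `e^{−cr(e_k)}`. [cite: BalabanImbrieJaffe1988, (2.31) p.263] -/
theorem opClose231_of_inputs {k : ℕ} (A c' : ℝ) (U : GaugeField P 0 U1) (Ω : Finset (Balaban1983to89.Site P 0)) {ι : Type*} [Fintype ι]
    (cube : ι → Finset (Balaban1983to89.Site P 0)) {lam : ι → Balaban1983to89.Site P 0 → Balaban1983to89.Site P 0 → ℝ}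
    {ζ'' : Balaban1983to89.Site P 0 → Balaban1983to89.Site P 0 → ℝ} (hlam : ∀ x y, ∑ α, |lam α x y| ≤ 1)
    (hζ : ∀ x y, 0 ≤ ζ'' x y ∧ ζ'' x y ≤ 1) {δ₀ c₀ : ℝ} (hδ₀ : 0 ≤ δ₀) (hc₀ : 0 ≤ c₀)
    (hGΩ : ∀ (x : Balaban1983to89.Site P 0) (f : Balaban1983to89.Site P 0 → ℂ) (F D : ℝ), (∀ y, ‖f y‖ ≤ F) →
      (∀ y, f y ≠ 0 → D ≤ B5Ineq137Torus.T P 0 x y) →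
      ‖(gBox A c' U k Ω *ᵥ f) x‖ ≤ P.spacing k ^ 2 * (c₀ * Real.exp (-(δ₀ * (((P.L : ℝ) ^ k)⁻¹ * D))) * F))
    (hC : ∀ α, ∀ x ∈ cube α, ∀ (f : Balaban1983to89.Site P 0 → ℂ) (F D Db Df : ℝ), (∀ y, ‖f y‖ ≤ F) → (∀ y, y ∉ cube α → f y = 0) →
      (∀ y, f y ≠ 0 → D ≤ B5Ineq137Torus.T P 0 x y) → (∀ w ∈ Ω, w ∉ cube α → Db ≤ B5Ineq137Torus.T P 0 x w) →
      (∀ y, f y ≠ 0 → ∀ w ∈ Ω, w ∉ cube α → Df ≤ B5Ineq137Torus.T P 0 y w) →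
      ‖(gBox A c' U k (cube α) *ᵥ f) x - (gBox A c' U k Ω *ᵥ f) x‖ ≤
        P.spacing k ^ 2 * (c₀ * Real.exp (-(δ₀ * (((P.L : ℝ) ^ k)⁻¹ * D))) * Real.exp (-(δ₀ * (((P.L : ℝ) ^ k)⁻¹ * (Db + Df)))) * F))
    (x : Balaban1983to89.Site P 0) {R R₁ : ℝ} (hcomp : ∀ y, ζ'' x y ≠ 0 → ∑ α, lam α x y = 1)
    (hdeep : ∀ α y, ζ'' x y * lam α x y ≠ 0 → x ∈ cube α ∧ y ∈ cube α ∧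
      ∀ w ∈ Ω, w ∉ cube α → R ≤ B5Ineq137Torus.T P 0 x w ∧ R ≤ B5Ineq137Torus.T P 0 y w)
    (hcut : ∀ y, B5Ineq137Torus.T P 0 x y ≤ R₁ → ζ'' x y = 1)
    (f : Balaban1983to89.Site P 0 → ℂ) {F D : ℝ} (hF : ∀ y, ‖f y‖ ≤ F) (hD : 0 ≤ D) (hsupp : ∀ y, f y ≠ 0 → D ≤ B5Ineq137Torus.T P 0 x y)
    (S : Finset ι) (hS : ∀ α y, ζ'' x y * lam α x y ≠ 0 → f y ≠ 0 → α ∈ S) :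
    ‖(gLocT A c' U k cube lam ζ'' *ᵥ f) x - (gBox A c' U k Ω *ᵥ f) x‖ ≤
      P.spacing k ^ 2 * (c₀ * (S.card * Real.exp (-(δ₀ * (((P.L : ℝ) ^ k)⁻¹ * (2 * R)))) + Real.exp (-(δ₀ / 2 * (((P.L : ℝ) ^ k)⁻¹ * R₁)))) *
        Real.exp (-(δ₀ / 2 * (((P.L : ℝ) ^ k)⁻¹ * D))) * F) := by
  have hε : 0 < ((P.L : ℝ) ^ k)⁻¹ := inv_pos.mpr (pow_pos P.cast_L_pos _)
  have hF0 : 0 ≤ F := (norm_nonneg _).trans (hF x)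
  have hs0 : 0 ≤ P.spacing k ^ 2 := sq_nonneg _
  have hζ1 : ∀ y, |ζ'' x y| ≤ 1 := fun y => abs_le.2 ⟨by linarith [(hζ x y).1], (hζ x y).2⟩
  set G0 := gBox A c' U k Ω with hG0def
  rw [gLocT_sub_mulVec_apply _ _ _ _ cube lam ζ'' G0 f x hcomp]
  set B := P.spacing k ^ 2 * (c₀ * Real.exp (-(δ₀ * (((P.L : ℝ) ^ k)⁻¹ * D))) * Real.exp (-(δ₀ * (((P.L : ℝ) ^ k)⁻¹ * (R + R)))) * F)
    with hBdef
  have hB0 : 0 ≤ B := by positivity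
  have hterm : ∀ α, ‖((gBox A c' U k (cube α) - G0) *ᵥ fun y => (ζ'' x y : ℂ) * (lam α x y : ℂ) * f y) x‖ ≤ B := by
    intro α
    by_cases hex : ∃ y, ζ'' x y * lam α x y ≠ 0
    · obtain ⟨y₀, hy₀⟩ := hex
      obtain ⟨hxα, -, hwx⟩ := hdeep α y₀ hy₀
      have hyα : ∀ y, (ζ'' x y : ℂ) * (lam α x y : ℂ) * f y ≠ 0 → y ∈ cube α :=
        fun y hy => (hdeep α y (rowSource_ne_zero hy).1).2.1
      have hwy : ∀ y, (ζ'' x y : ℂ) * (lam α x y : ℂ) * f y ≠ 0 → ∀ w ∈ Ω, w ∉ cube α → R ≤ B5Ineq137Torus.T P 0 y w :=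
        fun y hy w hw hw' => ((hdeep α y (rowSource_ne_zero hy).1).2.2 w hw hw').2
      rw [Matrix.sub_mulVec, Pi.sub_apply]
      exact hC α x hxα _ F D R R (fun y => norm_rowSource_le (hζ1 y) (abs_lam_le_one hlam α x y) hF y)
        (fun y hy => by by_contra hne; exact hy (hyα y hne)) (fun y hy => hsupp y (rowSource_ne_zero hy).2)
        (fun w hw hw' => (hwx w hw hw').1) hwy
    · push Not at hex
      have h0 : (fun y => (ζ'' x y : ℂ) * (lam α x y : ℂ) * f y) = 0 := by
        funext y; rw [← Complex.ofReal_mul, hex y, Complex.ofReal_zero, zero_mul]; rfl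
      rw [h0, mulVec_zero, Pi.zero_apply, norm_zero]
      exact hB0
  have hzero : ∀ α, α ∉ S → ((gBox A c' U k (cube α) - G0) *ᵥ fun y => (ζ'' x y : ℂ) * (lam α x y : ℂ) * f y) x = 0 := by
    intro α hα
    have h0 : (fun y => (ζ'' x y : ℂ) * (lam α x y : ℂ) * f y) = 0 := by
      funext y
      by_contra hne
      exact hα (hS α y (rowSource_ne_zero hne).1 (rowSource_ne_zero hne).2)
    rw [h0, mulVec_zero, Pi.zero_apply]
  have hsum : ‖∑ α, ((gBox A c' U k (cube α) - G0) *ᵥ fun y => (ζ'' x y : ℂ) * (lam α x y : ℂ) * f y) x‖ ≤ S.card * B := by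
    rw [← Finset.sum_subset (Finset.subset_univ S) (fun α _ hα => hzero α hα)]
    calc ‖∑ α ∈ S, ((gBox A c' U k (cube α) - G0) *ᵥ fun y => (ζ'' x y : ℂ) * (lam α x y : ℂ) * f y) x‖
        ≤ ∑ α ∈ S, ‖((gBox A c' U k (cube α) - G0) *ᵥ fun y => (ζ'' x y : ℂ) * (lam α x y : ℂ) * f y) x‖ := norm_sum_le _ _
      _ ≤ ∑ α ∈ S, B := Finset.sum_le_sum fun α _ => hterm α
      _ = S.card * B := by rw [Finset.sum_const, nsmul_eq_mul]
  have htail : ‖(G0 *ᵥ fun y => ((ζ'' x y : ℂ) - 1) * f y) x‖ ≤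
      P.spacing k ^ 2 * (c₀ * Real.exp (-(δ₀ * (((P.L : ℝ) ^ k)⁻¹ * max D R₁))) * F) := by
    refine hGΩ x _ F (max D R₁) (fun y => ?_) (fun y hy => ?_)
    · have hz1 : ‖(ζ'' x y : ℂ) - 1‖ ≤ 1 := by
        rw [← Complex.ofReal_one, ← Complex.ofReal_sub, Complex.norm_real, Real.norm_eq_abs, abs_le]
        constructor <;> linarith [(hζ x y).1, (hζ x y).2]
      calc ‖((ζ'' x y : ℂ) - 1) * f y‖ = ‖(ζ'' x y : ℂ) - 1‖ * ‖f y‖ := norm_mul _ _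
        _ ≤ 1 * F := mul_le_mul hz1 (hF y) (norm_nonneg _) zero_le_one
        _ = F := one_mul F
    · have hf : f y ≠ 0 := fun hf => hy (by rw [hf, mul_zero])
      have hz : ζ'' x y ≠ 1 := fun h1 => hy (by rw [h1]; push_cast; rw [sub_self, zero_mul])
      exact max_le (hsupp y hf) (le_of_lt (lt_of_not_ge fun hle => hz (hcut y hle)))
  have hεD : 0 ≤ ((P.L : ℝ) ^ k)⁻¹ * D := mul_nonneg hε.le hD
  have hsum' : (S.card : ℝ) * B ≤
      P.spacing k ^ 2 * (c₀ * (S.card * Real.exp (-(δ₀ * (((P.L : ℝ) ^ k)⁻¹ * (2 * R))))) *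
        Real.exp (-(δ₀ / 2 * (((P.L : ℝ) ^ k)⁻¹ * D))) * F) := by
    have h1 : c₀ * Real.exp (-(δ₀ * (((P.L : ℝ) ^ k)⁻¹ * D))) * Real.exp (-(δ₀ * (((P.L : ℝ) ^ k)⁻¹ * (R + R)))) * F ≤
        c₀ * Real.exp (-(δ₀ * (((P.L : ℝ) ^ k)⁻¹ * (2 * R)))) * Real.exp (-(δ₀ / 2 * (((P.L : ℝ) ^ k)⁻¹ * D))) * F := by
      rw [mul_assoc c₀, mul_comm (Real.exp _) (Real.exp _), ← mul_assoc c₀]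
      refine mul_le_mul_of_nonneg_right (mul_le_mul (mul_le_mul_of_nonneg_left ?_ hc₀) ?_ (Real.exp_pos _).le
        (by positivity)) hF0
      · rw [show R + R = 2 * R by ring]
      · exact exp_le_exp_of_rate (by linarith) hεD
    calc (S.card : ℝ) * B = P.spacing k ^ 2 * (S.card * (c₀ * Real.exp (-(δ₀ * (((P.L : ℝ) ^ k)⁻¹ * D))) *
          Real.exp (-(δ₀ * (((P.L : ℝ) ^ k)⁻¹ * (R + R)))) * F)) := by rw [hBdef]; ring
      _ ≤ P.spacing k ^ 2 * (S.card * (c₀ * Real.exp (-(δ₀ * (((P.L : ℝ) ^ k)⁻¹ * (2 * R)))) *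
          Real.exp (-(δ₀ / 2 * (((P.L : ℝ) ^ k)⁻¹ * D))) * F)) :=
          mul_le_mul_of_nonneg_left (mul_le_mul_of_nonneg_left h1 (Nat.cast_nonneg _)) hs0
      _ = _ := by ring
  have htail' : P.spacing k ^ 2 * (c₀ * Real.exp (-(δ₀ * (((P.L : ℝ) ^ k)⁻¹ * max D R₁))) * F) ≤
      P.spacing k ^ 2 * (c₀ * Real.exp (-(δ₀ / 2 * (((P.L : ℝ) ^ k)⁻¹ * R₁))) * Real.exp (-(δ₀ / 2 * (((P.L : ℝ) ^ k)⁻¹ * D))) * F) := by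
    refine mul_le_mul_of_nonneg_left (mul_le_mul_of_nonneg_right ?_ hF0) hs0
    rw [mul_assoc c₀, ← Real.exp_add]
    refine mul_le_mul_of_nonneg_left (Real.exp_le_exp.2 ?_) hc₀
    have hm1 : D ≤ max D R₁ := le_max_left _ _
    have hm2 : R₁ ≤ max D R₁ := le_max_right _ _
    have hm0 : 0 ≤ ((P.L : ℝ) ^ k)⁻¹ * max D R₁ := mul_nonneg hε.le (hD.trans hm1)
    nlinarith [mul_le_mul_of_nonneg_left hm1 hε.le, mul_le_mul_of_nonneg_left hm2 hε.le, mul_nonneg hδ₀ hm0]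
  calc ‖∑ α, ((gBox A c' U k (cube α) - G0) *ᵥ fun y => (ζ'' x y : ℂ) * (lam α x y : ℂ) * f y) x +
          (G0 *ᵥ fun y => ((ζ'' x y : ℂ) - 1) * f y) x‖
      ≤ S.card * B + P.spacing k ^ 2 * (c₀ * Real.exp (-(δ₀ * (((P.L : ℝ) ^ k)⁻¹ * max D R₁))) * F) :=
        (norm_add_le _ _).trans (add_le_add hsum htail)
    _ ≤ P.spacing k ^ 2 * (c₀ * (S.card * Real.exp (-(δ₀ * (((P.L : ℝ) ^ k)⁻¹ * (2 * R))))) *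
          Real.exp (-(δ₀ / 2 * (((P.L : ℝ) ^ k)⁻¹ * D))) * F) +
        P.spacing k ^ 2 * (c₀ * Real.exp (-(δ₀ / 2 * (((P.L : ℝ) ^ k)⁻¹ * R₁))) * Real.exp (-(δ₀ / 2 * (((P.L : ℝ) ^ k)⁻¹ * D))) * F) :=
        add_le_add hsum' htail'
    _ = _ := by ring

/-- **(2.31), KERNEL FORM, AT AN ARBITRARY BACKGROUND `u`** (the bracketed sentence of p. 263 entrywise): under the row-`x` hypotheses
(i)–(iii), for every `y`:  `‖G_{k,loc}(u;x,y) − G_k(Ω,u;x,y)‖ ≤ s_k²·c₀(e^{−2δ₀R/L^k} + e^{−(δ₀/2)R₁/L^k})·e^{−(δ₀/2)|x−y|_T/L^k}` — gen 17's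
`close231_flat_kernel_level` with `1^h ↦ u` (`gLocT_sub_eq`; the kernel consequences `input112_kernel` on the active cubes, `input110_kernel`
for `Ω` on the tail beyond `R₁`). [cite: BalabanImbrieJaffe1988, (2.31) p.263] -/
theorem close231_kernel_of_inputs {k : ℕ} (A c' : ℝ) (U : GaugeField P 0 U1) (Ω : Finset (Balaban1983to89.Site P 0))
    {ι : Type*} [Fintype ι] (cube : ι → Finset (Balaban1983to89.Site P 0))
    {lam : ι → Balaban1983to89.Site P 0 → Balaban1983to89.Site P 0 → ℝ} {ζ'' : Balaban1983to89.Site P 0 → Balaban1983to89.Site P 0 → ℝ}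
    (hlam : ∀ x y, ∑ α, |lam α x y| ≤ 1) (hζ : ∀ x y, 0 ≤ ζ'' x y ∧ ζ'' x y ≤ 1) {δ₀ c₀ : ℝ} (hδ₀ : 0 ≤ δ₀) (hc₀ : 0 ≤ c₀)
    (hGΩ : ∀ (x : Balaban1983to89.Site P 0) (f : Balaban1983to89.Site P 0 → ℂ) (F D : ℝ), (∀ y, ‖f y‖ ≤ F) →
      (∀ y, f y ≠ 0 → D ≤ B5Ineq137Torus.T P 0 x y) →
      ‖(gBox A c' U k Ω *ᵥ f) x‖ ≤ P.spacing k ^ 2 * (c₀ * Real.exp (-(δ₀ * (((P.L : ℝ) ^ k)⁻¹ * D))) * F))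
    (hC : ∀ α, ∀ x ∈ cube α, ∀ (f : Balaban1983to89.Site P 0 → ℂ) (F D Db Df : ℝ), (∀ y, ‖f y‖ ≤ F) → (∀ y, y ∉ cube α → f y = 0) →
      (∀ y, f y ≠ 0 → D ≤ B5Ineq137Torus.T P 0 x y) → (∀ w ∈ Ω, w ∉ cube α → Db ≤ B5Ineq137Torus.T P 0 x w) →
      (∀ y, f y ≠ 0 → ∀ w ∈ Ω, w ∉ cube α → Df ≤ B5Ineq137Torus.T P 0 y w) →
      ‖(gBox A c' U k (cube α) *ᵥ f) x - (gBox A c' U k Ω *ᵥ f) x‖ ≤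
        P.spacing k ^ 2 * (c₀ * Real.exp (-(δ₀ * (((P.L : ℝ) ^ k)⁻¹ * D))) * Real.exp (-(δ₀ * (((P.L : ℝ) ^ k)⁻¹ * (Db + Df)))) * F))
    (x : Balaban1983to89.Site P 0) {R R₁ : ℝ} (hcomp : ∀ y, ζ'' x y ≠ 0 → ∑ α, lam α x y = 1)
    (hdeep : ∀ α y, ζ'' x y * lam α x y ≠ 0 → x ∈ cube α ∧ y ∈ cube α ∧
      ∀ w ∈ Ω, w ∉ cube α → R ≤ B5Ineq137Torus.T P 0 x w ∧ R ≤ B5Ineq137Torus.T P 0 y w)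
    (hcut : ∀ y, B5Ineq137Torus.T P 0 x y ≤ R₁ → ζ'' x y = 1) (y : Balaban1983to89.Site P 0) :
    ‖gLocT A c' U k cube lam ζ'' x y - gBox A c' U k Ω x y‖ ≤
      P.spacing k ^ 2 * (c₀ * (Real.exp (-(δ₀ * (((P.L : ℝ) ^ k)⁻¹ * (2 * R)))) + Real.exp (-(δ₀ / 2 * (((P.L : ℝ) ^ k)⁻¹ * R₁)))) *
        Real.exp (-(δ₀ / 2 * (((P.L : ℝ) ^ k)⁻¹ * B5Ineq137Torus.T P 0 x y)))) := by
  have hε : 0 < ((P.L : ℝ) ^ k)⁻¹ := inv_pos.mpr (pow_pos P.cast_L_pos _)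
  have hs0 : 0 ≤ P.spacing k ^ 2 := sq_nonneg _
  set Txy := B5Ineq137Torus.T P 0 x y with hTdef
  have hT0 : 0 ≤ Txy := B5Ineq137Torus.T_nonneg P 0 x y
  set G0 := gBox A c' U k Ω with hG0def
  -- the entry of the region propagator ((H1.10), kernel consequence)
  have hG0 : ‖G0 x y‖ ≤ P.spacing k ^ 2 * (c₀ * Real.exp (-(δ₀ * (((P.L : ℝ) ^ k)⁻¹ * Txy)))) := input110_kernel hGΩ x y
  -- the active cubes are close to the region propagator at (x,y) ((H1.12), kernel consequence)
  have hGa : ∀ α, ζ'' x y * lam α x y ≠ 0 → ‖gBox A c' U k (cube α) x y - G0 x y‖ ≤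
      P.spacing k ^ 2 * (c₀ * Real.exp (-(δ₀ * (((P.L : ℝ) ^ k)⁻¹ * Txy))) * Real.exp (-(δ₀ * (((P.L : ℝ) ^ k)⁻¹ * (R + R))))) := by
    intro α hα
    obtain ⟨hxα, hyα, hw⟩ := hdeep α y hα
    exact input112_kernel (hC α) hxα hyα R R hw
  rw [gLocT_sub_eq _ _ _ _ cube lam ζ'' G0 (hcomp y)]
  -- term 1: the convex combination of the differences
  set B := P.spacing k ^ 2 * (c₀ * Real.exp (-(δ₀ * (((P.L : ℝ) ^ k)⁻¹ * Txy))) * Real.exp (-(δ₀ * (((P.L : ℝ) ^ k)⁻¹ * (R + R)))))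
    with hBdef
  have hB0 : 0 ≤ B := by positivity
  have h1 : ‖(ζ'' x y : ℂ) * ∑ α, (lam α x y : ℂ) * (gBox A c' U k (cube α) x y - G0 x y)‖ ≤ B := by
    have hz1 : |ζ'' x y| ≤ 1 := abs_le.2 ⟨by linarith [(hζ x y).1], (hζ x y).2⟩
    calc ‖(ζ'' x y : ℂ) * ∑ α, (lam α x y : ℂ) * (gBox A c' U k (cube α) x y - G0 x y)‖
        ≤ |ζ'' x y| * ∑ α, |lam α x y| * ‖gBox A c' U k (cube α) x y - G0 x y‖ := by
            rw [norm_mul, Complex.norm_real, Real.norm_eq_abs]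
            refine mul_le_mul_of_nonneg_left ((norm_sum_le _ _).trans (Finset.sum_le_sum fun α _ => ?_)) (abs_nonneg _)
            rw [norm_mul, Complex.norm_real, Real.norm_eq_abs]
      _ = ∑ α, |ζ'' x y * lam α x y| * ‖gBox A c' U k (cube α) x y - G0 x y‖ := by
            rw [Finset.mul_sum]
            exact Finset.sum_congr rfl fun α _ => by rw [abs_mul, mul_assoc]
      _ ≤ ∑ α, |ζ'' x y * lam α x y| * B := Finset.sum_le_sum fun α _ => by
            by_cases hα : ζ'' x y * lam α x y = 0
            · rw [hα, abs_zero, zero_mul, zero_mul]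
            · exact mul_le_mul_of_nonneg_left (hGa α hα) (abs_nonneg _)
      _ = |ζ'' x y| * (∑ α, |lam α x y|) * B := by
            rw [Finset.mul_sum, Finset.sum_mul]
            exact Finset.sum_congr rfl fun α _ => by rw [abs_mul]
      _ ≤ 1 * 1 * B := mul_le_mul_of_nonneg_right
            (mul_le_mul hz1 (hlam x y) (Finset.sum_nonneg fun α _ => abs_nonneg _) zero_le_one) hB0
      _ = B := by ring
  -- term 2: the tail of the region propagator beyond `R₁`
  have h2 : ‖((ζ'' x y : ℂ) - 1) * G0 x y‖ ≤
      P.spacing k ^ 2 * (c₀ * Real.exp (-(δ₀ / 2 * (((P.L : ℝ) ^ k)⁻¹ * R₁))) * Real.exp (-(δ₀ / 2 * (((P.L : ℝ) ^ k)⁻¹ * Txy)))) := by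
    by_cases hT1 : Txy ≤ R₁
    · rw [hcut y hT1]
      push_cast
      rw [sub_self, zero_mul, norm_zero]
      positivity
    · rw [not_le] at hT1
      have hz1 : ‖(ζ'' x y : ℂ) - 1‖ ≤ 1 := by
        rw [← Complex.ofReal_one, ← Complex.ofReal_sub, Complex.norm_real, Real.norm_eq_abs, abs_le]
        constructor <;> linarith [(hζ x y).1, (hζ x y).2]
      calc ‖((ζ'' x y : ℂ) - 1) * G0 x y‖ = ‖(ζ'' x y : ℂ) - 1‖ * ‖G0 x y‖ := norm_mul _ _
        _ ≤ 1 * (P.spacing k ^ 2 * (c₀ * Real.exp (-(δ₀ * (((P.L : ℝ) ^ k)⁻¹ * Txy))))) :=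
            mul_le_mul hz1 hG0 (norm_nonneg _) zero_le_one
        _ ≤ P.spacing k ^ 2 * (c₀ * Real.exp (-(δ₀ / 2 * (((P.L : ℝ) ^ k)⁻¹ * R₁))) * Real.exp (-(δ₀ / 2 * (((P.L : ℝ) ^ k)⁻¹ * Txy)))) := by
            rw [one_mul, mul_assoc c₀, ← Real.exp_add]
            refine mul_le_mul_of_nonneg_left (mul_le_mul_of_nonneg_left (Real.exp_le_exp.2 ?_) hc₀) hs0
            have : ((P.L : ℝ) ^ k)⁻¹ * R₁ ≤ ((P.L : ℝ) ^ k)⁻¹ * Txy := mul_le_mul_of_nonneg_left hT1.le hε.le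
            nlinarith
  -- assemble
  have hεT : 0 ≤ ((P.L : ℝ) ^ k)⁻¹ * Txy := mul_nonneg hε.le hT0
  have h1' : B ≤ P.spacing k ^ 2 * (c₀ * Real.exp (-(δ₀ * (((P.L : ℝ) ^ k)⁻¹ * (2 * R)))) *
      Real.exp (-(δ₀ / 2 * (((P.L : ℝ) ^ k)⁻¹ * Txy)))) := by
    rw [hBdef, mul_assoc c₀, mul_assoc c₀, mul_comm (Real.exp (-(δ₀ * (((P.L : ℝ) ^ k)⁻¹ * Txy)))) (Real.exp _)]
    refine mul_le_mul_of_nonneg_left (mul_le_mul_of_nonneg_left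
      (mul_le_mul ?_ ?_ (Real.exp_pos _).le (Real.exp_pos _).le) hc₀) hs0
    · rw [show R + R = 2 * R by ring]
    · exact exp_le_exp_of_rate (by linarith) hεT
  calc ‖(ζ'' x y : ℂ) * ∑ α, (lam α x y : ℂ) * (gBox A c' U k (cube α) x y - G0 x y) + ((ζ'' x y : ℂ) - 1) * G0 x y‖
      ≤ B + P.spacing k ^ 2 * (c₀ * Real.exp (-(δ₀ / 2 * (((P.L : ℝ) ^ k)⁻¹ * R₁))) * Real.exp (-(δ₀ / 2 * (((P.L : ℝ) ^ k)⁻¹ * Txy)))) :=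
        (norm_add_le _ _).trans (add_le_add h1 h2)
    _ ≤ P.spacing k ^ 2 * (c₀ * Real.exp (-(δ₀ * (((P.L : ℝ) ^ k)⁻¹ * (2 * R)))) * Real.exp (-(δ₀ / 2 * (((P.L : ℝ) ^ k)⁻¹ * Txy)))) +
        P.spacing k ^ 2 * (c₀ * Real.exp (-(δ₀ / 2 * (((P.L : ℝ) ^ k)⁻¹ * R₁))) * Real.exp (-(δ₀ / 2 * (((P.L : ℝ) ^ k)⁻¹ * Txy)))) :=
        add_le_add h1' le_rfl
    _ = _ := by ring

end Close231

/-! ## §3 (2.36) at an arbitrary background: the kernels of `Δ_k(Ω,u)` and `Δ_{k,loc}(u)` in the printed unit-lattice distance -/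

section Decay236

/-- **(2.36) FOR THE REGION FORM `Δ_k(Ω,u)` AT AN ARBITRARY BACKGROUND, FROM (H1.10) FOR `Ω`** (the comparison object of (2.35), [I]
(4.6.4); print's `|Δ(x₁,x₂)| ≤ ce^{−c|x₁−x₂|}` shape): for `A = α_kL^{kd}`, any `c′`, `1 ≤ k`, `0 + k ≤ m + K`, any finite `Ω`, if
`G_k(Ω,u) = gBox A c′ u k Ω` satisfies (H1.10) at `(δ₀, c₀)`, `δ₀ ≥ 0`, then for ALL unit-lattice points `y₁, y₂ ∈ T^{(k)}`:
`‖Δ_k(Ω,u; y₁,y₂)‖ ≤ A·([y₁ = y₂] + a_k·c₀e^{δ₀}·e^{−δ₀|y₁−y₂|_{T^{(k)}}})` — gen 17's `decay236_region_flat_level` with `1^h ↦ u` (the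
`Q_k(u)G_k(Ω,u)Q_k(u)ᴴ` sandwich `norm_qMq_apply_le` at the block lower bound `blockLower_le_T` of the metric, `scale_identity`
`A²·s_k²·L^{−kd} = A·a_k`, `exp_blockLower_level_le`), COUNTING NORMALIZATION of gen 15 (`deltaRegion = (A/a_k)×` the printed kernel).
[cite: BalabanImbrieJaffe1988, (2.36) p.263] -/
theorem decay236_region_of_input {k : ℕ} (hk1 : 1 ≤ k) (hk : 0 + k ≤ P.m + P.K) {a : ℝ} (ha : 0 < a) (c' : ℝ) (U : GaugeField P 0 U1)
    (Ω : Finset (Balaban1983to89.Site P 0)) {δ₀ c₀ : ℝ} (hδ₀ : 0 ≤ δ₀) (hc₀ : 0 ≤ c₀)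
    (hGΩ : ∀ (x : Balaban1983to89.Site P 0) (f : Balaban1983to89.Site P 0 → ℂ) (F D : ℝ), (∀ y, ‖f y‖ ≤ F) →
      (∀ y, f y ≠ 0 → D ≤ B5Ineq137Torus.T P 0 x y) →
      ‖(gBox (B1RG242Torus.α P a k * (P.L : ℝ) ^ (k * P.d)) c' U k Ω *ᵥ f) x‖ ≤
        P.spacing k ^ 2 * (c₀ * Real.exp (-(δ₀ * (((P.L : ℝ) ^ k)⁻¹ * D))) * F))
    (y₁ y₂ : Balaban1983to89.Site P (0 + k)) :
    ‖deltaRegion (B1RG242Torus.α P a k * (P.L : ℝ) ^ (k * P.d)) c' U k Ω y₁ y₂‖ ≤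
      (B1RG242Torus.α P a k * (P.L : ℝ) ^ (k * P.d)) *
        ((if y₁ = y₂ then 1 else 0) + B1.aSeq a P.L k * (c₀ * Real.exp δ₀) * Real.exp (-(δ₀ * (B5Ineq137Torus.T P (0 + k) y₁ y₂)))) := by
  set A := B1RG242Torus.α P a k * (P.L : ℝ) ^ (k * P.d) with hAdef
  have hak : 0 < B1.aSeq a P.L k := B1.aSeq_pos ha (B1RG242Torus.one_lt_cast_L P) hk1
  have hα : 0 < B1RG242Torus.α P a k := mul_pos hak (inv_pos.mpr (pow_pos (P.spacing_pos k) 2))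
  have hA0 : 0 ≤ A := (mul_pos hα (pow_pos P.cast_L_pos _)).le
  set G0 := gBox A c' U k Ω with hG0def
  set Dl := max 0 (((P.L : ℝ) ^ k) * B5Ineq137Torus.T P (0 + k) y₁ y₂ - (((P.L : ℝ) ^ k) - 1)) with hDldef
  have hSandwich : ‖(qMatT U k * G0 * (qMatT U k)ᴴ) y₁ y₂‖ ≤
      P.spacing k ^ 2 * (c₀ * Real.exp (-(δ₀ * (((P.L : ℝ) ^ k)⁻¹ * Dl))) * ((P.L : ℝ) ^ (k * P.d))⁻¹) :=
    norm_qMq_apply_le hk _ G0 y₁ y₂ fun x hx =>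
      hGΩ x _ _ Dl (fun x' => norm_conj_qMatT_le _ k y₂ x') (fun x' hx' => blockLower_le_T hk hx (conj_qMatT_ne_zero _ k hx'))
  have hexp := exp_blockLower_level_le y₁ y₂ hδ₀
  rw [← hDldef] at hexp
  rw [deltaRegion_apply]
  calc ‖(A : ℂ) * (1 : Matrix _ _ ℂ) y₁ y₂ - ((A : ℂ) ^ 2) * (qMatT U k * G0 * (qMatT U k)ᴴ) y₁ y₂‖
      ≤ ‖(A : ℂ) * (1 : Matrix _ _ ℂ) y₁ y₂‖ + ‖((A : ℂ) ^ 2) * (qMatT U k * G0 * (qMatT U k)ᴴ) y₁ y₂‖ := norm_sub_le _ _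
    _ ≤ A * (if y₁ = y₂ then 1 else 0) +
        A ^ 2 * (P.spacing k ^ 2 * (c₀ * Real.exp (-(δ₀ * (((P.L : ℝ) ^ k)⁻¹ * Dl))) * ((P.L : ℝ) ^ (k * P.d))⁻¹)) := by
        rw [norm_coe_mul_one_apply hA0, norm_mul, norm_pow, Complex.norm_real, Real.norm_eq_abs, abs_of_nonneg hA0]
        exact add_le_add le_rfl (mul_le_mul_of_nonneg_left hSandwich (sq_nonneg _))
    _ = A * ((if y₁ = y₂ then 1 else 0) + B1.aSeq a P.L k * c₀ * Real.exp (-(δ₀ * (((P.L : ℝ) ^ k)⁻¹ * Dl)))) := by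
        have e := scale_identity P a k
        rw [← hAdef] at e
        calc A * (if y₁ = y₂ then 1 else 0) +
              A ^ 2 * (P.spacing k ^ 2 * (c₀ * Real.exp (-(δ₀ * (((P.L : ℝ) ^ k)⁻¹ * Dl))) * ((P.L : ℝ) ^ (k * P.d))⁻¹))
            = A * (if y₁ = y₂ then 1 else 0) +
                A ^ 2 * (((P.L : ℝ) ^ (k * P.d))⁻¹ * P.spacing k ^ 2) * (c₀ * Real.exp (-(δ₀ * (((P.L : ℝ) ^ k)⁻¹ * Dl)))) := by ring
          _ = A * ((if y₁ = y₂ then 1 else 0) + B1.aSeq a P.L k * c₀ * Real.exp (-(δ₀ * (((P.L : ℝ) ^ k)⁻¹ * Dl)))) := by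
              rw [e]; ring
    _ ≤ A * ((if y₁ = y₂ then 1 else 0) +
          B1.aSeq a P.L k * (c₀ * Real.exp δ₀) * Real.exp (-(δ₀ * (B5Ineq137Torus.T P (0 + k) y₁ y₂)))) := by
        refine mul_le_mul_of_nonneg_left (add_le_add le_rfl ?_) hA0
        calc B1.aSeq a P.L k * c₀ * Real.exp (-(δ₀ * (((P.L : ℝ) ^ k)⁻¹ * Dl)))
            ≤ B1.aSeq a P.L k * c₀ * (Real.exp δ₀ * Real.exp (-(δ₀ * (B5Ineq137Torus.T P (0 + k) y₁ y₂)))) :=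
              mul_le_mul_of_nonneg_left hexp (mul_nonneg hak.le hc₀)
          _ = B1.aSeq a P.L k * (c₀ * Real.exp δ₀) * Real.exp (-(δ₀ * (B5Ineq137Torus.T P (0 + k) y₁ y₂))) := by ring

/-- **(2.36) FOR GEN 15's `Δ_{k,loc}(u)` AT AN ARBITRARY BACKGROUND, FROM (H1.10) FOR THE CUBES** (*"|Δ_{k,loc}(u;x₁,x₂)| ≤ ce^{−c|x₁−x₂|},
(2.36)"*, p. 263, with the unit-lattice distance itself): for ANY finite family `□_α` with (H1.10) at `(δ₀, c₀)`, `δ₀, c₀ ≥ 0`, weights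
`Σ_α|λ_α| ≤ 1`, `|ζ″| ≤ 1`, all `y₁, y₂ ∈ T^{(k)}` and every finite `S` containing the cubes active on the rows `x ∈ B^k(y₁)`:
`‖Δ_{k,loc}(u; y₁,y₂)‖ ≤ A·([y₁ = y₂] + #S·a_k·c₀e^{δ₀}·e^{−δ₀|y₁−y₂|_{T^{(k)}}})`, `A = α_kL^{kd}` — gen 17's `decay236_flat_level` with
`1^h ↦ u` (§1 in the sandwich). [cite: BalabanImbrieJaffe1988, (2.36) p.263] -/
theorem decay236_of_input {k : ℕ} (hk1 : 1 ≤ k) (hk : 0 + k ≤ P.m + P.K) {a : ℝ} (ha : 0 < a) (c' : ℝ) (U : GaugeField P 0 U1)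
    {ι : Type*} [Fintype ι] (cube : ι → Finset (Balaban1983to89.Site P 0))
    {lam : ι → Balaban1983to89.Site P 0 → Balaban1983to89.Site P 0 → ℝ} {ζ'' : Balaban1983to89.Site P 0 → Balaban1983to89.Site P 0 → ℝ}
    (hlam : ∀ x y, ∑ α, |lam α x y| ≤ 1) (hζ : ∀ x y, |ζ'' x y| ≤ 1) {δ₀ c₀ : ℝ} (hδ₀ : 0 ≤ δ₀) (hc₀ : 0 ≤ c₀)
    (hG : ∀ α (x : Balaban1983to89.Site P 0) (f : Balaban1983to89.Site P 0 → ℂ) (F D : ℝ), (∀ y, ‖f y‖ ≤ F) →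
      (∀ y, f y ≠ 0 → D ≤ B5Ineq137Torus.T P 0 x y) →
      ‖(gBox (B1RG242Torus.α P a k * (P.L : ℝ) ^ (k * P.d)) c' U k (cube α) *ᵥ f) x‖ ≤
        P.spacing k ^ 2 * (c₀ * Real.exp (-(δ₀ * (((P.L : ℝ) ^ k)⁻¹ * D))) * F))
    (y₁ y₂ : Balaban1983to89.Site P (0 + k)) (S : Finset ι) (hS : ∀ x ∈ blockK k y₁, ∀ α y, ζ'' x y * lam α x y ≠ 0 → α ∈ S) :
    ‖deltaLocT (B1RG242Torus.α P a k * (P.L : ℝ) ^ (k * P.d)) c' U k cube lam ζ'' y₁ y₂‖ ≤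
      (B1RG242Torus.α P a k * (P.L : ℝ) ^ (k * P.d)) *
        ((if y₁ = y₂ then 1 else 0) +
          S.card * B1.aSeq a P.L k * (c₀ * Real.exp δ₀) * Real.exp (-(δ₀ * (B5Ineq137Torus.T P (0 + k) y₁ y₂)))) := by
  set A := B1RG242Torus.α P a k * (P.L : ℝ) ^ (k * P.d) with hAdef
  have hak : 0 < B1.aSeq a P.L k := B1.aSeq_pos ha (B1RG242Torus.one_lt_cast_L P) hk1
  have hα : 0 < B1RG242Torus.α P a k := mul_pos hak (inv_pos.mpr (pow_pos (P.spacing_pos k) 2))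
  have hA0 : 0 ≤ A := (mul_pos hα (pow_pos P.cast_L_pos _)).le
  set Gloc := gLocT A c' U k cube lam ζ'' with hGlocdef
  set Dl := max 0 (((P.L : ℝ) ^ k) * B5Ineq137Torus.T P (0 + k) y₁ y₂ - (((P.L : ℝ) ^ k) - 1)) with hDldef
  have hSandwich : ‖(qMatT U k * Gloc * (qMatT U k)ᴴ) y₁ y₂‖ ≤
      P.spacing k ^ 2 * (S.card * (c₀ * Real.exp (-(δ₀ * (((P.L : ℝ) ^ k)⁻¹ * Dl))) * ((P.L : ℝ) ^ (k * P.d))⁻¹)) :=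
    norm_qMq_apply_le hk _ Gloc y₁ y₂ fun x hx =>
      opDecay230_of_input A c' U cube hlam hζ hG x _ _ Dl (fun x' => norm_conj_qMatT_le _ k y₂ x')
        (fun x' hx' => blockLower_le_T hk hx (conj_qMatT_ne_zero _ k hx')) S (fun α y hαy _ => hS x hx α y hαy)
  have hexp := exp_blockLower_level_le y₁ y₂ hδ₀
  rw [← hDldef] at hexp
  rw [deltaLocT_apply]
  calc ‖(A : ℂ) * (1 : Matrix _ _ ℂ) y₁ y₂ - ((A : ℂ) ^ 2) * (qMatT U k * Gloc * (qMatT U k)ᴴ) y₁ y₂‖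
      ≤ ‖(A : ℂ) * (1 : Matrix _ _ ℂ) y₁ y₂‖ + ‖((A : ℂ) ^ 2) * (qMatT U k * Gloc * (qMatT U k)ᴴ) y₁ y₂‖ := norm_sub_le _ _
    _ ≤ A * (if y₁ = y₂ then 1 else 0) +
        A ^ 2 * (P.spacing k ^ 2 * (S.card * (c₀ * Real.exp (-(δ₀ * (((P.L : ℝ) ^ k)⁻¹ * Dl))) * ((P.L : ℝ) ^ (k * P.d))⁻¹))) := by
        rw [norm_coe_mul_one_apply hA0, norm_mul, norm_pow, Complex.norm_real, Real.norm_eq_abs, abs_of_nonneg hA0]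
        exact add_le_add le_rfl (mul_le_mul_of_nonneg_left hSandwich (sq_nonneg _))
    _ = A * ((if y₁ = y₂ then 1 else 0) + S.card * B1.aSeq a P.L k * c₀ * Real.exp (-(δ₀ * (((P.L : ℝ) ^ k)⁻¹ * Dl)))) := by
        have e := scale_identity P a k
        rw [← hAdef] at e
        calc A * (if y₁ = y₂ then 1 else 0) +
              A ^ 2 * (P.spacing k ^ 2 * (S.card * (c₀ * Real.exp (-(δ₀ * (((P.L : ℝ) ^ k)⁻¹ * Dl))) * ((P.L : ℝ) ^ (k * P.d))⁻¹)))
            = A * (if y₁ = y₂ then 1 else 0) +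
                A ^ 2 * (((P.L : ℝ) ^ (k * P.d))⁻¹ * P.spacing k ^ 2) * (S.card * (c₀ * Real.exp (-(δ₀ * (((P.L : ℝ) ^ k)⁻¹ * Dl))))) := by
              ring
          _ = A * ((if y₁ = y₂ then 1 else 0) + S.card * B1.aSeq a P.L k * c₀ * Real.exp (-(δ₀ * (((P.L : ℝ) ^ k)⁻¹ * Dl)))) := by
              rw [e]; ring
    _ ≤ A * ((if y₁ = y₂ then 1 else 0) +
          S.card * B1.aSeq a P.L k * (c₀ * Real.exp δ₀) * Real.exp (-(δ₀ * (B5Ineq137Torus.T P (0 + k) y₁ y₂)))) := by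
        refine mul_le_mul_of_nonneg_left (add_le_add le_rfl ?_) hA0
        calc S.card * B1.aSeq a P.L k * c₀ * Real.exp (-(δ₀ * (((P.L : ℝ) ^ k)⁻¹ * Dl)))
            ≤ S.card * B1.aSeq a P.L k * c₀ * (Real.exp δ₀ * Real.exp (-(δ₀ * (B5Ineq137Torus.T P (0 + k) y₁ y₂)))) :=
              mul_le_mul_of_nonneg_left hexp (by positivity)
          _ = S.card * B1.aSeq a P.L k * (c₀ * Real.exp δ₀) * Real.exp (-(δ₀ * (B5Ineq137Torus.T P (0 + k) y₁ y₂))) := by ring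

end Decay236

/-! ## §4 (2.35) at an arbitrary background -/

section Close235

/-- **(2.35) FOR GEN 15's `Δ_{k,loc}(u)` AGAINST `Δ_k(Ω,u)` AT AN ARBITRARY BACKGROUND, FROM (H1.12) FOR THE PAIRS `□_α ⊆ Ω` AND (H1.10)
FOR `Ω`** (*"Hence |Δ_{k,loc}(u;x₁,x₂) − Δ_k(Ω,u;x₁,x₂)| ≦ e^{−cr(e_k)}e^{−c|x₁−x₂|} for dist({x₁,x₂},Ω^c) > O(r(e_k)), (2.35)"*, p. 263):
`A = α_kL^{kd}`, any `c′`, `1 ≤ k`, `0 + k ≤ m + K`, any finite `Ω` and family `□_α`, weights `Σ_α|λ_α| ≤ 1`, cut-off `0 ≤ ζ″ ≤ 1`, inputs at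
`(δ₀, c₀)`, `δ₀, c₀ ≥ 0`; under the row hypotheses (i)–(iii) of §2 on every row `x ∈ B^k(y₁)` and `S ∋` the active cubes of those rows:
`‖Δ_{k,loc}(u;y₁,y₂) − Δ_k(Ω,u;y₁,y₂)‖ ≤ A·a_k·c₀e^{δ₀/2}·(#S·e^{−2δ₀R/L^k} + e^{−(δ₀/2)R₁/L^k})·e^{−(δ₀/2)|y₁−y₂|_{T^{(k)}}}` — gen 17's
`close235_flat_level` with `1^h ↦ u` (*"Here we have simply replaced G_k(Ω,u) with G_{k,loc}"*: `deltaLocT_sub_deltaRegion_apply`, the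
sandwich of §2's operator form).  At the printed radii `R, R₁ = r(e_k)L^k` this is `A·a_k·c(#S)·e^{−c r(e_k)}·e^{−c|y₁−y₂|}` AT EVERY LEVEL
`k`, in the counting normalization of gen 15. [cite: BalabanImbrieJaffe1988, (2.35) p.263] -/
theorem close235_of_inputs {k : ℕ} (hk1 : 1 ≤ k) (hk : 0 + k ≤ P.m + P.K) {a : ℝ} (ha : 0 < a) (c' : ℝ) (U : GaugeField P 0 U1)
    (Ω : Finset (Balaban1983to89.Site P 0)) {ι : Type*} [Fintype ι] (cube : ι → Finset (Balaban1983to89.Site P 0))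
    {lam : ι → Balaban1983to89.Site P 0 → Balaban1983to89.Site P 0 → ℝ} {ζ'' : Balaban1983to89.Site P 0 → Balaban1983to89.Site P 0 → ℝ}
    (hlam : ∀ x y, ∑ α, |lam α x y| ≤ 1) (hζ : ∀ x y, 0 ≤ ζ'' x y ∧ ζ'' x y ≤ 1) {δ₀ c₀ : ℝ} (hδ₀ : 0 ≤ δ₀) (hc₀ : 0 ≤ c₀)
    (hGΩ : ∀ (x : Balaban1983to89.Site P 0) (f : Balaban1983to89.Site P 0 → ℂ) (F D : ℝ), (∀ y, ‖f y‖ ≤ F) →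
      (∀ y, f y ≠ 0 → D ≤ B5Ineq137Torus.T P 0 x y) →
      ‖(gBox (B1RG242Torus.α P a k * (P.L : ℝ) ^ (k * P.d)) c' U k Ω *ᵥ f) x‖ ≤
        P.spacing k ^ 2 * (c₀ * Real.exp (-(δ₀ * (((P.L : ℝ) ^ k)⁻¹ * D))) * F))
    (hC : ∀ α, ∀ x ∈ cube α, ∀ (f : Balaban1983to89.Site P 0 → ℂ) (F D Db Df : ℝ), (∀ y, ‖f y‖ ≤ F) → (∀ y, y ∉ cube α → f y = 0) →
      (∀ y, f y ≠ 0 → D ≤ B5Ineq137Torus.T P 0 x y) → (∀ w ∈ Ω, w ∉ cube α → Db ≤ B5Ineq137Torus.T P 0 x w) →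
      (∀ y, f y ≠ 0 → ∀ w ∈ Ω, w ∉ cube α → Df ≤ B5Ineq137Torus.T P 0 y w) →
      ‖(gBox (B1RG242Torus.α P a k * (P.L : ℝ) ^ (k * P.d)) c' U k (cube α) *ᵥ f) x -
          (gBox (B1RG242Torus.α P a k * (P.L : ℝ) ^ (k * P.d)) c' U k Ω *ᵥ f) x‖ ≤
        P.spacing k ^ 2 * (c₀ * Real.exp (-(δ₀ * (((P.L : ℝ) ^ k)⁻¹ * D))) * Real.exp (-(δ₀ * (((P.L : ℝ) ^ k)⁻¹ * (Db + Df)))) * F))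
    {R R₁ : ℝ} (y₁ y₂ : Balaban1983to89.Site P (0 + k))
    (hcomp : ∀ x ∈ blockK k y₁, ∀ y, ζ'' x y ≠ 0 → ∑ α, lam α x y = 1)
    (hdeep : ∀ x ∈ blockK k y₁, ∀ α y, ζ'' x y * lam α x y ≠ 0 → x ∈ cube α ∧ y ∈ cube α ∧
      ∀ w ∈ Ω, w ∉ cube α → R ≤ B5Ineq137Torus.T P 0 x w ∧ R ≤ B5Ineq137Torus.T P 0 y w)
    (hcut : ∀ x ∈ blockK k y₁, ∀ y, B5Ineq137Torus.T P 0 x y ≤ R₁ → ζ'' x y = 1)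
    (S : Finset ι) (hS : ∀ x ∈ blockK k y₁, ∀ α y, ζ'' x y * lam α x y ≠ 0 → α ∈ S) :
    ‖deltaLocT (B1RG242Torus.α P a k * (P.L : ℝ) ^ (k * P.d)) c' U k cube lam ζ'' y₁ y₂ -
        deltaRegion (B1RG242Torus.α P a k * (P.L : ℝ) ^ (k * P.d)) c' U k Ω y₁ y₂‖ ≤
      (B1RG242Torus.α P a k * (P.L : ℝ) ^ (k * P.d)) * (B1.aSeq a P.L k * (c₀ * Real.exp (δ₀ / 2)) *
        (S.card * Real.exp (-(δ₀ * (((P.L : ℝ) ^ k)⁻¹ * (2 * R)))) + Real.exp (-(δ₀ / 2 * (((P.L : ℝ) ^ k)⁻¹ * R₁)))) *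
          Real.exp (-(δ₀ / 2 * (B5Ineq137Torus.T P (0 + k) y₁ y₂)))) := by
  set A := B1RG242Torus.α P a k * (P.L : ℝ) ^ (k * P.d) with hAdef
  have hak : 0 < B1.aSeq a P.L k := B1.aSeq_pos ha (B1RG242Torus.one_lt_cast_L P) hk1
  have hα : 0 < B1RG242Torus.α P a k := mul_pos hak (inv_pos.mpr (pow_pos (P.spacing_pos k) 2))
  have hA0 : 0 ≤ A := (mul_pos hα (pow_pos P.cast_L_pos _)).le
  set Gloc := gLocT A c' U k cube lam ζ'' with hGlocdef
  set G0 := gBox A c' U k Ω with hG0def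
  set Dl := max 0 (((P.L : ℝ) ^ k) * B5Ineq137Torus.T P (0 + k) y₁ y₂ - (((P.L : ℝ) ^ k) - 1)) with hDldef
  have hDl0 : 0 ≤ Dl := le_max_left _ _
  set E := c₀ * (S.card * Real.exp (-(δ₀ * (((P.L : ℝ) ^ k)⁻¹ * (2 * R)))) + Real.exp (-(δ₀ / 2 * (((P.L : ℝ) ^ k)⁻¹ * R₁))))
    with hEdef
  have hE0 : 0 ≤ E := by positivity
  have hSandwich : ‖(qMatT U k * (Gloc - G0) * (qMatT U k)ᴴ) y₁ y₂‖ ≤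
      P.spacing k ^ 2 * (E * Real.exp (-(δ₀ / 2 * (((P.L : ℝ) ^ k)⁻¹ * Dl))) * ((P.L : ℝ) ^ (k * P.d))⁻¹) := by
    refine norm_qMq_apply_le hk _ (Gloc - G0) y₁ y₂ fun x hx => ?_
    rw [Matrix.sub_mulVec, Pi.sub_apply]
    exact opClose231_of_inputs A c' U Ω cube hlam hζ hδ₀ hc₀ hGΩ hC x (hcomp x hx) (hdeep x hx) (hcut x hx) _
      (fun x' => norm_conj_qMatT_le _ k y₂ x') hDl0 (fun x' hx' => blockLower_le_T hk hx (conj_qMatT_ne_zero _ k hx'))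
      S (fun α y hαy _ => hS x hx α y hαy)
  have hexp := exp_blockLower_level_le y₁ y₂ (by positivity : (0 : ℝ) ≤ δ₀ / 2)
  rw [← hDldef] at hexp
  rw [deltaLocT_sub_deltaRegion_apply, norm_neg, norm_mul, norm_pow, Complex.norm_real, Real.norm_eq_abs, abs_of_nonneg hA0]
  have e := scale_identity P a k
  rw [← hAdef] at e
  calc A ^ 2 * ‖(qMatT U k * (Gloc - G0) * (qMatT U k)ᴴ) y₁ y₂‖
      ≤ A ^ 2 * (P.spacing k ^ 2 * (E * Real.exp (-(δ₀ / 2 * (((P.L : ℝ) ^ k)⁻¹ * Dl))) * ((P.L : ℝ) ^ (k * P.d))⁻¹)) :=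
        mul_le_mul_of_nonneg_left hSandwich (sq_nonneg _)
    _ = A ^ 2 * (((P.L : ℝ) ^ (k * P.d))⁻¹ * P.spacing k ^ 2) * (E * Real.exp (-(δ₀ / 2 * (((P.L : ℝ) ^ k)⁻¹ * Dl)))) := by ring
    _ = A * B1.aSeq a P.L k * (E * Real.exp (-(δ₀ / 2 * (((P.L : ℝ) ^ k)⁻¹ * Dl)))) := by rw [e]
    _ ≤ A * B1.aSeq a P.L k * (E * (Real.exp (δ₀ / 2) * Real.exp (-(δ₀ / 2 * (B5Ineq137Torus.T P (0 + k) y₁ y₂))))) :=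
        mul_le_mul_of_nonneg_left (mul_le_mul_of_nonneg_left hexp hE0) (mul_nonneg hA0 hak.le)
    _ = _ := by rw [hEdef]; ring

end Close235

/-! ## §5 (2.38) for `Δ_{k,loc}(u)` at an arbitrary small-plaquette background -/

section Ineq238

open BIJ85AbelianStokes (plaqC)
open BIJ88NeumannNoZeroModesTorus (IsBlockUnion innerK)
open BIJ88Sect3Statements (starB)
open BIJ88Ineq238Proof (kform abs_kform_sub_le)
open BIJ88Ineq238FlatTorus (kform_eq_re_dotProduct sum_univ_eq_sum_starB)
open BIJ85Ineq732SmallFieldRegion (ineq238_deltaRegion_smallField_region)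
open B5Ineq137Torus (T_symm rowSum_T_le)
open B4Sect5Proof (latticeConst latticeConst_nonneg)

/-- **(2.38) FOR GEN 15's `Δ_{k,loc}(u)` AT AN ARBITRARY SMALL-PLAQUETTE BACKGROUND, FROM (H1.10) FOR `Ω`, (H1.12) FOR THE PAIRS `□_α ⊆ Ω`
AND [I] (7.3.2) FOR `Δ_k(Ω,u)`** (p. 264: *"Finally, in view of (2.35), the lower bound (I.7.3.2) applies to Δ_{k,loc}(u) as well. Let φ be
supported in a region having an r(e_k) neighborhood where u is smooth. Then ⟨φ, Δ_{k,loc}(u)φ⟩ ≧ c Σ_{b∈T₁^{(k)*}} |u(⟨b₋,b₊⟩)φ(b₊) − φ(b₋)|²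
− ce_k²p(e_k)² Σ_{x∈T₁^{(k)}} |φ(x)|². (2.38)"*): `A = α_kL^{kd}`, `c′ = ε^{−1}`, `1 ≤ k`, `0 + k ≤ m + K`, `Ω` a union of `k`-blocks, `u` ANY
`U(1)` field on `T^{(0)}` with plaquettes within `θ` of `1`, inputs at `(δ₀, c₀)`, `δ₀ > 0`, `c₀ ≥ 0`; every admissibility predicate `Adm` such
that admissible `φ` satisfy §2's row hypotheses (i)–(iii) with multiplicity `≤ m` on every block `B^k(y₁)`, `y₁ ∈ supp φ`, and have every unit
bond meeting `supp φ` inside `Ω^{(k)*}` (print's *"φ supported in a region having an r(e_k) neighborhood where u is smooth"*); then for every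
admissible `φ`:  `(A/a_k)·( γ₀·Σ_{b∈T₁^{(k)*}} |u_k(b)φ(b₊) − φ(b₋)|² − ((4/3)d⁴(L^{2k}θ)² + a_k²·c₀e^{δ₀/2}K_d(δ₀/2)·(m·e^{−2δ₀R/L^k} +
e^{−(δ₀/2)R₁/L^k}))·Σ_x|φ(x)|² ) ≤ Re⟨φ, Δ_{k,loc}(u)φ⟩`, `γ₀ = min(a/(9(d+1)), 1/12)`, `u_k(b) = u(Γ_{b₋,b₊})` the straight transport
(p11's `lineIter u k`), `K_d` the torus row sum `rowSum_T_le`, `A/a_k` the counting normalization of gen 15 — p344913's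
`ineq238_deltaRegion_smallField_region` ((I.7.3.2) for the region form at a general small-plaquette `u`) and §4's `close235_of_inputs`, combined
by p02's `abs_kform_sub_le` BY NAME (gen 18's `ineq238_flat_mult` with `1^h ↦ u`; there the `e_k²p(e_k)²` term was zero, here it is the
plaquette term `(4/3)d⁴(L^{2k}θ)²` — print's `ce_k²p(e_k)²` at (2.33)-regular `u`). [cite: BalabanImbrieJaffe1988, (2.38) p.264] -/
theorem ineq238_of_inputs {k : ℕ} (hk1 : 1 ≤ k) (hk : 0 + k ≤ P.m + P.K) {a : ℝ} (ha : 0 < a) (U : GaugeField P 0 U1) {θ : ℝ}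
    (hθ : ∀ (x : Balaban1983to89.Site P 0) (μ ν : Fin P.d), ‖plaqC U x μ ν - 1‖ ≤ θ)
    {Ω : Finset (Balaban1983to89.Site P 0)} (hΩ : IsBlockUnion k Ω) {ι : Type*} [Fintype ι] (cube : ι → Finset (Balaban1983to89.Site P 0))
    {lam : ι → Balaban1983to89.Site P 0 → Balaban1983to89.Site P 0 → ℝ} {ζ'' : Balaban1983to89.Site P 0 → Balaban1983to89.Site P 0 → ℝ}
    (hlam : ∀ x y, ∑ α, |lam α x y| ≤ 1) (hζ : ∀ x y, 0 ≤ ζ'' x y ∧ ζ'' x y ≤ 1) {δ₀ c₀ : ℝ} (hδ₀ : 0 < δ₀) (hc₀ : 0 ≤ c₀)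
    (hGΩ : ∀ (x : Balaban1983to89.Site P 0) (f : Balaban1983to89.Site P 0 → ℂ) (F D : ℝ), (∀ y, ‖f y‖ ≤ F) →
      (∀ y, f y ≠ 0 → D ≤ B5Ineq137Torus.T P 0 x y) →
      ‖(gBox (B1RG242Torus.α P a k * (P.L : ℝ) ^ (k * P.d)) P.eps⁻¹ U k Ω *ᵥ f) x‖ ≤
        P.spacing k ^ 2 * (c₀ * Real.exp (-(δ₀ * (((P.L : ℝ) ^ k)⁻¹ * D))) * F))
    (hC : ∀ α, ∀ x ∈ cube α, ∀ (f : Balaban1983to89.Site P 0 → ℂ) (F D Db Df : ℝ), (∀ y, ‖f y‖ ≤ F) → (∀ y, y ∉ cube α → f y = 0) →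
      (∀ y, f y ≠ 0 → D ≤ B5Ineq137Torus.T P 0 x y) → (∀ w ∈ Ω, w ∉ cube α → Db ≤ B5Ineq137Torus.T P 0 x w) →
      (∀ y, f y ≠ 0 → ∀ w ∈ Ω, w ∉ cube α → Df ≤ B5Ineq137Torus.T P 0 y w) →
      ‖(gBox (B1RG242Torus.α P a k * (P.L : ℝ) ^ (k * P.d)) P.eps⁻¹ U k (cube α) *ᵥ f) x -
          (gBox (B1RG242Torus.α P a k * (P.L : ℝ) ^ (k * P.d)) P.eps⁻¹ U k Ω *ᵥ f) x‖ ≤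
        P.spacing k ^ 2 * (c₀ * Real.exp (-(δ₀ * (((P.L : ℝ) ^ k)⁻¹ * D))) * Real.exp (-(δ₀ * (((P.L : ℝ) ^ k)⁻¹ * (Db + Df)))) * F))
    {R R₁ : ℝ} (m : ℕ) (Adm : (Balaban1983to89.Site P (0 + k) → ℂ) → Prop)
    (hAdm : ∀ φ, Adm φ → ∀ y₁, φ y₁ ≠ 0 →
      (∀ x ∈ blockK k y₁, ∀ y, ζ'' x y ≠ 0 → ∑ α, lam α x y = 1) ∧
      (∀ x ∈ blockK k y₁, ∀ α y, ζ'' x y * lam α x y ≠ 0 → x ∈ cube α ∧ y ∈ cube α ∧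
          ∀ w ∈ Ω, w ∉ cube α → R ≤ B5Ineq137Torus.T P 0 x w ∧ R ≤ B5Ineq137Torus.T P 0 y w) ∧
      (∀ x ∈ blockK k y₁, ∀ y, B5Ineq137Torus.T P 0 x y ≤ R₁ → ζ'' x y = 1) ∧
      ∃ S : Finset ι, S.card ≤ m ∧ ∀ x ∈ blockK k y₁, ∀ α y, ζ'' x y * lam α x y ≠ 0 → α ∈ S)
    (hnb : ∀ φ, Adm φ → ∀ b : PBond P (0 + k), (φ b.src ≠ 0 ∨ φ b.tgt ≠ 0) → b ∈ starB (innerK k Ω))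
    (φ : Balaban1983to89.Site P (0 + k) → ℂ) (hφ : Adm φ) :
    (B1RG242Torus.α P a k * (P.L : ℝ) ^ (k * P.d)) / B1.aSeq a P.L k *
        (min (a / (9 * (P.d + 1))) (1 / 12) * ∑ b : PBond P (0 + k), ‖toC (lineIter U k b) * φ b.tgt - φ b.src‖ ^ 2
          - (4 / 3 * (P.d : ℝ) ^ 4 * (((P.L : ℝ) ^ k) ^ 2 * θ) ^ 2 +
              B1.aSeq a P.L k ^ 2 * (c₀ * Real.exp (δ₀ / 2) * latticeConst P.d (δ₀ / 2)) *
                ((m : ℝ) * Real.exp (-(δ₀ * (((P.L : ℝ) ^ k)⁻¹ * (2 * R)))) + Real.exp (-(δ₀ / 2 * (((P.L : ℝ) ^ k)⁻¹ * R₁))))) *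
            ∑ y : Balaban1983to89.Site P (0 + k), ‖φ y‖ ^ 2)
      ≤ (star φ ⬝ᵥ (deltaLocT (B1RG242Torus.α P a k * (P.L : ℝ) ^ (k * P.d)) P.eps⁻¹ U k cube lam ζ'' *ᵥ φ)).re := by
  set A : ℝ := B1RG242Torus.α P a k * (P.L : ℝ) ^ (k * P.d) with hAdef
  set ak : ℝ := B1.aSeq a P.L k with hakdef
  have hak : 0 < ak := B1.aSeq_pos ha (B1RG242Torus.one_lt_cast_L P) hk1
  have hα : 0 < B1RG242Torus.α P a k := mul_pos hak (inv_pos.mpr (pow_pos (P.spacing_pos k) 2))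
  have hA0 : 0 < A := mul_pos hα (pow_pos P.cast_L_pos _)
  have hAak : 0 < A / ak := div_pos hA0 hak
  set br : ℝ := (m : ℝ) * Real.exp (-(δ₀ * (((P.L : ℝ) ^ k)⁻¹ * (2 * R)))) + Real.exp (-(δ₀ / 2 * (((P.L : ℝ) ^ k)⁻¹ * R₁)))
    with hbrdef
  have hbr0 : 0 ≤ br := by positivity
  set δ' : ℝ := A * (ak * (c₀ * Real.exp (δ₀ / 2)) * br) with hδ'def
  have hδ'0 : 0 ≤ δ' := by positivity
  set Kd : ℝ := latticeConst P.d (δ₀ / 2) with hKddef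
  set Err : ℝ := 4 / 3 * (P.d : ℝ) ^ 4 * (((P.L : ℝ) ^ k) ^ 2 * θ) ^ 2 with hErrdef
  set Δloc := deltaLocT A P.eps⁻¹ U k cube lam ζ'' with hΔlocdef
  set ΔΩ := deltaRegion A P.eps⁻¹ U k Ω with hΔΩdef
  -- (I.7.3.2) for the region form at the small-plaquette background (p344913)
  have h732 := ineq238_deltaRegion_smallField_region hk1 hk ha U hθ hΩ φ
  rw [← hAdef, ← hakdef, ← hΔΩdef] at h732
  have hfull : ∑ b : PBond P (0 + k), ‖toC (lineIter U k b) * φ b.tgt - φ b.src‖ ^ 2 =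
      ∑ b ∈ starB (innerK k Ω), ‖toC (lineIter U k b) * φ b.tgt - φ b.src‖ ^ 2 := by
    refine sum_univ_eq_sum_starB (innerK k Ω) _ fun b hb => ?_
    have h0 : φ b.src = 0 ∧ φ b.tgt = 0 := by
      by_contra hne
      rw [not_and_or] at hne
      exact hb (hnb φ hφ b hne)
    rw [h0.1, h0.2, mul_zero, sub_zero, norm_zero, zero_pow two_ne_zero]
  have hinner : ∑ y ∈ innerK k Ω, ‖φ y‖ ^ 2 ≤ ∑ y : Balaban1983to89.Site P (0 + k), ‖φ y‖ ^ 2 :=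
    Finset.sum_le_univ_sum_of_nonneg fun y => sq_nonneg _
  -- (2.35) on supp φ × supp φ (§4)
  have hM : ∀ y₁ y₂, φ y₁ ≠ 0 → φ y₂ ≠ 0 → ‖Δloc y₁ y₂ - ΔΩ y₁ y₂‖ ≤ δ' * Real.exp (-(δ₀ / 2) * B5Ineq137Torus.T P (0 + k) y₁ y₂) := by
    intro y₁ y₂ hy₁ _
    obtain ⟨hcomp, hdeep, hcut, S, hSm, hS⟩ := hAdm φ hφ y₁ hy₁
    have h35 := close235_of_inputs hk1 hk ha P.eps⁻¹ U Ω cube hlam hζ hδ₀.le hc₀ hGΩ hC y₁ y₂ hcomp hdeep hcut S hS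
    rw [← hAdef, ← hakdef, ← hΔlocdef, ← hΔΩdef] at h35
    rw [neg_mul]
    have hbrS : (S.card : ℝ) * Real.exp (-(δ₀ * (((P.L : ℝ) ^ k)⁻¹ * (2 * R)))) + Real.exp (-(δ₀ / 2 * (((P.L : ℝ) ^ k)⁻¹ * R₁))) ≤ br := by
      have hSm' : (S.card : ℝ) ≤ m := by exact_mod_cast hSm
      exact add_le_add (mul_le_mul_of_nonneg_right hSm' (Real.exp_nonneg _)) le_rfl
    calc _ ≤ A * (ak * (c₀ * Real.exp (δ₀ / 2)) * ((S.card : ℝ) * Real.exp (-(δ₀ * (((P.L : ℝ) ^ k)⁻¹ * (2 * R)))) +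
            Real.exp (-(δ₀ / 2 * (((P.L : ℝ) ^ k)⁻¹ * R₁)))) * Real.exp (-(δ₀ / 2 * B5Ineq137Torus.T P (0 + k) y₁ y₂))) := h35
      _ ≤ A * (ak * (c₀ * Real.exp (δ₀ / 2)) * br * Real.exp (-(δ₀ / 2 * B5Ineq137Torus.T P (0 + k) y₁ y₂))) := by
          apply mul_le_mul_of_nonneg_left _ hA0.le
          apply mul_le_mul_of_nonneg_right _ (Real.exp_nonneg _)
          exact mul_le_mul_of_nonneg_left hbrS (by positivity)
      _ = δ' * Real.exp (-(δ₀ / 2 * B5Ineq137Torus.T P (0 + k) y₁ y₂)) := by rw [hδ'def]; ring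
  have hsymm : ∀ y₁ y₂ : Balaban1983to89.Site P (0 + k), B5Ineq137Torus.T P (0 + k) y₁ y₂ = B5Ineq137Torus.T P (0 + k) y₂ y₁ :=
    fun y₁ y₂ => T_symm P (0 + k) y₁ y₂
  have hSrow : ∀ y₁ : Balaban1983to89.Site P (0 + k), ∑ y₂, Real.exp (-(δ₀ / 2) * B5Ineq137Torus.T P (0 + k) y₁ y₂) ≤ Kd := by
    intro y₁
    simp_rw [neg_mul]
    exact rowSum_T_le P (0 + k) (half_pos hδ₀) y₁
  -- p02's form comparison
  have hK := abs_kform_sub_le (K := fun y₁ y₂ => Δloc y₁ y₂) (K' := fun y₁ y₂ => ΔΩ y₁ y₂) hM hsymm hSrow hδ'0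
  have hKloc : kform (fun y₁ y₂ => Δloc y₁ y₂) φ = (star φ ⬝ᵥ (Δloc *ᵥ φ)).re := kform_eq_re_dotProduct Δloc φ
  have hKΩ : kform (fun y₁ y₂ => ΔΩ y₁ y₂) φ = (star φ ⬝ᵥ (ΔΩ *ᵥ φ)).re := kform_eq_re_dotProduct ΔΩ φ
  rw [hKloc, hKΩ] at hK
  have hlow := (abs_sub_le_iff.1 hK).2
  -- constants
  have hconst : δ' * Kd = A / ak * (ak ^ 2 * (c₀ * Real.exp (δ₀ / 2) * Kd) * br) := by
    rw [hδ'def]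
    field_simp
  have hγ0 : 0 ≤ min (a / (9 * ((P.d : ℝ) + 1))) (1 / 12) := le_min (by positivity) (by norm_num)
  rw [hfull]
  calc A / ak * (min (a / (9 * (P.d + 1))) (1 / 12) * ∑ b ∈ starB (innerK k Ω), ‖toC (lineIter U k b) * φ b.tgt - φ b.src‖ ^ 2 -
          (Err + ak ^ 2 * (c₀ * Real.exp (δ₀ / 2) * Kd) * br) * ∑ y : Balaban1983to89.Site P (0 + k), ‖φ y‖ ^ 2)
      = A / ak * (min (a / (9 * (P.d + 1))) (1 / 12) * ∑ b ∈ starB (innerK k Ω), ‖toC (lineIter U k b) * φ b.tgt - φ b.src‖ ^ 2 -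
          Err * ∑ y : Balaban1983to89.Site P (0 + k), ‖φ y‖ ^ 2) - δ' * Kd * ∑ y : Balaban1983to89.Site P (0 + k), ‖φ y‖ ^ 2 := by
        rw [hconst]; ring
    _ ≤ A / ak * (min (a / (9 * (P.d + 1))) (1 / 12) * ∑ b ∈ starB (innerK k Ω), ‖toC (lineIter U k b) * φ b.tgt - φ b.src‖ ^ 2 -
          Err * ∑ y ∈ innerK k Ω, ‖φ y‖ ^ 2) - δ' * Kd * ∑ y : Balaban1983to89.Site P (0 + k), ‖φ y‖ ^ 2 := by
        have hErr0 : 0 ≤ Err := by positivity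
        nlinarith [mul_le_mul_of_nonneg_left hinner hErr0, hAak.le,
          mul_le_mul_of_nonneg_left (mul_le_mul_of_nonneg_left hinner hErr0) hAak.le]
    _ ≤ (star φ ⬝ᵥ (ΔΩ *ᵥ φ)).re - δ' * Kd * ∑ y : Balaban1983to89.Site P (0 + k), ‖φ y‖ ^ 2 := by
        rw [hErrdef]; linarith [h732]
    _ ≤ (star φ ⬝ᵥ (Δloc *ᵥ φ)).re := by linarith [hlow]

end Ineq238

/-! ## §6 (2.40) and (4.9) at a general step for `Δ_{k,loc}(u)` at an arbitrary small background -/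

section Eq240

open BIJ85AbelianStokes (plaqC)
open BIJ88NeumannNoZeroModesTorus (IsBlockUnion innerK)
open BIJ88Sect3Statements (starB)
open BIJ88DeltaLoc234Torus (deltaLocT_conjTranspose)
open BIJ88Eq240FlatTorus (realify compress op240 c240)
open BIJ88Normalization46 (Z49 Z49_pos)
open BIJ88Decay241SmallFieldTorus (Z49_smallField_eq)
open BIJ88Decay241FlatTorus (c240_smul)
open B4Sect5Proof (latticeConst)

/-- **(2.40) AND (4.9)_{j≥1} FOR GEN 15's `Δ_{k,loc}(u)` AT AN ARBITRARY SMALL BACKGROUND, CLOSED MODULO (H1.10)/(H1.12)** (p. 264: *"Let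
C^{(k)}_Λ(u) = (Λ(Δ_{k,loc}(u) + a_kL^{−2}P(u))Λ)^{−1} … (2.40) by (2.38), C^{(k)}_Λ(u)^{−1} is bounded below"*; (4.9) p. 275): with the data of
§5 — `Ω` a `k`-block union, the cubes `□_α` unions of `k`-blocks (so that `Δ_{k,loc}(u)` is HERMITIAN for symmetric `λ, ζ″`,
`deltaLocT_conjTranspose`), `u` with plaquettes within `θ` of `1`, inputs at `(δ₀, c₀)`, row hypotheses (i)–(iii) with multiplicity `≤ m` on every
block row of `Λ ⊆ T^{(k)}` and every unit bond meeting `Λ` inside `Ω^{(k)*}` — and with the straight transports `u_k = lineIter u k` small inside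
the `L`-blocks of `T^{(k)}` (`|u_k(b) − 1| ≤ T₁` there, `|u_k(Γ^{(1)}_y) − 1| ≤ δ₁`, `2(L−1)L·d·T₁² + 2δ₁² ≤ σ`), `κ′ ≥ 0`, and the SMALLNESS
`(4/3)d⁴(L^{2k}θ)² + a_k²c₀e^{δ₀/2}K_d(δ₀/2)(m·e^{−2δ₀R/L^k} + e^{−(δ₀/2)R₁/L^k}) < c₀^{(2.40)}(γ₀, κ′)·(1 − σ)` (`γ₀ = min(a/(9(d+1)), 1/12)`;
small plaquettes, deep rows, large radii): the precision matrix `realify((Δ_{k,loc}(u) + (A/a_k)κ′P(u_k))|_Λ)` of (4.9) is POSITIVE DEFINITE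
and `Z = e^{−E_sN}√(2π)^{2|Λ|}/√det` — p344337 §7's `Z49_smallField_eq` (any Hermitian `Δ` with a (2.38)-shape bound) fed with §5's
`ineq238_of_inputs`.  gen 18's `Z49_deltaLocT_flat` / p29's `Z49_flat_cwt` are the flat instances (inputs PROVED there); this is the member at
a general background, whose only undischarged hypotheses are [6]'s (H1.10)/(H1.12) for `gBox … u k ·`. [cite: BalabanImbrieJaffe1988, (2.40) p.264] -/
theorem Z49_of_inputs {k : ℕ} (hk1 : 1 ≤ k) (hk' : 0 + k + 1 ≤ P.m + P.K) {a : ℝ} (ha : 0 < a) (U : GaugeField P 0 U1) {θ : ℝ}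
    (hθ : ∀ (x : Balaban1983to89.Site P 0) (μ ν : Fin P.d), ‖plaqC U x μ ν - 1‖ ≤ θ)
    {Ω : Finset (Balaban1983to89.Site P 0)} (hΩ : IsBlockUnion k Ω) {ι : Type*} [Fintype ι] {cube : ι → Finset (Balaban1983to89.Site P 0)}
    (hcube : ∀ α, IsBlockUnion k (cube α))
    {lam : ι → Balaban1983to89.Site P 0 → Balaban1983to89.Site P 0 → ℝ} {ζ'' : Balaban1983to89.Site P 0 → Balaban1983to89.Site P 0 → ℝ}
    (hlam : ∀ x y, ∑ α, |lam α x y| ≤ 1) (hlamsymm : ∀ α x₁ x₂, lam α x₂ x₁ = lam α x₁ x₂) (hζ : ∀ x y, 0 ≤ ζ'' x y ∧ ζ'' x y ≤ 1)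
    (hζsymm : ∀ x₁ x₂, ζ'' x₂ x₁ = ζ'' x₁ x₂) {δ₀ c₀ : ℝ} (hδ₀ : 0 < δ₀) (hc₀ : 0 ≤ c₀)
    (hGΩ : ∀ (x : Balaban1983to89.Site P 0) (f : Balaban1983to89.Site P 0 → ℂ) (F D : ℝ), (∀ y, ‖f y‖ ≤ F) →
      (∀ y, f y ≠ 0 → D ≤ B5Ineq137Torus.T P 0 x y) →
      ‖(gBox (B1RG242Torus.α P a k * (P.L : ℝ) ^ (k * P.d)) P.eps⁻¹ U k Ω *ᵥ f) x‖ ≤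
        P.spacing k ^ 2 * (c₀ * Real.exp (-(δ₀ * (((P.L : ℝ) ^ k)⁻¹ * D))) * F))
    (hC : ∀ α, ∀ x ∈ cube α, ∀ (f : Balaban1983to89.Site P 0 → ℂ) (F D Db Df : ℝ), (∀ y, ‖f y‖ ≤ F) → (∀ y, y ∉ cube α → f y = 0) →
      (∀ y, f y ≠ 0 → D ≤ B5Ineq137Torus.T P 0 x y) → (∀ w ∈ Ω, w ∉ cube α → Db ≤ B5Ineq137Torus.T P 0 x w) →
      (∀ y, f y ≠ 0 → ∀ w ∈ Ω, w ∉ cube α → Df ≤ B5Ineq137Torus.T P 0 y w) →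
      ‖(gBox (B1RG242Torus.α P a k * (P.L : ℝ) ^ (k * P.d)) P.eps⁻¹ U k (cube α) *ᵥ f) x -
          (gBox (B1RG242Torus.α P a k * (P.L : ℝ) ^ (k * P.d)) P.eps⁻¹ U k Ω *ᵥ f) x‖ ≤
        P.spacing k ^ 2 * (c₀ * Real.exp (-(δ₀ * (((P.L : ℝ) ^ k)⁻¹ * D))) * Real.exp (-(δ₀ * (((P.L : ℝ) ^ k)⁻¹ * (Db + Df)))) * F))
    {R R₁ : ℝ} (m : ℕ) (Λ : Finset (Balaban1983to89.Site P (0 + k)))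
    (hrows : ∀ y₁ ∈ Λ,
      (∀ x ∈ blockK k y₁, ∀ y, ζ'' x y ≠ 0 → ∑ α, lam α x y = 1) ∧
      (∀ x ∈ blockK k y₁, ∀ α y, ζ'' x y * lam α x y ≠ 0 → x ∈ cube α ∧ y ∈ cube α ∧
          ∀ w ∈ Ω, w ∉ cube α → R ≤ B5Ineq137Torus.T P 0 x w ∧ R ≤ B5Ineq137Torus.T P 0 y w) ∧
      (∀ x ∈ blockK k y₁, ∀ y, B5Ineq137Torus.T P 0 x y ≤ R₁ → ζ'' x y = 1) ∧
      ∃ S : Finset ι, S.card ≤ m ∧ ∀ x ∈ blockK k y₁, ∀ α y, ζ'' x y * lam α x y ≠ 0 → α ∈ S)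
    (hΛ : ∀ b : PBond P (0 + k), (b.src ∈ Λ ∨ b.tgt ∈ Λ) → b ∈ starB (innerK k Ω))
    {T₁ δ₁ σ : ℝ} (hInt : ∀ b : PBond P (0 + k), blkIter 1 b.src = blkIter 1 b.tgt → ‖toC (lineIter U k b) - 1‖ ≤ T₁)
    (hTree : ∀ y : Balaban1983to89.Site P (0 + k), ‖holCK (lineIter U k) 1 y - 1‖ ≤ δ₁)
    (hσ : 2 * (((P.L : ℝ) - 1) * P.L) * P.d * T₁ ^ 2 + 2 * δ₁ ^ 2 ≤ σ) {κ' : ℝ} (hκ' : 0 ≤ κ')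
    (hE : 4 / 3 * (P.d : ℝ) ^ 4 * (((P.L : ℝ) ^ k) ^ 2 * θ) ^ 2 +
        B1.aSeq a P.L k ^ 2 * (c₀ * Real.exp (δ₀ / 2) * latticeConst P.d (δ₀ / 2)) *
          ((m : ℝ) * Real.exp (-(δ₀ * (((P.L : ℝ) ^ k)⁻¹ * (2 * R)))) + Real.exp (-(δ₀ / 2 * (((P.L : ℝ) ^ k)⁻¹ * R₁)))) <
      c240 P (min (a / (9 * (P.d + 1))) (1 / 12)) κ' * (1 - σ)) (Es N : ℝ) :
    (realify (compress Λ (op240 (deltaLocT (B1RG242Torus.α P a k * (P.L : ℝ) ^ (k * P.d)) P.eps⁻¹ U k cube lam ζ'')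
        ((B1RG242Torus.α P a k * (P.L : ℝ) ^ (k * P.d)) / B1.aSeq a P.L k * κ') (lineIter U k)))).PosDef ∧
      Z49 (realify (compress Λ (op240 (deltaLocT (B1RG242Torus.α P a k * (P.L : ℝ) ^ (k * P.d)) P.eps⁻¹ U k cube lam ζ'')
          ((B1RG242Torus.α P a k * (P.L : ℝ) ^ (k * P.d)) / B1.aSeq a P.L k * κ') (lineIter U k)))) Es N =
        Real.exp (-(Es * N)) * (Real.sqrt (2 * Real.pi) ^ Fintype.card (↥Λ × Fin 2) /
          Real.sqrt (realify (compress Λ (op240 (deltaLocT (B1RG242Torus.α P a k * (P.L : ℝ) ^ (k * P.d)) P.eps⁻¹ U k cube lam ζ'')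
            ((B1RG242Torus.α P a k * (P.L : ℝ) ^ (k * P.d)) / B1.aSeq a P.L k * κ') (lineIter U k)))).det) ∧
      0 < Z49 (realify (compress Λ (op240 (deltaLocT (B1RG242Torus.α P a k * (P.L : ℝ) ^ (k * P.d)) P.eps⁻¹ U k cube lam ζ'')
          ((B1RG242Torus.α P a k * (P.L : ℝ) ^ (k * P.d)) / B1.aSeq a P.L k * κ') (lineIter U k)))) Es N := by
  have hk : 0 + k ≤ P.m + P.K := (Nat.le_succ _).trans hk'
  set A : ℝ := B1RG242Torus.α P a k * (P.L : ℝ) ^ (k * P.d) with hAdef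
  set ak : ℝ := B1.aSeq a P.L k with hakdef
  have hak : 0 < ak := B1.aSeq_pos ha (B1RG242Torus.one_lt_cast_L P) hk1
  have hα : 0 < B1RG242Torus.α P a k := mul_pos hak (inv_pos.mpr (pow_pos (P.spacing_pos k) 2))
  have hA0 : 0 < A := mul_pos hα (pow_pos P.cast_L_pos _)
  have hAak : 0 < A / ak := div_pos hA0 hak
  set γ₀ : ℝ := min (a / (9 * ((P.d : ℝ) + 1))) (1 / 12) with hγ₀def
  have hγ₀0 : 0 ≤ γ₀ := le_min (by positivity) (by norm_num)
  set E₀ : ℝ := 4 / 3 * (P.d : ℝ) ^ 4 * (((P.L : ℝ) ^ k) ^ 2 * θ) ^ 2 +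
      ak ^ 2 * (c₀ * Real.exp (δ₀ / 2) * latticeConst P.d (δ₀ / 2)) *
        ((m : ℝ) * Real.exp (-(δ₀ * (((P.L : ℝ) ^ k)⁻¹ * (2 * R)))) + Real.exp (-(δ₀ / 2 * (((P.L : ℝ) ^ k)⁻¹ * R₁)))) with hE₀def
  have hΔ : (deltaLocT A P.eps⁻¹ U k cube lam ζ'').IsHermitian :=
    deltaLocT_conjTranspose hk (inv_ne_zero P.eps_pos.ne') hA0 U hcube hlamsymm hζsymm
  have hγ : 0 ≤ A / ak * γ₀ := mul_nonneg hAak.le hγ₀0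
  have hκ : 0 ≤ A / ak * κ' := mul_nonneg hAak.le hκ'
  have hE' : A / ak * E₀ < c240 P (A / ak * γ₀) (A / ak * κ') * (1 - σ) := by
    rw [c240_smul P hAak.le, mul_assoc]
    exact mul_lt_mul_of_pos_left hE hAak
  -- §5 with `Adm φ := supp φ ⊆ Λ`
  have h238 : ∀ φ : Balaban1983to89.Site P (0 + k) → ℂ, (∀ x ∉ Λ, φ x = 0) →
      A / ak * γ₀ * ∑ b : PBond P (0 + k), ‖toC (lineIter U k b) * φ b.tgt - φ b.src‖ ^ 2 -
          A / ak * E₀ * ∑ x, ‖φ x‖ ^ 2 ≤ (star φ ⬝ᵥ (deltaLocT A P.eps⁻¹ U k cube lam ζ'' *ᵥ φ)).re := by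
    intro φ hφ
    have hmemΛ : ∀ y, φ y ≠ 0 → y ∈ Λ := fun y hy => by by_contra h; exact hy (hφ y h)
    have h5 := ineq238_of_inputs hk1 hk ha U hθ hΩ cube hlam hζ hδ₀ hc₀ hGΩ hC m (fun ψ => ∀ x ∉ Λ, ψ x = 0)
      (fun ψ hψ y₁ hy₁ => hrows y₁ (by by_contra h; exact hy₁ (hψ y₁ h)))
      (fun ψ hψ b hb => hΛ b (hb.elim (fun h => Or.inl (by by_contra h'; exact h (hψ _ h')))
        (fun h => Or.inr (by by_contra h'; exact h (hψ _ h'))))) φ hφ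
    rw [← hAdef, ← hakdef] at h5
    have e : A / ak * γ₀ * ∑ b : PBond P (0 + k), ‖toC (lineIter U k b) * φ b.tgt - φ b.src‖ ^ 2 - A / ak * E₀ * ∑ x, ‖φ x‖ ^ 2 =
        A / ak * (γ₀ * ∑ b : PBond P (0 + k), ‖toC (lineIter U k b) * φ b.tgt - φ b.src‖ ^ 2 - E₀ * ∑ x, ‖φ x‖ ^ 2) := by ring
    rw [e]
    exact h5
  have h := Z49_smallField_eq (Λ := Λ) hk' (lineIter U k) hInt hTree hσ hΔ hγ hκ hE' h238 Es N
  exact ⟨h.1, h.2, Z49_pos _ h.1 Es N⟩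

end Eq240

/-! ## §7 The inputs ARE theorems at flat backgrounds: gen 17's two members at one pair of constants -/

section FlatInstance

open BIJ88NeumannPropagatorFlatDecayCube (cubeT)
open BIJ88NeumannPropagatorFlatClose231 (fit_of_nested short_of_nested)
open BIJ88DeltaLocFlatClose235 (decay110_flat_cube_level close112_flat_cube_level)
open GaugeField (gaugeAct)

/-- **(H1.10) AND (H1.12) AT EVERY PURE-GAUGE BACKGROUND `u = 1^h`, AT ONE PAIR OF CONSTANTS** (non-vacuity of the two input shapes, by the
kernel): there are `δ₀, c₀ > 0` depending on `(d, ℓ, a)` only such that on every torus with `d + 1` directions and `L = ℓ + 1`, at every level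
`1 ≤ k ≤ K`, for every no-wrap box `Ω₀ = c·L^k + Π_i[0, L^kM₀_i)` fitting and shorter than the torus and every `h`: (H1.10) holds for
`G_k(Ω₀,1^h)` and, for every cube `□ = (c+t)·L^k + Π_i[0, L^kM_i)` NESTED in `Ω₀`, (H1.10) holds for `G_k(□,1^h)` and (H1.12) for the pair
`□ ⊆ Ω₀` — gen 17's `decay110_flat_cube_level` (p38's zero-field box theorem [6] (1.10)) and `close112_flat_cube_level` (r01/b04's [6]
(1.11)–(1.12) at `A = 0`) BY NAME, weakened to the common constants `(min δ, max c)` by §0.  Hence every member of §1–§6 is a hypothesis-free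
theorem at flat `u` for such data (gen 17/18's flat members are these instances, filed earlier with their own constants).
[cite: Balaban1983RegularityDecay, (1.10)–(1.12) p.573] -/
theorem inputs_flat (d ℓ : ℕ) (hℓ : 1 ≤ ℓ) {a : ℝ} (ha : 0 < a) :
    ∃ δ₀ c₀ : ℝ, 0 < δ₀ ∧ 0 < c₀ ∧ ∀ (P : Params) (hPd : P.d = d + 1), P.L = ℓ + 1 →
      ∀ k : ℕ, 1 ≤ k → k ≤ P.K → ∀ (c M0 : Fin (d + 1) → ℕ), (∀ i, 1 ≤ M0 i) →
        (∀ i, c i * P.L ^ k + P.L ^ k * M0 i ≤ P.sitesPerDir 0) → (∀ i, P.L ^ k * M0 i < P.sitesPerDir 0) →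
      ∀ h : GaugeTransf P 0 U1,
        (∀ (x : Balaban1983to89.Site P 0) (f : Balaban1983to89.Site P 0 → ℂ) (F D : ℝ), (∀ y, ‖f y‖ ≤ F) →
          (∀ y, f y ≠ 0 → D ≤ B5Ineq137Torus.T P 0 x y) →
          ‖(gBox (B1RG242Torus.α P a k * (P.L : ℝ) ^ (k * P.d)) P.eps⁻¹ (gaugeAct h (1 : GaugeField P 0 U1)) k
              (cubeT hPd (P.L ^ k) c fun i => P.L ^ k * M0 i) *ᵥ f) x‖ ≤
            P.spacing k ^ 2 * (c₀ * Real.exp (-(δ₀ * (((P.L : ℝ) ^ k)⁻¹ * D))) * F)) ∧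
        ∀ (t M : Fin (d + 1) → ℕ), (∀ i, 1 ≤ M i) → (∀ i, t i + M i ≤ M0 i) →
          (∀ (x : Balaban1983to89.Site P 0) (f : Balaban1983to89.Site P 0 → ℂ) (F D : ℝ), (∀ y, ‖f y‖ ≤ F) →
            (∀ y, f y ≠ 0 → D ≤ B5Ineq137Torus.T P 0 x y) →
            ‖(gBox (B1RG242Torus.α P a k * (P.L : ℝ) ^ (k * P.d)) P.eps⁻¹ (gaugeAct h (1 : GaugeField P 0 U1)) k
                (cubeT hPd (P.L ^ k) (c + t) fun i => P.L ^ k * M i) *ᵥ f) x‖ ≤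
              P.spacing k ^ 2 * (c₀ * Real.exp (-(δ₀ * (((P.L : ℝ) ^ k)⁻¹ * D))) * F)) ∧
          (∀ x ∈ cubeT hPd (P.L ^ k) (c + t) (fun i => P.L ^ k * M i), ∀ (f : Balaban1983to89.Site P 0 → ℂ) (F D Db Df : ℝ),
            (∀ y, ‖f y‖ ≤ F) → (∀ y, y ∉ cubeT hPd (P.L ^ k) (c + t) (fun i => P.L ^ k * M i) → f y = 0) →
            (∀ y, f y ≠ 0 → D ≤ B5Ineq137Torus.T P 0 x y) →
            (∀ w ∈ cubeT hPd (P.L ^ k) c (fun i => P.L ^ k * M0 i), w ∉ cubeT hPd (P.L ^ k) (c + t) (fun i => P.L ^ k * M i) →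
              Db ≤ B5Ineq137Torus.T P 0 x w) →
            (∀ y, f y ≠ 0 → ∀ w ∈ cubeT hPd (P.L ^ k) c (fun i => P.L ^ k * M0 i),
              w ∉ cubeT hPd (P.L ^ k) (c + t) (fun i => P.L ^ k * M i) → Df ≤ B5Ineq137Torus.T P 0 y w) →
            ‖(gBox (B1RG242Torus.α P a k * (P.L : ℝ) ^ (k * P.d)) P.eps⁻¹ (gaugeAct h (1 : GaugeField P 0 U1)) k
                  (cubeT hPd (P.L ^ k) (c + t) fun i => P.L ^ k * M i) *ᵥ f) x -
              (gBox (B1RG242Torus.α P a k * (P.L : ℝ) ^ (k * P.d)) P.eps⁻¹ (gaugeAct h (1 : GaugeField P 0 U1)) k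
                  (cubeT hPd (P.L ^ k) c fun i => P.L ^ k * M0 i) *ᵥ f) x‖ ≤
              P.spacing k ^ 2 * (c₀ * Real.exp (-(δ₀ * (((P.L : ℝ) ^ k)⁻¹ * D))) *
                Real.exp (-(δ₀ * (((P.L : ℝ) ^ k)⁻¹ * (Db + Df)))) * F)) := by
  obtain ⟨δ₁, c₁, hδ₁, hc₁, H1⟩ := close112_flat_cube_level d ℓ hℓ ha
  obtain ⟨δ₂, c₂, hδ₂, hc₂, H2⟩ := decay110_flat_cube_level d ℓ hℓ ha
  have hδ0 : 0 ≤ min δ₁ δ₂ := (lt_min hδ₁ hδ₂).le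
  refine ⟨min δ₁ δ₂, max c₁ c₂, lt_min hδ₁ hδ₂, lt_max_of_lt_left hc₁, ?_⟩
  intro P hPd hPL k hk1 hkK c M0 hM0 hfit0 hN0 h
  refine ⟨fun x f F D hF hsupp => input110_mono hδ0 (min_le_right _ _) hc₂.le (le_max_right _ _)
    (H2 P hPd hPL k hk1 hkK c M0 hM0 hfit0 hN0 h) x f F D hF hsupp, fun t M hM hnest => ⟨?_, ?_⟩⟩
  · exact fun x f F D hF hsupp => input110_mono hδ0 (min_le_right _ _) hc₂.le (le_max_right _ _)
      (H2 P hPd hPL k hk1 hkK (c + t) M hM (fit_of_nested hnest hfit0) (short_of_nested hnest hN0) h) x f F D hF hsupp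
  · exact fun x hx f F D Db Df hF hfs hsD hsDb hsDf => input112_mono hδ0 (min_le_left _ _) hc₁.le (le_max_left _ _)
      (H1 P hPd hPL k hk1 hkK c M0 t M hM hnest hfit0 hN0 h) x hx f F D Db Df hF hfs hsD hsDb hsDf

end FlatInstance

/-! ## §8 (2.41) for `C^{(k)}_Λ(u) = ((Δ_{k,loc}(u) + (A/a_k)κ′P(u_k))|_Λ)^{−1}` at an arbitrary small background (v1.1) -/

section Decay241

open BIJ85AbelianStokes (plaqC)
open BIJ88NeumannNoZeroModesTorus (IsBlockUnion innerK)
open BIJ88Sect3Statements (starB)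
open BIJ88Eq240FlatTorus (compress op240 c240)
open BIJ88Decay241SmallFieldTorus (decay241_smallField)
open BIJ88Decay241FlatTorus (c240_smul)
open B4Sect5Torus (weightC)
open B4Sect5Proof (latticeConst)

/-- **(2.41) FOR `C^{(k)}_Λ(u) = ((Δ_{k,loc}(u) + (A/a_k)κ′P(u_k))|_Λ)^{−1}` AT AN ARBITRARY SMALL BACKGROUND, CLOSED MODULO (H1.10)/(H1.12)**
(p. 264: *"This is of course a nonlocal operator, but by (2.38), C^{(k)}_Λ(u)^{−1} is bounded below and a random walk expansion as in [6] can be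
used to prove that |C^{(k)}_Λ(u; x₁, x₂)| ≦ ce^{−c|x₁−x₂|}. (2.41)"*): with the data and hypotheses of §6 (`Z49_of_inputs`) except the
symmetry ones (ARBITRARY finsets `□_α`, any real `λ, ζ″`: the Combes–Thomas engine needs no Hermitian `Δ`) and, in addition, (H1.10) for every
cube `□_α` (the (2.36) input of §3), for every rate `0 ≤ ϑ ≤ δ₀/4` satisfying the explicit smallness
`ϑ·(4/δ₀)·2K_d(δ₀/2)·(a_k(1 + m·a_kc₀e^{δ₀}) + κ′L^{−2d}e^{δ₀(L−1)}) ≤ (c₀^{(2.40)}(γ₀,κ′)(1 − σ) − E₀)/2` (`E₀` = the (2.38) error of §5):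
`‖C^{(k)}_Λ(u;x₁,x₂)‖ ≤ (A/a_k)^{−1}·(4/(c₀^{(2.40)}(γ₀,κ′)(1 − σ) − E₀))·e^{−ϑ|x₁−x₂|_{T^{(k)}}}` for all `x₁, x₂ ∈ Λ`, uniformly in the torus
and in `Λ` — gen 19's abstract `BIJ88Decay241SmallFieldTorus.decay241_smallField` (any `Δ` with a (2.38)-shape bound and a (2.36)-shape kernel
bound at a small bond field; engine [6] Sect. 5 `norm_inv_apply_le`) BY NAME, fed with §5 `ineq238_of_inputs` and §3 `decay236_of_input`
(`[y₁ = y₂] ≤ e^{−δ₀|y₁−y₂|}`); the factor `(A/a_k)^{−1}` is gen 15's counting normalization (gen 19: *"C = (A/a_k)^{−1}× the printed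
kernel"*).  gen 18/19's `decay241_flat` / `decay241_deltaRegion_smallField` / p29's `decay241_flat_cwt` are the instances with inputs PROVED.
[cite: BalabanImbrieJaffe1988, (2.41) p.264] -/
theorem decay241_of_inputs {k : ℕ} (hk1 : 1 ≤ k) (hk' : 0 + k + 1 ≤ P.m + P.K) {a : ℝ} (ha : 0 < a) (U : GaugeField P 0 U1) {θ : ℝ}
    (hθ : ∀ (x : Balaban1983to89.Site P 0) (μ ν : Fin P.d), ‖plaqC U x μ ν - 1‖ ≤ θ)
    {Ω : Finset (Balaban1983to89.Site P 0)} (hΩ : IsBlockUnion k Ω) {ι : Type*} [Fintype ι] (cube : ι → Finset (Balaban1983to89.Site P 0))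
    {lam : ι → Balaban1983to89.Site P 0 → Balaban1983to89.Site P 0 → ℝ} {ζ'' : Balaban1983to89.Site P 0 → Balaban1983to89.Site P 0 → ℝ}
    (hlam : ∀ x y, ∑ α, |lam α x y| ≤ 1) (hζ : ∀ x y, 0 ≤ ζ'' x y ∧ ζ'' x y ≤ 1) {δ₀ c₀ : ℝ} (hδ₀ : 0 < δ₀) (hc₀ : 0 ≤ c₀)
    (hGΩ : ∀ (x : Balaban1983to89.Site P 0) (f : Balaban1983to89.Site P 0 → ℂ) (F D : ℝ), (∀ y, ‖f y‖ ≤ F) →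
      (∀ y, f y ≠ 0 → D ≤ B5Ineq137Torus.T P 0 x y) →
      ‖(gBox (B1RG242Torus.α P a k * (P.L : ℝ) ^ (k * P.d)) P.eps⁻¹ U k Ω *ᵥ f) x‖ ≤
        P.spacing k ^ 2 * (c₀ * Real.exp (-(δ₀ * (((P.L : ℝ) ^ k)⁻¹ * D))) * F))
    (hG : ∀ α (x : Balaban1983to89.Site P 0) (f : Balaban1983to89.Site P 0 → ℂ) (F D : ℝ), (∀ y, ‖f y‖ ≤ F) →
      (∀ y, f y ≠ 0 → D ≤ B5Ineq137Torus.T P 0 x y) →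
      ‖(gBox (B1RG242Torus.α P a k * (P.L : ℝ) ^ (k * P.d)) P.eps⁻¹ U k (cube α) *ᵥ f) x‖ ≤
        P.spacing k ^ 2 * (c₀ * Real.exp (-(δ₀ * (((P.L : ℝ) ^ k)⁻¹ * D))) * F))
    (hC : ∀ α, ∀ x ∈ cube α, ∀ (f : Balaban1983to89.Site P 0 → ℂ) (F D Db Df : ℝ), (∀ y, ‖f y‖ ≤ F) → (∀ y, y ∉ cube α → f y = 0) →
      (∀ y, f y ≠ 0 → D ≤ B5Ineq137Torus.T P 0 x y) → (∀ w ∈ Ω, w ∉ cube α → Db ≤ B5Ineq137Torus.T P 0 x w) →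
      (∀ y, f y ≠ 0 → ∀ w ∈ Ω, w ∉ cube α → Df ≤ B5Ineq137Torus.T P 0 y w) →
      ‖(gBox (B1RG242Torus.α P a k * (P.L : ℝ) ^ (k * P.d)) P.eps⁻¹ U k (cube α) *ᵥ f) x -
          (gBox (B1RG242Torus.α P a k * (P.L : ℝ) ^ (k * P.d)) P.eps⁻¹ U k Ω *ᵥ f) x‖ ≤
        P.spacing k ^ 2 * (c₀ * Real.exp (-(δ₀ * (((P.L : ℝ) ^ k)⁻¹ * D))) * Real.exp (-(δ₀ * (((P.L : ℝ) ^ k)⁻¹ * (Db + Df)))) * F))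
    {R R₁ : ℝ} (m : ℕ) (Λ : Finset (Balaban1983to89.Site P (0 + k)))
    (hrows : ∀ y₁ ∈ Λ,
      (∀ x ∈ blockK k y₁, ∀ y, ζ'' x y ≠ 0 → ∑ α, lam α x y = 1) ∧
      (∀ x ∈ blockK k y₁, ∀ α y, ζ'' x y * lam α x y ≠ 0 → x ∈ cube α ∧ y ∈ cube α ∧
          ∀ w ∈ Ω, w ∉ cube α → R ≤ B5Ineq137Torus.T P 0 x w ∧ R ≤ B5Ineq137Torus.T P 0 y w) ∧
      (∀ x ∈ blockK k y₁, ∀ y, B5Ineq137Torus.T P 0 x y ≤ R₁ → ζ'' x y = 1) ∧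
      ∃ S : Finset ι, S.card ≤ m ∧ ∀ x ∈ blockK k y₁, ∀ α y, ζ'' x y * lam α x y ≠ 0 → α ∈ S)
    (hΛ : ∀ b : PBond P (0 + k), (b.src ∈ Λ ∨ b.tgt ∈ Λ) → b ∈ starB (innerK k Ω))
    {T₁ δ₁ σ : ℝ} (hInt : ∀ b : PBond P (0 + k), blkIter 1 b.src = blkIter 1 b.tgt → ‖toC (lineIter U k b) - 1‖ ≤ T₁)
    (hTree : ∀ y : Balaban1983to89.Site P (0 + k), ‖holCK (lineIter U k) 1 y - 1‖ ≤ δ₁)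
    (hσ : 2 * (((P.L : ℝ) - 1) * P.L) * P.d * T₁ ^ 2 + 2 * δ₁ ^ 2 ≤ σ) {κ' : ℝ} (hκ' : 0 ≤ κ')
    (hE : 4 / 3 * (P.d : ℝ) ^ 4 * (((P.L : ℝ) ^ k) ^ 2 * θ) ^ 2 +
        B1.aSeq a P.L k ^ 2 * (c₀ * Real.exp (δ₀ / 2) * latticeConst P.d (δ₀ / 2)) *
          ((m : ℝ) * Real.exp (-(δ₀ * (((P.L : ℝ) ^ k)⁻¹ * (2 * R)))) + Real.exp (-(δ₀ / 2 * (((P.L : ℝ) ^ k)⁻¹ * R₁)))) <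
      c240 P (min (a / (9 * (P.d + 1))) (1 / 12)) κ' * (1 - σ))
    {ϑ : ℝ} (hϑ0 : 0 ≤ ϑ) (hϑ : ϑ ≤ δ₀ / 4)
    (hsmall : ϑ * ((4 / δ₀) * (2 * latticeConst P.d (δ₀ / 2)) *
        (B1.aSeq a P.L k * (1 + m * B1.aSeq a P.L k * (c₀ * Real.exp δ₀)) +
          κ' * (((P.L : ℝ) ^ P.d)⁻¹) ^ 2 * Real.exp (δ₀ * ((P.L : ℝ) - 1)))) ≤
      (c240 P (min (a / (9 * (P.d + 1))) (1 / 12)) κ' * (1 - σ) -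
        (4 / 3 * (P.d : ℝ) ^ 4 * (((P.L : ℝ) ^ k) ^ 2 * θ) ^ 2 +
          B1.aSeq a P.L k ^ 2 * (c₀ * Real.exp (δ₀ / 2) * latticeConst P.d (δ₀ / 2)) *
            ((m : ℝ) * Real.exp (-(δ₀ * (((P.L : ℝ) ^ k)⁻¹ * (2 * R)))) + Real.exp (-(δ₀ / 2 * (((P.L : ℝ) ^ k)⁻¹ * R₁)))))) / 2)
    (x₁ x₂ : ↥Λ) :
    ‖(compress Λ (op240 (deltaLocT (B1RG242Torus.α P a k * (P.L : ℝ) ^ (k * P.d)) P.eps⁻¹ U k cube lam ζ'')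
        ((B1RG242Torus.α P a k * (P.L : ℝ) ^ (k * P.d)) / B1.aSeq a P.L k * κ') (lineIter U k)))⁻¹ x₁ x₂‖ ≤
      ((B1RG242Torus.α P a k * (P.L : ℝ) ^ (k * P.d)) / B1.aSeq a P.L k)⁻¹ *
        (4 / (c240 P (min (a / (9 * (P.d + 1))) (1 / 12)) κ' * (1 - σ) -
          (4 / 3 * (P.d : ℝ) ^ 4 * (((P.L : ℝ) ^ k) ^ 2 * θ) ^ 2 +
            B1.aSeq a P.L k ^ 2 * (c₀ * Real.exp (δ₀ / 2) * latticeConst P.d (δ₀ / 2)) *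
              ((m : ℝ) * Real.exp (-(δ₀ * (((P.L : ℝ) ^ k)⁻¹ * (2 * R)))) + Real.exp (-(δ₀ / 2 * (((P.L : ℝ) ^ k)⁻¹ * R₁))))))) *
        Real.exp (-(ϑ * B5Ineq137Torus.T P (0 + k) x₁ x₂)) := by
  have hk : 0 + k ≤ P.m + P.K := (Nat.le_succ _).trans hk'
  set A : ℝ := B1RG242Torus.α P a k * (P.L : ℝ) ^ (k * P.d) with hAdef
  set ak : ℝ := B1.aSeq a P.L k with hakdef
  have hak : 0 < ak := B1.aSeq_pos ha (B1RG242Torus.one_lt_cast_L P) hk1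
  have hα : 0 < B1RG242Torus.α P a k := mul_pos hak (inv_pos.mpr (pow_pos (P.spacing_pos k) 2))
  have hA0 : 0 < A := mul_pos hα (pow_pos P.cast_L_pos _)
  have hAak : 0 < A / ak := div_pos hA0 hak
  set γ₀ : ℝ := min (a / (9 * ((P.d : ℝ) + 1))) (1 / 12) with hγ₀def
  have hγ₀0 : 0 ≤ γ₀ := le_min (by positivity) (by norm_num)
  set E₀ : ℝ := 4 / 3 * (P.d : ℝ) ^ 4 * (((P.L : ℝ) ^ k) ^ 2 * θ) ^ 2 +
      ak ^ 2 * (c₀ * Real.exp (δ₀ / 2) * latticeConst P.d (δ₀ / 2)) *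
        ((m : ℝ) * Real.exp (-(δ₀ * (((P.L : ℝ) ^ k)⁻¹ * (2 * R)))) + Real.exp (-(δ₀ / 2 * (((P.L : ℝ) ^ k)⁻¹ * R₁)))) with hE₀def
  have hγ : 0 ≤ A / ak * γ₀ := mul_nonneg hAak.le hγ₀0
  have hκ : 0 ≤ A / ak * κ' := mul_nonneg hAak.le hκ'
  have hE' : A / ak * E₀ < c240 P (A / ak * γ₀) (A / ak * κ') * (1 - σ) := by
    rw [c240_smul P hAak.le, mul_assoc]
    exact mul_lt_mul_of_pos_left hE hAak
  have hgap : c240 P (A / ak * γ₀) (A / ak * κ') * (1 - σ) - A / ak * E₀ = A / ak * (c240 P γ₀ κ' * (1 - σ) - E₀) := by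
    rw [c240_smul P hAak.le]; ring
  -- (2.38) on the fields supported in Λ (§5)
  have h238 : ∀ φ : Balaban1983to89.Site P (0 + k) → ℂ, (∀ x ∉ Λ, φ x = 0) →
      A / ak * γ₀ * ∑ b : PBond P (0 + k), ‖toC (lineIter U k b) * φ b.tgt - φ b.src‖ ^ 2 -
          A / ak * E₀ * ∑ x, ‖φ x‖ ^ 2 ≤ (star φ ⬝ᵥ (deltaLocT A P.eps⁻¹ U k cube lam ζ'' *ᵥ φ)).re := by
    intro φ hφ
    have h5 := ineq238_of_inputs hk1 hk ha U hθ hΩ cube hlam hζ hδ₀ hc₀ hGΩ hC m (fun ψ => ∀ x ∉ Λ, ψ x = 0)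
      (fun ψ hψ y₁ hy₁ => hrows y₁ (by by_contra h; exact hy₁ (hψ y₁ h)))
      (fun ψ hψ b hb => hΛ b (hb.elim (fun h => Or.inl (by by_contra h'; exact h (hψ _ h')))
        (fun h => Or.inr (by by_contra h'; exact h (hψ _ h'))))) φ hφ
    rw [← hAdef, ← hakdef] at h5
    have e : A / ak * γ₀ * ∑ b : PBond P (0 + k), ‖toC (lineIter U k b) * φ b.tgt - φ b.src‖ ^ 2 - A / ak * E₀ * ∑ x, ‖φ x‖ ^ 2 =
        A / ak * (γ₀ * ∑ b : PBond P (0 + k), ‖toC (lineIter U k b) * φ b.tgt - φ b.src‖ ^ 2 - E₀ * ∑ x, ‖φ x‖ ^ 2) := by ring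
    rw [e]
    exact h5
  -- (2.36) on Λ × Λ (§3): `‖Δ_{k,loc}(u;y₁,y₂)‖ ≤ A(1 + m·a_k·c₀e^{δ₀})·e^{−δ₀|y₁−y₂|}`
  set cΔ : ℝ := A * (1 + m * ak * (c₀ * Real.exp δ₀)) with hcΔdef
  have hcΔ : 0 ≤ cΔ := by positivity
  have hker : ∀ y₁ ∈ Λ, ∀ y₂ ∈ Λ, ‖deltaLocT A P.eps⁻¹ U k cube lam ζ'' y₁ y₂‖ ≤
      cΔ * Real.exp (-(δ₀ * B5Ineq137Torus.T P (0 + k) y₁ y₂)) := by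
    intro y₁ hy₁ y₂ _
    obtain ⟨-, -, -, S, hSm, hS⟩ := hrows y₁ hy₁
    have h36 := decay236_of_input hk1 hk ha P.eps⁻¹ U cube hlam (fun x y => abs_le.2 ⟨by linarith [(hζ x y).1], (hζ x y).2⟩) hδ₀.le
      hc₀ hG y₁ y₂ S hS
    rw [← hAdef, ← hakdef] at h36
    have hT0 : 0 ≤ B5Ineq137Torus.T P (0 + k) y₁ y₂ := B5Ineq137Torus.T_nonneg P (0 + k) y₁ y₂
    have hind : (if y₁ = y₂ then (1 : ℝ) else 0) ≤ Real.exp (-(δ₀ * B5Ineq137Torus.T P (0 + k) y₁ y₂)) := by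
      split_ifs with h
      · rw [h, B5Ineq137Torus.T_self, mul_zero, neg_zero, Real.exp_zero]
      · exact Real.exp_nonneg _
    have hSm' : (S.card : ℝ) ≤ m := by exact_mod_cast hSm
    calc ‖deltaLocT A P.eps⁻¹ U k cube lam ζ'' y₁ y₂‖
        ≤ A * ((if y₁ = y₂ then 1 else 0) + S.card * ak * (c₀ * Real.exp δ₀) * Real.exp (-(δ₀ * B5Ineq137Torus.T P (0 + k) y₁ y₂))) := h36
      _ ≤ A * (Real.exp (-(δ₀ * B5Ineq137Torus.T P (0 + k) y₁ y₂)) +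
            m * ak * (c₀ * Real.exp δ₀) * Real.exp (-(δ₀ * B5Ineq137Torus.T P (0 + k) y₁ y₂))) :=
          mul_le_mul_of_nonneg_left (add_le_add hind (mul_le_mul_of_nonneg_right
            (mul_le_mul_of_nonneg_right (mul_le_mul_of_nonneg_right hSm' hak.le) (by positivity)) (Real.exp_nonneg _))) hA0.le
      _ = cΔ * Real.exp (-(δ₀ * B5Ineq137Torus.T P (0 + k) y₁ y₂)) := by rw [hcΔdef]; ring
  -- the smallness in the form of gen 19's abstract theorem
  have hW : weightC (fun t => 2 * latticeConst P.d t) (cΔ + A / ak * κ' * (((P.L : ℝ) ^ P.d)⁻¹) ^ 2 * Real.exp (δ₀ * ((P.L : ℝ) - 1))) δ₀ =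
      A / ak * ((4 / δ₀) * (2 * latticeConst P.d (δ₀ / 2)) *
        (ak * (1 + m * ak * (c₀ * Real.exp δ₀)) + κ' * (((P.L : ℝ) ^ P.d)⁻¹) ^ 2 * Real.exp (δ₀ * ((P.L : ℝ) - 1)))) := by
    rw [weightC, hcΔdef]
    field_simp
  have hsmall' : ϑ * weightC (fun t => 2 * latticeConst P.d t)
      (cΔ + A / ak * κ' * (((P.L : ℝ) ^ P.d)⁻¹) ^ 2 * Real.exp (δ₀ * ((P.L : ℝ) - 1))) δ₀ ≤
      (c240 P (A / ak * γ₀) (A / ak * κ') * (1 - σ) - A / ak * E₀) / 2 := by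
    rw [hW, hgap]
    have h1 := mul_le_mul_of_nonneg_left hsmall hAak.le
    linarith [h1]
  have h := decay241_smallField (Λ := Λ) hk' (lineIter U k) hInt hTree hσ hγ hκ hE' h238 hcΔ hδ₀ hker hϑ0 hϑ hsmall' x₁ x₂
  rw [hgap] at h
  refine h.trans (le_of_eq ?_)
  rw [hAdef, hakdef]
  field_simp

end Decay241

/-! ## §9 Adapter (v1.1): the LOCAL form of (H1.10) on a `k`-block union implies (H1.10) -/

section Adapters

open BIJ88NeumannNoZeroModesTorus (IsBlockUnion)
open BIJ88NeumannPropagator227Torus (isUnit_nPad)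
open BIJ85Ineq732FlatRegion (gBox_mulVec_apply_eq_zero)

/-- **(H1.10) FROM ITS LOCAL FORM** (how a provider's natural statement instantiates the hypothesis of §1–§8): if `X` is a union of `k`-blocks,
`A > 0`, `c′ ≠ 0`, and the bound `‖(G_k(X,u)f)(x)‖ ≤ s_k²·c₀e^{−δ₀D/L^k}·F` is known for the rows `x ∈ X` and for sources controlled ON `X` only
(`‖f‖ ≤ F` on `X`, `supp f ∩ X` at sup-torus distance `≥ D` from `x` — the shape announced by p27 g34 for the cube propagators at small
fields, 2026-08-23T00:16Z, up to the metric dictionary `B3Bound323ZeroTorus.T_eq_supDist`), then (H1.10) holds as stated in this file (all rows,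
global source conditions): off `X` the left side vanishes (`G_k(X,u)` is supported in `X × X`, gen 15 / gen 18's `gBox_mulVec_apply_eq_zero`),
and on `X` the global conditions restrict. [cite: Balaban1983RegularityDecay, (1.10) p.573] -/
theorem input110_of_local {k : ℕ} (hk : 0 + k ≤ P.m + P.K) {A c' : ℝ} (hA : 0 < A) (hc' : c' ≠ 0) (U : GaugeField P 0 U1)
    {X : Finset (Balaban1983to89.Site P 0)} (hX : IsBlockUnion k X) {δ₀ c₀ : ℝ} (hc₀ : 0 ≤ c₀)
    (hloc : ∀ x ∈ X, ∀ (f : Balaban1983to89.Site P 0 → ℂ) (F D : ℝ), (∀ y ∈ X, ‖f y‖ ≤ F) →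
      (∀ y ∈ X, f y ≠ 0 → D ≤ B5Ineq137Torus.T P 0 x y) →
      ‖(gBox A c' U k X *ᵥ f) x‖ ≤ P.spacing k ^ 2 * (c₀ * Real.exp (-(δ₀ * (((P.L : ℝ) ^ k)⁻¹ * D))) * F))
    (x : Balaban1983to89.Site P 0) (f : Balaban1983to89.Site P 0 → ℂ) (F D : ℝ) (hF : ∀ y, ‖f y‖ ≤ F)
    (hsupp : ∀ y, f y ≠ 0 → D ≤ B5Ineq137Torus.T P 0 x y) :
    ‖(gBox A c' U k X *ᵥ f) x‖ ≤ P.spacing k ^ 2 * (c₀ * Real.exp (-(δ₀ * (((P.L : ℝ) ^ k)⁻¹ * D))) * F) := by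
  by_cases hx : x ∈ X
  · exact hloc x hx f F D (fun y _ => hF y) (fun y _ hy => hsupp y hy)
  · rw [gBox_mulVec_apply_eq_zero (isUnit_nPad hk hc' hA U hX) f hx, norm_zero]
    have hF0 : 0 ≤ F := (norm_nonneg _).trans (hF x)
    positivity


end Adapters

/-! ## §10 (v1.1) THE ROW-RESTRICTED INPUT SHAPES WITH TORUS-EXTERIOR DEPTHS — the `_gen` family for depth-restricted providers

[6] p. 573 prints (1.9)–(1.12) *"for x with dist(x, Ω^c) ≥ R₀"* and the (1.12) factor with the distances to `Ω^c = T∖Ω` of the SMALLER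
set (r01 g26's SHAPE NOTE 2026-08-23T00:42Z on `BIJ85NeumannPropagatorRegularDecay`/`…RegularClose` at (2.23)-regular `A ≠ 0`); for
boxes at `A = 0` the restrictions disappear (b04), which is the case of §0–§8.  The members below take the inputs in the weaker, printed
form: (H1.10″) for `G_k(X,u)` only on a ROW SET `X₀` (resp. `X_α` for the cubes) and with the binder `0 ≤ D`; (H1.12″) for `□_α` against `Ω`
only on the rows `X_α`, with `0 ≤ D, D_b, D_f` and the depths `D_b, D_f` dominated by the sup-torus distances to EVERYTHING outside `□_α`
(`∀ w ∉ □_α`), and conclude at the rows / entries / supports lying in those row sets, under the correspondingly stronger row hypothesis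
(ii″): an active cube at `(x,y)` has `x ∈ X_α`, `y ∈ □_α` and `x, y` at sup-torus distance `≥ R` from `T∖□_α` (r18's `rowHyp_ii_torus` form).
Same proofs as §1–§8. -/

section Gen

open BIJ85AbelianStokes (plaqC)
open BIJ88NeumannNoZeroModesTorus (IsBlockUnion innerK)
open BIJ88Sect3Statements (starB)
open BIJ88Ineq238Proof (kform abs_kform_sub_le)
open BIJ88Ineq238FlatTorus (kform_eq_re_dotProduct sum_univ_eq_sum_starB)
open BIJ85Ineq732SmallFieldRegion (ineq238_deltaRegion_smallField_region)
open B5Ineq137Torus (T_symm rowSum_T_le)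
open B4Sect5Proof (latticeConst latticeConst_nonneg)
open BIJ88DeltaLoc234Torus (deltaLocT_conjTranspose)
open BIJ88Eq240FlatTorus (realify compress op240 c240)
open BIJ88Normalization46 (Z49 Z49_pos)
open BIJ88Decay241SmallFieldTorus (Z49_smallField_eq decay241_smallField)
open BIJ88Decay241FlatTorus (c240_smul)
open B4Sect5Torus (weightC)

/-- **(H1.10″), KERNEL CONSEQUENCE** at a row `x ∈ X₀`: `‖G_k(X,u;x,y)‖ ≤ s_k²·c₀e^{−δ₀|x−y|_T/L^k}`. [cite: Balaban1983RegularityDecay, (1.10) p.573] -/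
theorem input110_kernel_gen {k : ℕ} {A c' : ℝ} {U : GaugeField P 0 U1} {X X₀ : Finset (Balaban1983to89.Site P 0)} {δ₀ c₀ : ℝ}
    (hG : ∀ x ∈ X₀, ∀ (f : Balaban1983to89.Site P 0 → ℂ) (F D : ℝ), (∀ y, ‖f y‖ ≤ F) → 0 ≤ D →
      (∀ y, f y ≠ 0 → D ≤ B5Ineq137Torus.T P 0 x y) →
      ‖(gBox A c' U k X *ᵥ f) x‖ ≤ P.spacing k ^ 2 * (c₀ * Real.exp (-(δ₀ * (((P.L : ℝ) ^ k)⁻¹ * D))) * F))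
    {x : Balaban1983to89.Site P 0} (hx : x ∈ X₀) (y : Balaban1983to89.Site P 0) :
    ‖gBox A c' U k X x y‖ ≤ P.spacing k ^ 2 * (c₀ * Real.exp (-(δ₀ * (((P.L : ℝ) ^ k)⁻¹ * B5Ineq137Torus.T P 0 x y)))) := by
  have h1 := hG x hx (Pi.single y 1) 1 (B5Ineq137Torus.T P 0 x y) (fun z => by by_cases hz : z = y <;> simp [hz])
    (B5Ineq137Torus.T_nonneg P 0 x y)
    (fun z hz => by
      by_cases hzy : z = y
      · rw [hzy]
      · exact absurd (by simp [hzy]) hz)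
  rwa [mulVec_single_one, col_apply, mul_one] at h1

/-- **(H1.12″), KERNEL CONSEQUENCE** at `x ∈ X_α`, `y ∈ □_α`, `0 ≤ R_x, R_y` dominated by the sup-torus distances from `x`, resp. `y`, to `T∖□_α`:
`‖G_k(□_α,u;x,y) − G_k(Ω,u;x,y)‖ ≤ s_k²·c₀e^{−δ₀|x−y|_T/L^k}e^{−δ₀(R_x+R_y)/L^k}`. [cite: Balaban1983RegularityDecay, (1.11)–(1.12) p.573] -/
theorem input112_kernel_gen {k : ℕ} {A c' : ℝ} {U : GaugeField P 0 U1} {B Xr X : Finset (Balaban1983to89.Site P 0)} {δ₀ c₀ : ℝ}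
    (hC : ∀ x ∈ Xr, ∀ (f : Balaban1983to89.Site P 0 → ℂ) (F D Db Df : ℝ), (∀ y, ‖f y‖ ≤ F) → (∀ y, y ∉ B → f y = 0) → 0 ≤ D →
      (∀ y, f y ≠ 0 → D ≤ B5Ineq137Torus.T P 0 x y) → 0 ≤ Db → (∀ w, w ∉ B → Db ≤ B5Ineq137Torus.T P 0 x w) → 0 ≤ Df →
      (∀ y, f y ≠ 0 → ∀ w, w ∉ B → Df ≤ B5Ineq137Torus.T P 0 y w) →
      ‖(gBox A c' U k B *ᵥ f) x - (gBox A c' U k X *ᵥ f) x‖ ≤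
        P.spacing k ^ 2 * (c₀ * Real.exp (-(δ₀ * (((P.L : ℝ) ^ k)⁻¹ * D))) * Real.exp (-(δ₀ * (((P.L : ℝ) ^ k)⁻¹ * (Db + Df)))) * F))
    {x y : Balaban1983to89.Site P 0} (hx : x ∈ Xr) (hy : y ∈ B) {Rx Ry : ℝ} (hRx : 0 ≤ Rx) (hRy : 0 ≤ Ry)
    (hR : ∀ w, w ∉ B → Rx ≤ B5Ineq137Torus.T P 0 x w ∧ Ry ≤ B5Ineq137Torus.T P 0 y w) :
    ‖gBox A c' U k B x y - gBox A c' U k X x y‖ ≤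
      P.spacing k ^ 2 * (c₀ * Real.exp (-(δ₀ * (((P.L : ℝ) ^ k)⁻¹ * B5Ineq137Torus.T P 0 x y))) *
        Real.exp (-(δ₀ * (((P.L : ℝ) ^ k)⁻¹ * (Rx + Ry))))) := by
  have h1 := hC x hx (Pi.single y 1) 1 (B5Ineq137Torus.T P 0 x y) Rx Ry (fun z => by by_cases hz : z = y <;> simp [hz])
    (fun z hz => by
      by_cases hzy : z = y
      · exact absurd (hzy ▸ hy) hz
      · simp [hzy])
    (B5Ineq137Torus.T_nonneg P 0 x y)
    (fun z hz => by
      by_cases hzy : z = y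
      · rw [hzy]
      · exact absurd (by simp [hzy]) hz)
    hRx (fun w hw' => (hR w hw').1) hRy
    (fun z hz w hw' => by
      by_cases hzy : z = y
      · rw [hzy]; exact (hR w hw').2
      · exact absurd (by simp [hzy]) hz)
  rwa [mulVec_single_one, mulVec_single_one, col_apply, col_apply, mul_one] at h1

/-- **(2.30), OPERATOR FORM, FROM THE ROW-RESTRICTED (H1.10″) FOR THE CUBES**: as `opDecay230_of_input`, with (H1.10″) for `G_k(□_α,u)` asked
only on the rows `X_α`, `0 ≤ D`, and the row-`x` activity hypothesis `ζ″(x,y)λ_α(x,y) ≠ 0 ⟹ x ∈ X_α`.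
[cite: BalabanImbrieJaffe1988, (2.30) p.263] -/
theorem opDecay230_gen {k : ℕ} (A c' : ℝ) (U : GaugeField P 0 U1) {ι : Type*} [Fintype ι]
    (cube Xr : ι → Finset (Balaban1983to89.Site P 0)) {lam : ι → Balaban1983to89.Site P 0 → Balaban1983to89.Site P 0 → ℝ}
    {ζ'' : Balaban1983to89.Site P 0 → Balaban1983to89.Site P 0 → ℝ} (hlam : ∀ x y, ∑ α, |lam α x y| ≤ 1) (hζ : ∀ x y, |ζ'' x y| ≤ 1)
    {δ₀ c₀ : ℝ} (hc₀ : 0 ≤ c₀)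
    (hG : ∀ α, ∀ x ∈ Xr α, ∀ (f : Balaban1983to89.Site P 0 → ℂ) (F D : ℝ), (∀ y, ‖f y‖ ≤ F) → 0 ≤ D →
      (∀ y, f y ≠ 0 → D ≤ B5Ineq137Torus.T P 0 x y) →
      ‖(gBox A c' U k (cube α) *ᵥ f) x‖ ≤ P.spacing k ^ 2 * (c₀ * Real.exp (-(δ₀ * (((P.L : ℝ) ^ k)⁻¹ * D))) * F))
    (x : Balaban1983to89.Site P 0) (f : Balaban1983to89.Site P 0 → ℂ) {F D : ℝ} (hF : ∀ y, ‖f y‖ ≤ F) (hD : 0 ≤ D)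
    (hsupp : ∀ y, f y ≠ 0 → D ≤ B5Ineq137Torus.T P 0 x y) (hact : ∀ α y, ζ'' x y * lam α x y ≠ 0 → x ∈ Xr α)
    (S : Finset ι) (hS : ∀ α y, ζ'' x y * lam α x y ≠ 0 → f y ≠ 0 → α ∈ S) :
    ‖(gLocT A c' U k cube lam ζ'' *ᵥ f) x‖ ≤ P.spacing k ^ 2 * (S.card * (c₀ * Real.exp (-(δ₀ * (((P.L : ℝ) ^ k)⁻¹ * D))) * F)) := by
  have hF0 : 0 ≤ F := (norm_nonneg _).trans (hF x)
  rw [gLocT_mulVec_apply]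
  have hterm : ∀ α, ‖(gBox A c' U k (cube α) *ᵥ fun y => (ζ'' x y : ℂ) * (lam α x y : ℂ) * f y) x‖ ≤
      P.spacing k ^ 2 * (c₀ * Real.exp (-(δ₀ * (((P.L : ℝ) ^ k)⁻¹ * D))) * F) := by
    intro α
    by_cases hex : ∃ y, ζ'' x y * lam α x y ≠ 0
    · obtain ⟨y₀, hy₀⟩ := hex
      exact hG α x (hact α y₀ hy₀) _ F D (fun y => norm_rowSource_le (hζ x y) (abs_lam_le_one hlam α x y) hF y) hD
        (fun y hy => hsupp y (rowSource_ne_zero hy).2)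
    · push Not at hex
      have h0 : (fun y => (ζ'' x y : ℂ) * (lam α x y : ℂ) * f y) = 0 := by
        funext y; rw [← Complex.ofReal_mul, hex y, Complex.ofReal_zero, zero_mul]; rfl
      rw [h0, mulVec_zero, Pi.zero_apply, norm_zero]
      positivity
  have hzero : ∀ α, α ∉ S → (gBox A c' U k (cube α) *ᵥ fun y => (ζ'' x y : ℂ) * (lam α x y : ℂ) * f y) x = 0 := by
    intro α hα
    have h0 : (fun y => (ζ'' x y : ℂ) * (lam α x y : ℂ) * f y) = 0 := by
      funext y
      by_contra hne
      exact hα (hS α y (rowSource_ne_zero hne).1 (rowSource_ne_zero hne).2)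
    rw [h0, mulVec_zero, Pi.zero_apply]
  rw [← Finset.sum_subset (Finset.subset_univ S) (fun α _ hα => hzero α hα)]
  calc ‖∑ α ∈ S, (gBox A c' U k (cube α) *ᵥ fun y => (ζ'' x y : ℂ) * (lam α x y : ℂ) * f y) x‖
      ≤ ∑ α ∈ S, ‖(gBox A c' U k (cube α) *ᵥ fun y => (ζ'' x y : ℂ) * (lam α x y : ℂ) * f y) x‖ := norm_sum_le _ _
    _ ≤ ∑ α ∈ S, P.spacing k ^ 2 * (c₀ * Real.exp (-(δ₀ * (((P.L : ℝ) ^ k)⁻¹ * D))) * F) := Finset.sum_le_sum fun α _ => hterm α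
    _ = P.spacing k ^ 2 * (S.card * (c₀ * Real.exp (-(δ₀ * (((P.L : ℝ) ^ k)⁻¹ * D))) * F)) := by
        rw [Finset.sum_const, nsmul_eq_mul]; ring

/-- **(2.31), OPERATOR FORM, FROM THE ROW-RESTRICTED INPUTS WITH TORUS-EXTERIOR DEPTHS** (*"(2.31) for dist(x,Ω^c) ≧ O(r(e_k))"*): as
`opClose231_of_inputs`, with (H1.10″) for `G_k(Ω,u)` on the row set `X₀ ∋ x`, (H1.12″) for `□_α` on the rows `X_α` with depths to `T∖□_α`,
`0 ≤ R`, and row hypothesis (ii″): `ζ″(x,y)λ_α(x,y) ≠ 0 ⟹ x ∈ X_α ∧ y ∈ □_α ∧ |x−w|_T, |y−w|_T ≥ R for all w ∉ □_α`.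
[cite: BalabanImbrieJaffe1988, (2.31) p.263] -/
theorem opClose231_gen {k : ℕ} (A c' : ℝ) (U : GaugeField P 0 U1) (Ω X₀ : Finset (Balaban1983to89.Site P 0)) {ι : Type*} [Fintype ι]
    (cube Xr : ι → Finset (Balaban1983to89.Site P 0)) {lam : ι → Balaban1983to89.Site P 0 → Balaban1983to89.Site P 0 → ℝ}
    {ζ'' : Balaban1983to89.Site P 0 → Balaban1983to89.Site P 0 → ℝ} (hlam : ∀ x y, ∑ α, |lam α x y| ≤ 1)
    (hζ : ∀ x y, 0 ≤ ζ'' x y ∧ ζ'' x y ≤ 1) {δ₀ c₀ : ℝ} (hδ₀ : 0 ≤ δ₀) (hc₀ : 0 ≤ c₀)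
    (hGΩ : ∀ x ∈ X₀, ∀ (f : Balaban1983to89.Site P 0 → ℂ) (F D : ℝ), (∀ y, ‖f y‖ ≤ F) → 0 ≤ D →
      (∀ y, f y ≠ 0 → D ≤ B5Ineq137Torus.T P 0 x y) →
      ‖(gBox A c' U k Ω *ᵥ f) x‖ ≤ P.spacing k ^ 2 * (c₀ * Real.exp (-(δ₀ * (((P.L : ℝ) ^ k)⁻¹ * D))) * F))
    (hC : ∀ α, ∀ x ∈ Xr α, ∀ (f : Balaban1983to89.Site P 0 → ℂ) (F D Db Df : ℝ), (∀ y, ‖f y‖ ≤ F) → (∀ y, y ∉ cube α → f y = 0) →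
      0 ≤ D → (∀ y, f y ≠ 0 → D ≤ B5Ineq137Torus.T P 0 x y) → 0 ≤ Db → (∀ w, w ∉ cube α → Db ≤ B5Ineq137Torus.T P 0 x w) →
      0 ≤ Df → (∀ y, f y ≠ 0 → ∀ w, w ∉ cube α → Df ≤ B5Ineq137Torus.T P 0 y w) →
      ‖(gBox A c' U k (cube α) *ᵥ f) x - (gBox A c' U k Ω *ᵥ f) x‖ ≤
        P.spacing k ^ 2 * (c₀ * Real.exp (-(δ₀ * (((P.L : ℝ) ^ k)⁻¹ * D))) * Real.exp (-(δ₀ * (((P.L : ℝ) ^ k)⁻¹ * (Db + Df)))) * F))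
    (x : Balaban1983to89.Site P 0) (hx : x ∈ X₀) {R R₁ : ℝ} (hR : 0 ≤ R) (hcomp : ∀ y, ζ'' x y ≠ 0 → ∑ α, lam α x y = 1)
    (hdeep : ∀ α y, ζ'' x y * lam α x y ≠ 0 → x ∈ Xr α ∧ y ∈ cube α ∧
      ∀ w, w ∉ cube α → R ≤ B5Ineq137Torus.T P 0 x w ∧ R ≤ B5Ineq137Torus.T P 0 y w)
    (hcut : ∀ y, B5Ineq137Torus.T P 0 x y ≤ R₁ → ζ'' x y = 1)
    (f : Balaban1983to89.Site P 0 → ℂ) {F D : ℝ} (hF : ∀ y, ‖f y‖ ≤ F) (hD : 0 ≤ D) (hsupp : ∀ y, f y ≠ 0 → D ≤ B5Ineq137Torus.T P 0 x y)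
    (S : Finset ι) (hS : ∀ α y, ζ'' x y * lam α x y ≠ 0 → f y ≠ 0 → α ∈ S) :
    ‖(gLocT A c' U k cube lam ζ'' *ᵥ f) x - (gBox A c' U k Ω *ᵥ f) x‖ ≤
      P.spacing k ^ 2 * (c₀ * (S.card * Real.exp (-(δ₀ * (((P.L : ℝ) ^ k)⁻¹ * (2 * R)))) + Real.exp (-(δ₀ / 2 * (((P.L : ℝ) ^ k)⁻¹ * R₁)))) *
        Real.exp (-(δ₀ / 2 * (((P.L : ℝ) ^ k)⁻¹ * D))) * F) := by
  have hε : 0 < ((P.L : ℝ) ^ k)⁻¹ := inv_pos.mpr (pow_pos P.cast_L_pos _)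
  have hF0 : 0 ≤ F := (norm_nonneg _).trans (hF x)
  have hs0 : 0 ≤ P.spacing k ^ 2 := sq_nonneg _
  have hζ1 : ∀ y, |ζ'' x y| ≤ 1 := fun y => abs_le.2 ⟨by linarith [(hζ x y).1], (hζ x y).2⟩
  set G0 := gBox A c' U k Ω with hG0def
  rw [gLocT_sub_mulVec_apply _ _ _ _ cube lam ζ'' G0 f x hcomp]
  set B := P.spacing k ^ 2 * (c₀ * Real.exp (-(δ₀ * (((P.L : ℝ) ^ k)⁻¹ * D))) * Real.exp (-(δ₀ * (((P.L : ℝ) ^ k)⁻¹ * (R + R)))) * F)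
    with hBdef
  have hB0 : 0 ≤ B := by positivity
  have hterm : ∀ α, ‖((gBox A c' U k (cube α) - G0) *ᵥ fun y => (ζ'' x y : ℂ) * (lam α x y : ℂ) * f y) x‖ ≤ B := by
    intro α
    by_cases hex : ∃ y, ζ'' x y * lam α x y ≠ 0
    · obtain ⟨y₀, hy₀⟩ := hex
      obtain ⟨hxα, -, hwx⟩ := hdeep α y₀ hy₀
      have hyα : ∀ y, (ζ'' x y : ℂ) * (lam α x y : ℂ) * f y ≠ 0 → y ∈ cube α :=
        fun y hy => (hdeep α y (rowSource_ne_zero hy).1).2.1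
      have hwy : ∀ y, (ζ'' x y : ℂ) * (lam α x y : ℂ) * f y ≠ 0 → ∀ w, w ∉ cube α → R ≤ B5Ineq137Torus.T P 0 y w :=
        fun y hy w hw' => ((hdeep α y (rowSource_ne_zero hy).1).2.2 w hw').2
      rw [Matrix.sub_mulVec, Pi.sub_apply]
      exact hC α x hxα _ F D R R (fun y => norm_rowSource_le (hζ1 y) (abs_lam_le_one hlam α x y) hF y)
        (fun y hy => by by_contra hne; exact hy (hyα y hne)) hD (fun y hy => hsupp y (rowSource_ne_zero hy).2)
        hR (fun w hw' => (hwx w hw').1) hR hwy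
    · push Not at hex
      have h0 : (fun y => (ζ'' x y : ℂ) * (lam α x y : ℂ) * f y) = 0 := by
        funext y; rw [← Complex.ofReal_mul, hex y, Complex.ofReal_zero, zero_mul]; rfl
      rw [h0, mulVec_zero, Pi.zero_apply, norm_zero]
      exact hB0
  have hzero : ∀ α, α ∉ S → ((gBox A c' U k (cube α) - G0) *ᵥ fun y => (ζ'' x y : ℂ) * (lam α x y : ℂ) * f y) x = 0 := by
    intro α hα
    have h0 : (fun y => (ζ'' x y : ℂ) * (lam α x y : ℂ) * f y) = 0 := by
      funext y
      by_contra hne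
      exact hα (hS α y (rowSource_ne_zero hne).1 (rowSource_ne_zero hne).2)
    rw [h0, mulVec_zero, Pi.zero_apply]
  have hsum : ‖∑ α, ((gBox A c' U k (cube α) - G0) *ᵥ fun y => (ζ'' x y : ℂ) * (lam α x y : ℂ) * f y) x‖ ≤ S.card * B := by
    rw [← Finset.sum_subset (Finset.subset_univ S) (fun α _ hα => hzero α hα)]
    calc ‖∑ α ∈ S, ((gBox A c' U k (cube α) - G0) *ᵥ fun y => (ζ'' x y : ℂ) * (lam α x y : ℂ) * f y) x‖
        ≤ ∑ α ∈ S, ‖((gBox A c' U k (cube α) - G0) *ᵥ fun y => (ζ'' x y : ℂ) * (lam α x y : ℂ) * f y) x‖ := norm_sum_le _ _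
      _ ≤ ∑ α ∈ S, B := Finset.sum_le_sum fun α _ => hterm α
      _ = S.card * B := by rw [Finset.sum_const, nsmul_eq_mul]
  have htail : ‖(G0 *ᵥ fun y => ((ζ'' x y : ℂ) - 1) * f y) x‖ ≤
      P.spacing k ^ 2 * (c₀ * Real.exp (-(δ₀ * (((P.L : ℝ) ^ k)⁻¹ * max D R₁))) * F) := by
    refine hGΩ x hx _ F (max D R₁) (fun y => ?_) (hD.trans (le_max_left _ _)) (fun y hy => ?_)
    · have hz1 : ‖(ζ'' x y : ℂ) - 1‖ ≤ 1 := by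
        rw [← Complex.ofReal_one, ← Complex.ofReal_sub, Complex.norm_real, Real.norm_eq_abs, abs_le]
        constructor <;> linarith [(hζ x y).1, (hζ x y).2]
      calc ‖((ζ'' x y : ℂ) - 1) * f y‖ = ‖(ζ'' x y : ℂ) - 1‖ * ‖f y‖ := norm_mul _ _
        _ ≤ 1 * F := mul_le_mul hz1 (hF y) (norm_nonneg _) zero_le_one
        _ = F := one_mul F
    · have hf : f y ≠ 0 := fun hf => hy (by rw [hf, mul_zero])
      have hz : ζ'' x y ≠ 1 := fun h1 => hy (by rw [h1]; push_cast; rw [sub_self, zero_mul])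
      exact max_le (hsupp y hf) (le_of_lt (lt_of_not_ge fun hle => hz (hcut y hle)))
  have hεD : 0 ≤ ((P.L : ℝ) ^ k)⁻¹ * D := mul_nonneg hε.le hD
  have hsum' : (S.card : ℝ) * B ≤
      P.spacing k ^ 2 * (c₀ * (S.card * Real.exp (-(δ₀ * (((P.L : ℝ) ^ k)⁻¹ * (2 * R))))) *
        Real.exp (-(δ₀ / 2 * (((P.L : ℝ) ^ k)⁻¹ * D))) * F) := by
    have h1 : c₀ * Real.exp (-(δ₀ * (((P.L : ℝ) ^ k)⁻¹ * D))) * Real.exp (-(δ₀ * (((P.L : ℝ) ^ k)⁻¹ * (R + R)))) * F ≤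
        c₀ * Real.exp (-(δ₀ * (((P.L : ℝ) ^ k)⁻¹ * (2 * R)))) * Real.exp (-(δ₀ / 2 * (((P.L : ℝ) ^ k)⁻¹ * D))) * F := by
      rw [mul_assoc c₀, mul_comm (Real.exp _) (Real.exp _), ← mul_assoc c₀]
      refine mul_le_mul_of_nonneg_right (mul_le_mul (mul_le_mul_of_nonneg_left ?_ hc₀) ?_ (Real.exp_pos _).le
        (by positivity)) hF0
      · rw [show R + R = 2 * R by ring]
      · exact exp_le_exp_of_rate (by linarith) hεD
    calc (S.card : ℝ) * B = P.spacing k ^ 2 * (S.card * (c₀ * Real.exp (-(δ₀ * (((P.L : ℝ) ^ k)⁻¹ * D))) *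
          Real.exp (-(δ₀ * (((P.L : ℝ) ^ k)⁻¹ * (R + R)))) * F)) := by rw [hBdef]; ring
      _ ≤ P.spacing k ^ 2 * (S.card * (c₀ * Real.exp (-(δ₀ * (((P.L : ℝ) ^ k)⁻¹ * (2 * R)))) *
          Real.exp (-(δ₀ / 2 * (((P.L : ℝ) ^ k)⁻¹ * D))) * F)) :=
          mul_le_mul_of_nonneg_left (mul_le_mul_of_nonneg_left h1 (Nat.cast_nonneg _)) hs0
      _ = _ := by ring
  have htail' : P.spacing k ^ 2 * (c₀ * Real.exp (-(δ₀ * (((P.L : ℝ) ^ k)⁻¹ * max D R₁))) * F) ≤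
      P.spacing k ^ 2 * (c₀ * Real.exp (-(δ₀ / 2 * (((P.L : ℝ) ^ k)⁻¹ * R₁))) * Real.exp (-(δ₀ / 2 * (((P.L : ℝ) ^ k)⁻¹ * D))) * F) := by
    refine mul_le_mul_of_nonneg_left (mul_le_mul_of_nonneg_right ?_ hF0) hs0
    rw [mul_assoc c₀, ← Real.exp_add]
    refine mul_le_mul_of_nonneg_left (Real.exp_le_exp.2 ?_) hc₀
    have hm1 : D ≤ max D R₁ := le_max_left _ _
    have hm2 : R₁ ≤ max D R₁ := le_max_right _ _
    have hm0 : 0 ≤ ((P.L : ℝ) ^ k)⁻¹ * max D R₁ := mul_nonneg hε.le (hD.trans hm1)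
    nlinarith [mul_le_mul_of_nonneg_left hm1 hε.le, mul_le_mul_of_nonneg_left hm2 hε.le, mul_nonneg hδ₀ hm0]
  calc ‖∑ α, ((gBox A c' U k (cube α) - G0) *ᵥ fun y => (ζ'' x y : ℂ) * (lam α x y : ℂ) * f y) x +
          (G0 *ᵥ fun y => ((ζ'' x y : ℂ) - 1) * f y) x‖
      ≤ S.card * B + P.spacing k ^ 2 * (c₀ * Real.exp (-(δ₀ * (((P.L : ℝ) ^ k)⁻¹ * max D R₁))) * F) :=
        (norm_add_le _ _).trans (add_le_add hsum htail)
    _ ≤ P.spacing k ^ 2 * (c₀ * (S.card * Real.exp (-(δ₀ * (((P.L : ℝ) ^ k)⁻¹ * (2 * R))))) *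
          Real.exp (-(δ₀ / 2 * (((P.L : ℝ) ^ k)⁻¹ * D))) * F) +
        P.spacing k ^ 2 * (c₀ * Real.exp (-(δ₀ / 2 * (((P.L : ℝ) ^ k)⁻¹ * R₁))) * Real.exp (-(δ₀ / 2 * (((P.L : ℝ) ^ k)⁻¹ * D))) * F) :=
        add_le_add hsum' htail'
    _ = _ := by ring

/-- **(2.31), KERNEL FORM, FROM THE ROW-RESTRICTED INPUTS WITH TORUS-EXTERIOR DEPTHS**: as `close231_kernel_of_inputs`, at a row `x ∈ X₀`
under (ii″) and `0 ≤ R`. [cite: BalabanImbrieJaffe1988, (2.31) p.263] -/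
theorem close231_kernel_gen {k : ℕ} (A c' : ℝ) (U : GaugeField P 0 U1) (Ω X₀ : Finset (Balaban1983to89.Site P 0))
    {ι : Type*} [Fintype ι] (cube Xr : ι → Finset (Balaban1983to89.Site P 0))
    {lam : ι → Balaban1983to89.Site P 0 → Balaban1983to89.Site P 0 → ℝ} {ζ'' : Balaban1983to89.Site P 0 → Balaban1983to89.Site P 0 → ℝ}
    (hlam : ∀ x y, ∑ α, |lam α x y| ≤ 1) (hζ : ∀ x y, 0 ≤ ζ'' x y ∧ ζ'' x y ≤ 1) {δ₀ c₀ : ℝ} (hδ₀ : 0 ≤ δ₀) (hc₀ : 0 ≤ c₀)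
    (hGΩ : ∀ x ∈ X₀, ∀ (f : Balaban1983to89.Site P 0 → ℂ) (F D : ℝ), (∀ y, ‖f y‖ ≤ F) → 0 ≤ D →
      (∀ y, f y ≠ 0 → D ≤ B5Ineq137Torus.T P 0 x y) →
      ‖(gBox A c' U k Ω *ᵥ f) x‖ ≤ P.spacing k ^ 2 * (c₀ * Real.exp (-(δ₀ * (((P.L : ℝ) ^ k)⁻¹ * D))) * F))
    (hC : ∀ α, ∀ x ∈ Xr α, ∀ (f : Balaban1983to89.Site P 0 → ℂ) (F D Db Df : ℝ), (∀ y, ‖f y‖ ≤ F) → (∀ y, y ∉ cube α → f y = 0) →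
      0 ≤ D → (∀ y, f y ≠ 0 → D ≤ B5Ineq137Torus.T P 0 x y) → 0 ≤ Db → (∀ w, w ∉ cube α → Db ≤ B5Ineq137Torus.T P 0 x w) →
      0 ≤ Df → (∀ y, f y ≠ 0 → ∀ w, w ∉ cube α → Df ≤ B5Ineq137Torus.T P 0 y w) →
      ‖(gBox A c' U k (cube α) *ᵥ f) x - (gBox A c' U k Ω *ᵥ f) x‖ ≤
        P.spacing k ^ 2 * (c₀ * Real.exp (-(δ₀ * (((P.L : ℝ) ^ k)⁻¹ * D))) * Real.exp (-(δ₀ * (((P.L : ℝ) ^ k)⁻¹ * (Db + Df)))) * F))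
    (x : Balaban1983to89.Site P 0) (hx : x ∈ X₀) {R R₁ : ℝ} (hR : 0 ≤ R) (hcomp : ∀ y, ζ'' x y ≠ 0 → ∑ α, lam α x y = 1)
    (hdeep : ∀ α y, ζ'' x y * lam α x y ≠ 0 → x ∈ Xr α ∧ y ∈ cube α ∧
      ∀ w, w ∉ cube α → R ≤ B5Ineq137Torus.T P 0 x w ∧ R ≤ B5Ineq137Torus.T P 0 y w)
    (hcut : ∀ y, B5Ineq137Torus.T P 0 x y ≤ R₁ → ζ'' x y = 1) (y : Balaban1983to89.Site P 0) :
    ‖gLocT A c' U k cube lam ζ'' x y - gBox A c' U k Ω x y‖ ≤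
      P.spacing k ^ 2 * (c₀ * (Real.exp (-(δ₀ * (((P.L : ℝ) ^ k)⁻¹ * (2 * R)))) + Real.exp (-(δ₀ / 2 * (((P.L : ℝ) ^ k)⁻¹ * R₁)))) *
        Real.exp (-(δ₀ / 2 * (((P.L : ℝ) ^ k)⁻¹ * B5Ineq137Torus.T P 0 x y)))) := by
  have hε : 0 < ((P.L : ℝ) ^ k)⁻¹ := inv_pos.mpr (pow_pos P.cast_L_pos _)
  have hs0 : 0 ≤ P.spacing k ^ 2 := sq_nonneg _
  set Txy := B5Ineq137Torus.T P 0 x y with hTdef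
  have hT0 : 0 ≤ Txy := B5Ineq137Torus.T_nonneg P 0 x y
  set G0 := gBox A c' U k Ω with hG0def
  have hG0 : ‖G0 x y‖ ≤ P.spacing k ^ 2 * (c₀ * Real.exp (-(δ₀ * (((P.L : ℝ) ^ k)⁻¹ * Txy)))) := input110_kernel_gen hGΩ hx y
  have hGa : ∀ α, ζ'' x y * lam α x y ≠ 0 → ‖gBox A c' U k (cube α) x y - G0 x y‖ ≤
      P.spacing k ^ 2 * (c₀ * Real.exp (-(δ₀ * (((P.L : ℝ) ^ k)⁻¹ * Txy))) * Real.exp (-(δ₀ * (((P.L : ℝ) ^ k)⁻¹ * (R + R))))) := by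
    intro α hα
    obtain ⟨hxα, hyα, hw⟩ := hdeep α y hα
    exact input112_kernel_gen (hC α) hxα hyα hR hR hw
  rw [gLocT_sub_eq _ _ _ _ cube lam ζ'' G0 (hcomp y)]
  set B := P.spacing k ^ 2 * (c₀ * Real.exp (-(δ₀ * (((P.L : ℝ) ^ k)⁻¹ * Txy))) * Real.exp (-(δ₀ * (((P.L : ℝ) ^ k)⁻¹ * (R + R)))))
    with hBdef
  have hB0 : 0 ≤ B := by positivity
  have h1 : ‖(ζ'' x y : ℂ) * ∑ α, (lam α x y : ℂ) * (gBox A c' U k (cube α) x y - G0 x y)‖ ≤ B := by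
    have hz1 : |ζ'' x y| ≤ 1 := abs_le.2 ⟨by linarith [(hζ x y).1], (hζ x y).2⟩
    calc ‖(ζ'' x y : ℂ) * ∑ α, (lam α x y : ℂ) * (gBox A c' U k (cube α) x y - G0 x y)‖
        ≤ |ζ'' x y| * ∑ α, |lam α x y| * ‖gBox A c' U k (cube α) x y - G0 x y‖ := by
            rw [norm_mul, Complex.norm_real, Real.norm_eq_abs]
            refine mul_le_mul_of_nonneg_left ((norm_sum_le _ _).trans (Finset.sum_le_sum fun α _ => ?_)) (abs_nonneg _)
            rw [norm_mul, Complex.norm_real, Real.norm_eq_abs]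
      _ = ∑ α, |ζ'' x y * lam α x y| * ‖gBox A c' U k (cube α) x y - G0 x y‖ := by
            rw [Finset.mul_sum]
            exact Finset.sum_congr rfl fun α _ => by rw [abs_mul, mul_assoc]
      _ ≤ ∑ α, |ζ'' x y * lam α x y| * B := Finset.sum_le_sum fun α _ => by
            by_cases hα : ζ'' x y * lam α x y = 0
            · rw [hα, abs_zero, zero_mul, zero_mul]
            · exact mul_le_mul_of_nonneg_left (hGa α hα) (abs_nonneg _)
      _ = |ζ'' x y| * (∑ α, |lam α x y|) * B := by
            rw [Finset.mul_sum, Finset.sum_mul]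
            exact Finset.sum_congr rfl fun α _ => by rw [abs_mul]
      _ ≤ 1 * 1 * B := mul_le_mul_of_nonneg_right
            (mul_le_mul hz1 (hlam x y) (Finset.sum_nonneg fun α _ => abs_nonneg _) zero_le_one) hB0
      _ = B := by ring
  have h2 : ‖((ζ'' x y : ℂ) - 1) * G0 x y‖ ≤
      P.spacing k ^ 2 * (c₀ * Real.exp (-(δ₀ / 2 * (((P.L : ℝ) ^ k)⁻¹ * R₁))) * Real.exp (-(δ₀ / 2 * (((P.L : ℝ) ^ k)⁻¹ * Txy)))) := by
    by_cases hT1 : Txy ≤ R₁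
    · rw [hcut y hT1]
      push_cast
      rw [sub_self, zero_mul, norm_zero]
      positivity
    · rw [not_le] at hT1
      have hz1 : ‖(ζ'' x y : ℂ) - 1‖ ≤ 1 := by
        rw [← Complex.ofReal_one, ← Complex.ofReal_sub, Complex.norm_real, Real.norm_eq_abs, abs_le]
        constructor <;> linarith [(hζ x y).1, (hζ x y).2]
      calc ‖((ζ'' x y : ℂ) - 1) * G0 x y‖ = ‖(ζ'' x y : ℂ) - 1‖ * ‖G0 x y‖ := norm_mul _ _
        _ ≤ 1 * (P.spacing k ^ 2 * (c₀ * Real.exp (-(δ₀ * (((P.L : ℝ) ^ k)⁻¹ * Txy))))) :=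
            mul_le_mul hz1 hG0 (norm_nonneg _) zero_le_one
        _ ≤ P.spacing k ^ 2 * (c₀ * Real.exp (-(δ₀ / 2 * (((P.L : ℝ) ^ k)⁻¹ * R₁))) * Real.exp (-(δ₀ / 2 * (((P.L : ℝ) ^ k)⁻¹ * Txy)))) := by
            rw [one_mul, mul_assoc c₀, ← Real.exp_add]
            refine mul_le_mul_of_nonneg_left (mul_le_mul_of_nonneg_left (Real.exp_le_exp.2 ?_) hc₀) hs0
            have : ((P.L : ℝ) ^ k)⁻¹ * R₁ ≤ ((P.L : ℝ) ^ k)⁻¹ * Txy := mul_le_mul_of_nonneg_left hT1.le hε.le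
            nlinarith
  have hεT : 0 ≤ ((P.L : ℝ) ^ k)⁻¹ * Txy := mul_nonneg hε.le hT0
  have h1' : B ≤ P.spacing k ^ 2 * (c₀ * Real.exp (-(δ₀ * (((P.L : ℝ) ^ k)⁻¹ * (2 * R)))) *
      Real.exp (-(δ₀ / 2 * (((P.L : ℝ) ^ k)⁻¹ * Txy)))) := by
    rw [hBdef, mul_assoc c₀, mul_assoc c₀, mul_comm (Real.exp (-(δ₀ * (((P.L : ℝ) ^ k)⁻¹ * Txy)))) (Real.exp _)]
    refine mul_le_mul_of_nonneg_left (mul_le_mul_of_nonneg_left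
      (mul_le_mul ?_ ?_ (Real.exp_pos _).le (Real.exp_pos _).le) hc₀) hs0
    · rw [show R + R = 2 * R by ring]
    · exact exp_le_exp_of_rate (by linarith) hεT
  calc ‖(ζ'' x y : ℂ) * ∑ α, (lam α x y : ℂ) * (gBox A c' U k (cube α) x y - G0 x y) + ((ζ'' x y : ℂ) - 1) * G0 x y‖
      ≤ B + P.spacing k ^ 2 * (c₀ * Real.exp (-(δ₀ / 2 * (((P.L : ℝ) ^ k)⁻¹ * R₁))) * Real.exp (-(δ₀ / 2 * (((P.L : ℝ) ^ k)⁻¹ * Txy)))) :=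
        (norm_add_le _ _).trans (add_le_add h1 h2)
    _ ≤ P.spacing k ^ 2 * (c₀ * Real.exp (-(δ₀ * (((P.L : ℝ) ^ k)⁻¹ * (2 * R)))) * Real.exp (-(δ₀ / 2 * (((P.L : ℝ) ^ k)⁻¹ * Txy)))) +
        P.spacing k ^ 2 * (c₀ * Real.exp (-(δ₀ / 2 * (((P.L : ℝ) ^ k)⁻¹ * R₁))) * Real.exp (-(δ₀ / 2 * (((P.L : ℝ) ^ k)⁻¹ * Txy)))) :=
        add_le_add h1' le_rfl
    _ = _ := by ring

/-- **(2.36) FOR `Δ_k(Ω,u)` FROM (H1.10″) ON A ROW SET `X₀`**, at the entries `(y₁, y₂)` with `B^k(y₁) ⊆ X₀` (r01's depth-restricted member for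
`G_k(Ω, e^{ieεA})` at (2.23)-regular `A` has this shape): the bound of `decay236_region_of_input`. [cite: BalabanImbrieJaffe1988, (2.36) p.263] -/
theorem decay236_region_gen {k : ℕ} (hk1 : 1 ≤ k) (hk : 0 + k ≤ P.m + P.K) {a : ℝ} (ha : 0 < a) (c' : ℝ) (U : GaugeField P 0 U1)
    (Ω X₀ : Finset (Balaban1983to89.Site P 0)) {δ₀ c₀ : ℝ} (hδ₀ : 0 ≤ δ₀) (hc₀ : 0 ≤ c₀)
    (hGΩ : ∀ x ∈ X₀, ∀ (f : Balaban1983to89.Site P 0 → ℂ) (F D : ℝ), (∀ y, ‖f y‖ ≤ F) → 0 ≤ D →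
      (∀ y, f y ≠ 0 → D ≤ B5Ineq137Torus.T P 0 x y) →
      ‖(gBox (B1RG242Torus.α P a k * (P.L : ℝ) ^ (k * P.d)) c' U k Ω *ᵥ f) x‖ ≤
        P.spacing k ^ 2 * (c₀ * Real.exp (-(δ₀ * (((P.L : ℝ) ^ k)⁻¹ * D))) * F))
    (y₁ y₂ : Balaban1983to89.Site P (0 + k)) (hy₁ : ∀ x ∈ blockK k y₁, x ∈ X₀) :
    ‖deltaRegion (B1RG242Torus.α P a k * (P.L : ℝ) ^ (k * P.d)) c' U k Ω y₁ y₂‖ ≤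
      (B1RG242Torus.α P a k * (P.L : ℝ) ^ (k * P.d)) *
        ((if y₁ = y₂ then 1 else 0) + B1.aSeq a P.L k * (c₀ * Real.exp δ₀) * Real.exp (-(δ₀ * (B5Ineq137Torus.T P (0 + k) y₁ y₂)))) := by
  set A := B1RG242Torus.α P a k * (P.L : ℝ) ^ (k * P.d) with hAdef
  have hak : 0 < B1.aSeq a P.L k := B1.aSeq_pos ha (B1RG242Torus.one_lt_cast_L P) hk1
  have hα : 0 < B1RG242Torus.α P a k := mul_pos hak (inv_pos.mpr (pow_pos (P.spacing_pos k) 2))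
  have hA0 : 0 ≤ A := (mul_pos hα (pow_pos P.cast_L_pos _)).le
  set G0 := gBox A c' U k Ω with hG0def
  set Dl := max 0 (((P.L : ℝ) ^ k) * B5Ineq137Torus.T P (0 + k) y₁ y₂ - (((P.L : ℝ) ^ k) - 1)) with hDldef
  have hDl0 : 0 ≤ Dl := le_max_left _ _
  have hSandwich : ‖(qMatT U k * G0 * (qMatT U k)ᴴ) y₁ y₂‖ ≤
      P.spacing k ^ 2 * (c₀ * Real.exp (-(δ₀ * (((P.L : ℝ) ^ k)⁻¹ * Dl))) * ((P.L : ℝ) ^ (k * P.d))⁻¹) :=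
    norm_qMq_apply_le hk _ G0 y₁ y₂ fun x hx =>
      hGΩ x (hy₁ x hx) _ _ Dl (fun x' => norm_conj_qMatT_le _ k y₂ x') hDl0
        (fun x' hx' => blockLower_le_T hk hx (conj_qMatT_ne_zero _ k hx'))
  have hexp := exp_blockLower_level_le y₁ y₂ hδ₀
  rw [← hDldef] at hexp
  rw [deltaRegion_apply]
  calc ‖(A : ℂ) * (1 : Matrix _ _ ℂ) y₁ y₂ - ((A : ℂ) ^ 2) * (qMatT U k * G0 * (qMatT U k)ᴴ) y₁ y₂‖
      ≤ ‖(A : ℂ) * (1 : Matrix _ _ ℂ) y₁ y₂‖ + ‖((A : ℂ) ^ 2) * (qMatT U k * G0 * (qMatT U k)ᴴ) y₁ y₂‖ := norm_sub_le _ _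
    _ ≤ A * (if y₁ = y₂ then 1 else 0) +
        A ^ 2 * (P.spacing k ^ 2 * (c₀ * Real.exp (-(δ₀ * (((P.L : ℝ) ^ k)⁻¹ * Dl))) * ((P.L : ℝ) ^ (k * P.d))⁻¹)) := by
        rw [norm_coe_mul_one_apply hA0, norm_mul, norm_pow, Complex.norm_real, Real.norm_eq_abs, abs_of_nonneg hA0]
        exact add_le_add le_rfl (mul_le_mul_of_nonneg_left hSandwich (sq_nonneg _))
    _ = A * ((if y₁ = y₂ then 1 else 0) + B1.aSeq a P.L k * c₀ * Real.exp (-(δ₀ * (((P.L : ℝ) ^ k)⁻¹ * Dl)))) := by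
        have e := scale_identity P a k
        rw [← hAdef] at e
        calc A * (if y₁ = y₂ then 1 else 0) +
              A ^ 2 * (P.spacing k ^ 2 * (c₀ * Real.exp (-(δ₀ * (((P.L : ℝ) ^ k)⁻¹ * Dl))) * ((P.L : ℝ) ^ (k * P.d))⁻¹))
            = A * (if y₁ = y₂ then 1 else 0) +
                A ^ 2 * (((P.L : ℝ) ^ (k * P.d))⁻¹ * P.spacing k ^ 2) * (c₀ * Real.exp (-(δ₀ * (((P.L : ℝ) ^ k)⁻¹ * Dl)))) := by ring
          _ = A * ((if y₁ = y₂ then 1 else 0) + B1.aSeq a P.L k * c₀ * Real.exp (-(δ₀ * (((P.L : ℝ) ^ k)⁻¹ * Dl)))) := by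
              rw [e]; ring
    _ ≤ A * ((if y₁ = y₂ then 1 else 0) +
          B1.aSeq a P.L k * (c₀ * Real.exp δ₀) * Real.exp (-(δ₀ * (B5Ineq137Torus.T P (0 + k) y₁ y₂)))) := by
        refine mul_le_mul_of_nonneg_left (add_le_add le_rfl ?_) hA0
        calc B1.aSeq a P.L k * c₀ * Real.exp (-(δ₀ * (((P.L : ℝ) ^ k)⁻¹ * Dl)))
            ≤ B1.aSeq a P.L k * c₀ * (Real.exp δ₀ * Real.exp (-(δ₀ * (B5Ineq137Torus.T P (0 + k) y₁ y₂)))) :=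
              mul_le_mul_of_nonneg_left hexp (mul_nonneg hak.le hc₀)
          _ = B1.aSeq a P.L k * (c₀ * Real.exp δ₀) * Real.exp (-(δ₀ * (B5Ineq137Torus.T P (0 + k) y₁ y₂))) := by ring

/-- **(2.36) FOR `Δ_{k,loc}(u)` FROM (H1.10″) FOR THE CUBES ON THE ROWS `X_α`**: as `decay236_of_input`, at the entries `(y₁, y₂)` whose row
block `B^k(y₁)` satisfies the activity hypothesis `ζ″(x,y)λ_α(x,y) ≠ 0 ⟹ x ∈ X_α`. [cite: BalabanImbrieJaffe1988, (2.36) p.263] -/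
theorem decay236_gen {k : ℕ} (hk1 : 1 ≤ k) (hk : 0 + k ≤ P.m + P.K) {a : ℝ} (ha : 0 < a) (c' : ℝ) (U : GaugeField P 0 U1)
    {ι : Type*} [Fintype ι] (cube Xr : ι → Finset (Balaban1983to89.Site P 0))
    {lam : ι → Balaban1983to89.Site P 0 → Balaban1983to89.Site P 0 → ℝ} {ζ'' : Balaban1983to89.Site P 0 → Balaban1983to89.Site P 0 → ℝ}
    (hlam : ∀ x y, ∑ α, |lam α x y| ≤ 1) (hζ : ∀ x y, |ζ'' x y| ≤ 1) {δ₀ c₀ : ℝ} (hδ₀ : 0 ≤ δ₀) (hc₀ : 0 ≤ c₀)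
    (hG : ∀ α, ∀ x ∈ Xr α, ∀ (f : Balaban1983to89.Site P 0 → ℂ) (F D : ℝ), (∀ y, ‖f y‖ ≤ F) → 0 ≤ D →
      (∀ y, f y ≠ 0 → D ≤ B5Ineq137Torus.T P 0 x y) →
      ‖(gBox (B1RG242Torus.α P a k * (P.L : ℝ) ^ (k * P.d)) c' U k (cube α) *ᵥ f) x‖ ≤
        P.spacing k ^ 2 * (c₀ * Real.exp (-(δ₀ * (((P.L : ℝ) ^ k)⁻¹ * D))) * F))
    (y₁ y₂ : Balaban1983to89.Site P (0 + k)) (hact : ∀ x ∈ blockK k y₁, ∀ α y, ζ'' x y * lam α x y ≠ 0 → x ∈ Xr α)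
    (S : Finset ι) (hS : ∀ x ∈ blockK k y₁, ∀ α y, ζ'' x y * lam α x y ≠ 0 → α ∈ S) :
    ‖deltaLocT (B1RG242Torus.α P a k * (P.L : ℝ) ^ (k * P.d)) c' U k cube lam ζ'' y₁ y₂‖ ≤
      (B1RG242Torus.α P a k * (P.L : ℝ) ^ (k * P.d)) *
        ((if y₁ = y₂ then 1 else 0) +
          S.card * B1.aSeq a P.L k * (c₀ * Real.exp δ₀) * Real.exp (-(δ₀ * (B5Ineq137Torus.T P (0 + k) y₁ y₂)))) := by
  set A := B1RG242Torus.α P a k * (P.L : ℝ) ^ (k * P.d) with hAdef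
  have hak : 0 < B1.aSeq a P.L k := B1.aSeq_pos ha (B1RG242Torus.one_lt_cast_L P) hk1
  have hα : 0 < B1RG242Torus.α P a k := mul_pos hak (inv_pos.mpr (pow_pos (P.spacing_pos k) 2))
  have hA0 : 0 ≤ A := (mul_pos hα (pow_pos P.cast_L_pos _)).le
  set Gloc := gLocT A c' U k cube lam ζ'' with hGlocdef
  set Dl := max 0 (((P.L : ℝ) ^ k) * B5Ineq137Torus.T P (0 + k) y₁ y₂ - (((P.L : ℝ) ^ k) - 1)) with hDldef
  have hDl0 : 0 ≤ Dl := le_max_left _ _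
  have hSandwich : ‖(qMatT U k * Gloc * (qMatT U k)ᴴ) y₁ y₂‖ ≤
      P.spacing k ^ 2 * (S.card * (c₀ * Real.exp (-(δ₀ * (((P.L : ℝ) ^ k)⁻¹ * Dl))) * ((P.L : ℝ) ^ (k * P.d))⁻¹)) :=
    norm_qMq_apply_le hk _ Gloc y₁ y₂ fun x hx =>
      opDecay230_gen A c' U cube Xr hlam hζ hc₀ hG x _ (fun x' => norm_conj_qMatT_le _ k y₂ x') hDl0
        (fun x' hx' => blockLower_le_T hk hx (conj_qMatT_ne_zero _ k hx')) (hact x hx) S (fun α y hαy _ => hS x hx α y hαy)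
  have hexp := exp_blockLower_level_le y₁ y₂ hδ₀
  rw [← hDldef] at hexp
  rw [deltaLocT_apply]
  calc ‖(A : ℂ) * (1 : Matrix _ _ ℂ) y₁ y₂ - ((A : ℂ) ^ 2) * (qMatT U k * Gloc * (qMatT U k)ᴴ) y₁ y₂‖
      ≤ ‖(A : ℂ) * (1 : Matrix _ _ ℂ) y₁ y₂‖ + ‖((A : ℂ) ^ 2) * (qMatT U k * Gloc * (qMatT U k)ᴴ) y₁ y₂‖ := norm_sub_le _ _
    _ ≤ A * (if y₁ = y₂ then 1 else 0) +
        A ^ 2 * (P.spacing k ^ 2 * (S.card * (c₀ * Real.exp (-(δ₀ * (((P.L : ℝ) ^ k)⁻¹ * Dl))) * ((P.L : ℝ) ^ (k * P.d))⁻¹))) := by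
        rw [norm_coe_mul_one_apply hA0, norm_mul, norm_pow, Complex.norm_real, Real.norm_eq_abs, abs_of_nonneg hA0]
        exact add_le_add le_rfl (mul_le_mul_of_nonneg_left hSandwich (sq_nonneg _))
    _ = A * ((if y₁ = y₂ then 1 else 0) + S.card * B1.aSeq a P.L k * c₀ * Real.exp (-(δ₀ * (((P.L : ℝ) ^ k)⁻¹ * Dl)))) := by
        have e := scale_identity P a k
        rw [← hAdef] at e
        calc A * (if y₁ = y₂ then 1 else 0) +
              A ^ 2 * (P.spacing k ^ 2 * (S.card * (c₀ * Real.exp (-(δ₀ * (((P.L : ℝ) ^ k)⁻¹ * Dl))) * ((P.L : ℝ) ^ (k * P.d))⁻¹)))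
            = A * (if y₁ = y₂ then 1 else 0) +
                A ^ 2 * (((P.L : ℝ) ^ (k * P.d))⁻¹ * P.spacing k ^ 2) * (S.card * (c₀ * Real.exp (-(δ₀ * (((P.L : ℝ) ^ k)⁻¹ * Dl))))) := by
              ring
          _ = A * ((if y₁ = y₂ then 1 else 0) + S.card * B1.aSeq a P.L k * c₀ * Real.exp (-(δ₀ * (((P.L : ℝ) ^ k)⁻¹ * Dl)))) := by
              rw [e]; ring
    _ ≤ A * ((if y₁ = y₂ then 1 else 0) +
          S.card * B1.aSeq a P.L k * (c₀ * Real.exp δ₀) * Real.exp (-(δ₀ * (B5Ineq137Torus.T P (0 + k) y₁ y₂)))) := by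
        refine mul_le_mul_of_nonneg_left (add_le_add le_rfl ?_) hA0
        calc S.card * B1.aSeq a P.L k * c₀ * Real.exp (-(δ₀ * (((P.L : ℝ) ^ k)⁻¹ * Dl)))
            ≤ S.card * B1.aSeq a P.L k * c₀ * (Real.exp δ₀ * Real.exp (-(δ₀ * (B5Ineq137Torus.T P (0 + k) y₁ y₂)))) :=
              mul_le_mul_of_nonneg_left hexp (by positivity)
          _ = S.card * B1.aSeq a P.L k * (c₀ * Real.exp δ₀) * Real.exp (-(δ₀ * (B5Ineq137Torus.T P (0 + k) y₁ y₂))) := by ring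

/-- **(2.35) FROM THE ROW-RESTRICTED INPUTS WITH TORUS-EXTERIOR DEPTHS** (*"for dist({x₁,x₂},Ω^c) > O(r(e_k))"*): as `close235_of_inputs`, at the
entries `(y₁, y₂)` with `B^k(y₁) ⊆ X₀`, under (i), (ii″), (iii) on the rows of `B^k(y₁)` and `0 ≤ R`. [cite: BalabanImbrieJaffe1988, (2.35) p.263] -/
theorem close235_gen {k : ℕ} (hk1 : 1 ≤ k) (hk : 0 + k ≤ P.m + P.K) {a : ℝ} (ha : 0 < a) (c' : ℝ) (U : GaugeField P 0 U1)
    (Ω X₀ : Finset (Balaban1983to89.Site P 0)) {ι : Type*} [Fintype ι] (cube Xr : ι → Finset (Balaban1983to89.Site P 0))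
    {lam : ι → Balaban1983to89.Site P 0 → Balaban1983to89.Site P 0 → ℝ} {ζ'' : Balaban1983to89.Site P 0 → Balaban1983to89.Site P 0 → ℝ}
    (hlam : ∀ x y, ∑ α, |lam α x y| ≤ 1) (hζ : ∀ x y, 0 ≤ ζ'' x y ∧ ζ'' x y ≤ 1) {δ₀ c₀ : ℝ} (hδ₀ : 0 ≤ δ₀) (hc₀ : 0 ≤ c₀)
    (hGΩ : ∀ x ∈ X₀, ∀ (f : Balaban1983to89.Site P 0 → ℂ) (F D : ℝ), (∀ y, ‖f y‖ ≤ F) → 0 ≤ D →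
      (∀ y, f y ≠ 0 → D ≤ B5Ineq137Torus.T P 0 x y) →
      ‖(gBox (B1RG242Torus.α P a k * (P.L : ℝ) ^ (k * P.d)) c' U k Ω *ᵥ f) x‖ ≤
        P.spacing k ^ 2 * (c₀ * Real.exp (-(δ₀ * (((P.L : ℝ) ^ k)⁻¹ * D))) * F))
    (hC : ∀ α, ∀ x ∈ Xr α, ∀ (f : Balaban1983to89.Site P 0 → ℂ) (F D Db Df : ℝ), (∀ y, ‖f y‖ ≤ F) → (∀ y, y ∉ cube α → f y = 0) →
      0 ≤ D → (∀ y, f y ≠ 0 → D ≤ B5Ineq137Torus.T P 0 x y) → 0 ≤ Db → (∀ w, w ∉ cube α → Db ≤ B5Ineq137Torus.T P 0 x w) →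
      0 ≤ Df → (∀ y, f y ≠ 0 → ∀ w, w ∉ cube α → Df ≤ B5Ineq137Torus.T P 0 y w) →
      ‖(gBox (B1RG242Torus.α P a k * (P.L : ℝ) ^ (k * P.d)) c' U k (cube α) *ᵥ f) x -
          (gBox (B1RG242Torus.α P a k * (P.L : ℝ) ^ (k * P.d)) c' U k Ω *ᵥ f) x‖ ≤
        P.spacing k ^ 2 * (c₀ * Real.exp (-(δ₀ * (((P.L : ℝ) ^ k)⁻¹ * D))) * Real.exp (-(δ₀ * (((P.L : ℝ) ^ k)⁻¹ * (Db + Df)))) * F))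
    {R R₁ : ℝ} (hR : 0 ≤ R) (y₁ y₂ : Balaban1983to89.Site P (0 + k)) (hy₁ : ∀ x ∈ blockK k y₁, x ∈ X₀)
    (hcomp : ∀ x ∈ blockK k y₁, ∀ y, ζ'' x y ≠ 0 → ∑ α, lam α x y = 1)
    (hdeep : ∀ x ∈ blockK k y₁, ∀ α y, ζ'' x y * lam α x y ≠ 0 → x ∈ Xr α ∧ y ∈ cube α ∧
      ∀ w, w ∉ cube α → R ≤ B5Ineq137Torus.T P 0 x w ∧ R ≤ B5Ineq137Torus.T P 0 y w)
    (hcut : ∀ x ∈ blockK k y₁, ∀ y, B5Ineq137Torus.T P 0 x y ≤ R₁ → ζ'' x y = 1)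
    (S : Finset ι) (hS : ∀ x ∈ blockK k y₁, ∀ α y, ζ'' x y * lam α x y ≠ 0 → α ∈ S) :
    ‖deltaLocT (B1RG242Torus.α P a k * (P.L : ℝ) ^ (k * P.d)) c' U k cube lam ζ'' y₁ y₂ -
        deltaRegion (B1RG242Torus.α P a k * (P.L : ℝ) ^ (k * P.d)) c' U k Ω y₁ y₂‖ ≤
      (B1RG242Torus.α P a k * (P.L : ℝ) ^ (k * P.d)) * (B1.aSeq a P.L k * (c₀ * Real.exp (δ₀ / 2)) *
        (S.card * Real.exp (-(δ₀ * (((P.L : ℝ) ^ k)⁻¹ * (2 * R)))) + Real.exp (-(δ₀ / 2 * (((P.L : ℝ) ^ k)⁻¹ * R₁)))) *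
          Real.exp (-(δ₀ / 2 * (B5Ineq137Torus.T P (0 + k) y₁ y₂)))) := by
  set A := B1RG242Torus.α P a k * (P.L : ℝ) ^ (k * P.d) with hAdef
  have hak : 0 < B1.aSeq a P.L k := B1.aSeq_pos ha (B1RG242Torus.one_lt_cast_L P) hk1
  have hα : 0 < B1RG242Torus.α P a k := mul_pos hak (inv_pos.mpr (pow_pos (P.spacing_pos k) 2))
  have hA0 : 0 ≤ A := (mul_pos hα (pow_pos P.cast_L_pos _)).le
  set Gloc := gLocT A c' U k cube lam ζ'' with hGlocdef
  set G0 := gBox A c' U k Ω with hG0def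
  set Dl := max 0 (((P.L : ℝ) ^ k) * B5Ineq137Torus.T P (0 + k) y₁ y₂ - (((P.L : ℝ) ^ k) - 1)) with hDldef
  have hDl0 : 0 ≤ Dl := le_max_left _ _
  set E := c₀ * (S.card * Real.exp (-(δ₀ * (((P.L : ℝ) ^ k)⁻¹ * (2 * R)))) + Real.exp (-(δ₀ / 2 * (((P.L : ℝ) ^ k)⁻¹ * R₁))))
    with hEdef
  have hE0 : 0 ≤ E := by positivity
  have hSandwich : ‖(qMatT U k * (Gloc - G0) * (qMatT U k)ᴴ) y₁ y₂‖ ≤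
      P.spacing k ^ 2 * (E * Real.exp (-(δ₀ / 2 * (((P.L : ℝ) ^ k)⁻¹ * Dl))) * ((P.L : ℝ) ^ (k * P.d))⁻¹) := by
    refine norm_qMq_apply_le hk _ (Gloc - G0) y₁ y₂ fun x hx => ?_
    rw [Matrix.sub_mulVec, Pi.sub_apply]
    exact opClose231_gen A c' U Ω X₀ cube Xr hlam hζ hδ₀ hc₀ hGΩ hC x (hy₁ x hx) hR (hcomp x hx) (hdeep x hx) (hcut x hx) _
      (fun x' => norm_conj_qMatT_le _ k y₂ x') hDl0 (fun x' hx' => blockLower_le_T hk hx (conj_qMatT_ne_zero _ k hx'))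
      S (fun α y hαy _ => hS x hx α y hαy)
  have hexp := exp_blockLower_level_le y₁ y₂ (by positivity : (0 : ℝ) ≤ δ₀ / 2)
  rw [← hDldef] at hexp
  rw [deltaLocT_sub_deltaRegion_apply, norm_neg, norm_mul, norm_pow, Complex.norm_real, Real.norm_eq_abs, abs_of_nonneg hA0]
  have e := scale_identity P a k
  rw [← hAdef] at e
  calc A ^ 2 * ‖(qMatT U k * (Gloc - G0) * (qMatT U k)ᴴ) y₁ y₂‖
      ≤ A ^ 2 * (P.spacing k ^ 2 * (E * Real.exp (-(δ₀ / 2 * (((P.L : ℝ) ^ k)⁻¹ * Dl))) * ((P.L : ℝ) ^ (k * P.d))⁻¹)) :=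
        mul_le_mul_of_nonneg_left hSandwich (sq_nonneg _)
    _ = A ^ 2 * (((P.L : ℝ) ^ (k * P.d))⁻¹ * P.spacing k ^ 2) * (E * Real.exp (-(δ₀ / 2 * (((P.L : ℝ) ^ k)⁻¹ * Dl)))) := by ring
    _ = A * B1.aSeq a P.L k * (E * Real.exp (-(δ₀ / 2 * (((P.L : ℝ) ^ k)⁻¹ * Dl)))) := by rw [e]
    _ ≤ A * B1.aSeq a P.L k * (E * (Real.exp (δ₀ / 2) * Real.exp (-(δ₀ / 2 * (B5Ineq137Torus.T P (0 + k) y₁ y₂))))) :=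
        mul_le_mul_of_nonneg_left (mul_le_mul_of_nonneg_left hexp hE0) (mul_nonneg hA0 hak.le)
    _ = _ := by rw [hEdef]; ring

/-- **(2.38) FOR `Δ_{k,loc}(u)` FROM THE ROW-RESTRICTED INPUTS WITH TORUS-EXTERIOR DEPTHS**: as `ineq238_of_inputs`, for admissible `φ` whose
block rows `B^k(y₁)`, `y₁ ∈ supp φ`, lie in `X₀` and satisfy (i), (ii″), (iii) with multiplicity `≤ m`; `0 ≤ R`.
[cite: BalabanImbrieJaffe1988, (2.38) p.264] -/
theorem ineq238_gen {k : ℕ} (hk1 : 1 ≤ k) (hk : 0 + k ≤ P.m + P.K) {a : ℝ} (ha : 0 < a) (U : GaugeField P 0 U1) {θ : ℝ}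
    (hθ : ∀ (x : Balaban1983to89.Site P 0) (μ ν : Fin P.d), ‖plaqC U x μ ν - 1‖ ≤ θ)
    {Ω : Finset (Balaban1983to89.Site P 0)} (hΩ : IsBlockUnion k Ω) (X₀ : Finset (Balaban1983to89.Site P 0)) {ι : Type*} [Fintype ι]
    (cube Xr : ι → Finset (Balaban1983to89.Site P 0))
    {lam : ι → Balaban1983to89.Site P 0 → Balaban1983to89.Site P 0 → ℝ} {ζ'' : Balaban1983to89.Site P 0 → Balaban1983to89.Site P 0 → ℝ}
    (hlam : ∀ x y, ∑ α, |lam α x y| ≤ 1) (hζ : ∀ x y, 0 ≤ ζ'' x y ∧ ζ'' x y ≤ 1) {δ₀ c₀ : ℝ} (hδ₀ : 0 < δ₀) (hc₀ : 0 ≤ c₀)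
    (hGΩ : ∀ x ∈ X₀, ∀ (f : Balaban1983to89.Site P 0 → ℂ) (F D : ℝ), (∀ y, ‖f y‖ ≤ F) → 0 ≤ D →
      (∀ y, f y ≠ 0 → D ≤ B5Ineq137Torus.T P 0 x y) →
      ‖(gBox (B1RG242Torus.α P a k * (P.L : ℝ) ^ (k * P.d)) P.eps⁻¹ U k Ω *ᵥ f) x‖ ≤
        P.spacing k ^ 2 * (c₀ * Real.exp (-(δ₀ * (((P.L : ℝ) ^ k)⁻¹ * D))) * F))
    (hC : ∀ α, ∀ x ∈ Xr α, ∀ (f : Balaban1983to89.Site P 0 → ℂ) (F D Db Df : ℝ), (∀ y, ‖f y‖ ≤ F) → (∀ y, y ∉ cube α → f y = 0) →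
      0 ≤ D → (∀ y, f y ≠ 0 → D ≤ B5Ineq137Torus.T P 0 x y) → 0 ≤ Db → (∀ w, w ∉ cube α → Db ≤ B5Ineq137Torus.T P 0 x w) →
      0 ≤ Df → (∀ y, f y ≠ 0 → ∀ w, w ∉ cube α → Df ≤ B5Ineq137Torus.T P 0 y w) →
      ‖(gBox (B1RG242Torus.α P a k * (P.L : ℝ) ^ (k * P.d)) P.eps⁻¹ U k (cube α) *ᵥ f) x -
          (gBox (B1RG242Torus.α P a k * (P.L : ℝ) ^ (k * P.d)) P.eps⁻¹ U k Ω *ᵥ f) x‖ ≤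
        P.spacing k ^ 2 * (c₀ * Real.exp (-(δ₀ * (((P.L : ℝ) ^ k)⁻¹ * D))) * Real.exp (-(δ₀ * (((P.L : ℝ) ^ k)⁻¹ * (Db + Df)))) * F))
    {R R₁ : ℝ} (hR : 0 ≤ R) (m : ℕ) (Adm : (Balaban1983to89.Site P (0 + k) → ℂ) → Prop)
    (hAdm : ∀ φ, Adm φ → ∀ y₁, φ y₁ ≠ 0 →
      (∀ x ∈ blockK k y₁, x ∈ X₀) ∧
      (∀ x ∈ blockK k y₁, ∀ y, ζ'' x y ≠ 0 → ∑ α, lam α x y = 1) ∧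
      (∀ x ∈ blockK k y₁, ∀ α y, ζ'' x y * lam α x y ≠ 0 → x ∈ Xr α ∧ y ∈ cube α ∧
          ∀ w, w ∉ cube α → R ≤ B5Ineq137Torus.T P 0 x w ∧ R ≤ B5Ineq137Torus.T P 0 y w) ∧
      (∀ x ∈ blockK k y₁, ∀ y, B5Ineq137Torus.T P 0 x y ≤ R₁ → ζ'' x y = 1) ∧
      ∃ S : Finset ι, S.card ≤ m ∧ ∀ x ∈ blockK k y₁, ∀ α y, ζ'' x y * lam α x y ≠ 0 → α ∈ S)
    (hnb : ∀ φ, Adm φ → ∀ b : PBond P (0 + k), (φ b.src ≠ 0 ∨ φ b.tgt ≠ 0) → b ∈ starB (innerK k Ω))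
    (φ : Balaban1983to89.Site P (0 + k) → ℂ) (hφ : Adm φ) :
    (B1RG242Torus.α P a k * (P.L : ℝ) ^ (k * P.d)) / B1.aSeq a P.L k *
        (min (a / (9 * (P.d + 1))) (1 / 12) * ∑ b : PBond P (0 + k), ‖toC (lineIter U k b) * φ b.tgt - φ b.src‖ ^ 2
          - (4 / 3 * (P.d : ℝ) ^ 4 * (((P.L : ℝ) ^ k) ^ 2 * θ) ^ 2 +
              B1.aSeq a P.L k ^ 2 * (c₀ * Real.exp (δ₀ / 2) * latticeConst P.d (δ₀ / 2)) *
                ((m : ℝ) * Real.exp (-(δ₀ * (((P.L : ℝ) ^ k)⁻¹ * (2 * R)))) + Real.exp (-(δ₀ / 2 * (((P.L : ℝ) ^ k)⁻¹ * R₁))))) *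
            ∑ y : Balaban1983to89.Site P (0 + k), ‖φ y‖ ^ 2)
      ≤ (star φ ⬝ᵥ (deltaLocT (B1RG242Torus.α P a k * (P.L : ℝ) ^ (k * P.d)) P.eps⁻¹ U k cube lam ζ'' *ᵥ φ)).re := by
  set A : ℝ := B1RG242Torus.α P a k * (P.L : ℝ) ^ (k * P.d) with hAdef
  set ak : ℝ := B1.aSeq a P.L k with hakdef
  have hak : 0 < ak := B1.aSeq_pos ha (B1RG242Torus.one_lt_cast_L P) hk1
  have hα : 0 < B1RG242Torus.α P a k := mul_pos hak (inv_pos.mpr (pow_pos (P.spacing_pos k) 2))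
  have hA0 : 0 < A := mul_pos hα (pow_pos P.cast_L_pos _)
  have hAak : 0 < A / ak := div_pos hA0 hak
  set br : ℝ := (m : ℝ) * Real.exp (-(δ₀ * (((P.L : ℝ) ^ k)⁻¹ * (2 * R)))) + Real.exp (-(δ₀ / 2 * (((P.L : ℝ) ^ k)⁻¹ * R₁)))
    with hbrdef
  have hbr0 : 0 ≤ br := by positivity
  set δ' : ℝ := A * (ak * (c₀ * Real.exp (δ₀ / 2)) * br) with hδ'def
  have hδ'0 : 0 ≤ δ' := by positivity
  set Kd : ℝ := latticeConst P.d (δ₀ / 2) with hKddef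
  set Err : ℝ := 4 / 3 * (P.d : ℝ) ^ 4 * (((P.L : ℝ) ^ k) ^ 2 * θ) ^ 2 with hErrdef
  set Δloc := deltaLocT A P.eps⁻¹ U k cube lam ζ'' with hΔlocdef
  set ΔΩ := deltaRegion A P.eps⁻¹ U k Ω with hΔΩdef
  have h732 := ineq238_deltaRegion_smallField_region hk1 hk ha U hθ hΩ φ
  rw [← hAdef, ← hakdef, ← hΔΩdef] at h732
  have hfull : ∑ b : PBond P (0 + k), ‖toC (lineIter U k b) * φ b.tgt - φ b.src‖ ^ 2 =
      ∑ b ∈ starB (innerK k Ω), ‖toC (lineIter U k b) * φ b.tgt - φ b.src‖ ^ 2 := by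
    refine sum_univ_eq_sum_starB (innerK k Ω) _ fun b hb => ?_
    have h0 : φ b.src = 0 ∧ φ b.tgt = 0 := by
      by_contra hne
      rw [not_and_or] at hne
      exact hb (hnb φ hφ b hne)
    rw [h0.1, h0.2, mul_zero, sub_zero, norm_zero, zero_pow two_ne_zero]
  have hinner : ∑ y ∈ innerK k Ω, ‖φ y‖ ^ 2 ≤ ∑ y : Balaban1983to89.Site P (0 + k), ‖φ y‖ ^ 2 :=
    Finset.sum_le_univ_sum_of_nonneg fun y => sq_nonneg _
  have hM : ∀ y₁ y₂, φ y₁ ≠ 0 → φ y₂ ≠ 0 → ‖Δloc y₁ y₂ - ΔΩ y₁ y₂‖ ≤ δ' * Real.exp (-(δ₀ / 2) * B5Ineq137Torus.T P (0 + k) y₁ y₂) := by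
    intro y₁ y₂ hy₁ _
    obtain ⟨hX₀, hcomp, hdeep, hcut, S, hSm, hS⟩ := hAdm φ hφ y₁ hy₁
    have h35 := close235_gen hk1 hk ha P.eps⁻¹ U Ω X₀ cube Xr hlam hζ hδ₀.le hc₀ hGΩ hC hR y₁ y₂ hX₀ hcomp hdeep hcut S hS
    rw [← hAdef, ← hakdef, ← hΔlocdef, ← hΔΩdef] at h35
    rw [neg_mul]
    have hbrS : (S.card : ℝ) * Real.exp (-(δ₀ * (((P.L : ℝ) ^ k)⁻¹ * (2 * R)))) + Real.exp (-(δ₀ / 2 * (((P.L : ℝ) ^ k)⁻¹ * R₁))) ≤ br := by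
      have hSm' : (S.card : ℝ) ≤ m := by exact_mod_cast hSm
      exact add_le_add (mul_le_mul_of_nonneg_right hSm' (Real.exp_nonneg _)) le_rfl
    calc _ ≤ A * (ak * (c₀ * Real.exp (δ₀ / 2)) * ((S.card : ℝ) * Real.exp (-(δ₀ * (((P.L : ℝ) ^ k)⁻¹ * (2 * R)))) +
            Real.exp (-(δ₀ / 2 * (((P.L : ℝ) ^ k)⁻¹ * R₁)))) * Real.exp (-(δ₀ / 2 * B5Ineq137Torus.T P (0 + k) y₁ y₂))) := h35
      _ ≤ A * (ak * (c₀ * Real.exp (δ₀ / 2)) * br * Real.exp (-(δ₀ / 2 * B5Ineq137Torus.T P (0 + k) y₁ y₂))) := by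
          apply mul_le_mul_of_nonneg_left _ hA0.le
          apply mul_le_mul_of_nonneg_right _ (Real.exp_nonneg _)
          exact mul_le_mul_of_nonneg_left hbrS (by positivity)
      _ = δ' * Real.exp (-(δ₀ / 2 * B5Ineq137Torus.T P (0 + k) y₁ y₂)) := by rw [hδ'def]; ring
  have hsymm : ∀ y₁ y₂ : Balaban1983to89.Site P (0 + k), B5Ineq137Torus.T P (0 + k) y₁ y₂ = B5Ineq137Torus.T P (0 + k) y₂ y₁ :=
    fun y₁ y₂ => T_symm P (0 + k) y₁ y₂
  have hSrow : ∀ y₁ : Balaban1983to89.Site P (0 + k), ∑ y₂, Real.exp (-(δ₀ / 2) * B5Ineq137Torus.T P (0 + k) y₁ y₂) ≤ Kd := by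
    intro y₁
    simp_rw [neg_mul]
    exact rowSum_T_le P (0 + k) (half_pos hδ₀) y₁
  have hK := abs_kform_sub_le (K := fun y₁ y₂ => Δloc y₁ y₂) (K' := fun y₁ y₂ => ΔΩ y₁ y₂) hM hsymm hSrow hδ'0
  have hKloc : kform (fun y₁ y₂ => Δloc y₁ y₂) φ = (star φ ⬝ᵥ (Δloc *ᵥ φ)).re := kform_eq_re_dotProduct Δloc φ
  have hKΩ : kform (fun y₁ y₂ => ΔΩ y₁ y₂) φ = (star φ ⬝ᵥ (ΔΩ *ᵥ φ)).re := kform_eq_re_dotProduct ΔΩ φ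
  rw [hKloc, hKΩ] at hK
  have hlow := (abs_sub_le_iff.1 hK).2
  have hconst : δ' * Kd = A / ak * (ak ^ 2 * (c₀ * Real.exp (δ₀ / 2) * Kd) * br) := by
    rw [hδ'def]
    field_simp
  rw [hfull]
  calc A / ak * (min (a / (9 * (P.d + 1))) (1 / 12) * ∑ b ∈ starB (innerK k Ω), ‖toC (lineIter U k b) * φ b.tgt - φ b.src‖ ^ 2 -
          (Err + ak ^ 2 * (c₀ * Real.exp (δ₀ / 2) * Kd) * br) * ∑ y : Balaban1983to89.Site P (0 + k), ‖φ y‖ ^ 2)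
      = A / ak * (min (a / (9 * (P.d + 1))) (1 / 12) * ∑ b ∈ starB (innerK k Ω), ‖toC (lineIter U k b) * φ b.tgt - φ b.src‖ ^ 2 -
          Err * ∑ y : Balaban1983to89.Site P (0 + k), ‖φ y‖ ^ 2) - δ' * Kd * ∑ y : Balaban1983to89.Site P (0 + k), ‖φ y‖ ^ 2 := by
        rw [hconst]; ring
    _ ≤ A / ak * (min (a / (9 * (P.d + 1))) (1 / 12) * ∑ b ∈ starB (innerK k Ω), ‖toC (lineIter U k b) * φ b.tgt - φ b.src‖ ^ 2 -
          Err * ∑ y ∈ innerK k Ω, ‖φ y‖ ^ 2) - δ' * Kd * ∑ y : Balaban1983to89.Site P (0 + k), ‖φ y‖ ^ 2 := by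
        have hErr0 : 0 ≤ Err := by positivity
        nlinarith [mul_le_mul_of_nonneg_left hinner hErr0, hAak.le,
          mul_le_mul_of_nonneg_left (mul_le_mul_of_nonneg_left hinner hErr0) hAak.le]
    _ ≤ (star φ ⬝ᵥ (ΔΩ *ᵥ φ)).re - δ' * Kd * ∑ y : Balaban1983to89.Site P (0 + k), ‖φ y‖ ^ 2 := by
        rw [hErrdef]; linarith [h732]
    _ ≤ (star φ ⬝ᵥ (Δloc *ᵥ φ)).re := by linarith [hlow]

/-- **(2.40) AND (4.9)_{j≥1} FOR `Δ_{k,loc}(u)` FROM THE ROW-RESTRICTED INPUTS WITH TORUS-EXTERIOR DEPTHS**: as `Z49_of_inputs`, for `Λ` whose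
block rows lie in `X₀` and satisfy (i), (ii″), (iii) with multiplicity `≤ m`; `0 ≤ R`. [cite: BalabanImbrieJaffe1988, (2.40) p.264] -/
theorem Z49_gen {k : ℕ} (hk1 : 1 ≤ k) (hk' : 0 + k + 1 ≤ P.m + P.K) {a : ℝ} (ha : 0 < a) (U : GaugeField P 0 U1) {θ : ℝ}
    (hθ : ∀ (x : Balaban1983to89.Site P 0) (μ ν : Fin P.d), ‖plaqC U x μ ν - 1‖ ≤ θ)
    {Ω : Finset (Balaban1983to89.Site P 0)} (hΩ : IsBlockUnion k Ω) (X₀ : Finset (Balaban1983to89.Site P 0)) {ι : Type*} [Fintype ι]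
    {cube : ι → Finset (Balaban1983to89.Site P 0)} (hcube : ∀ α, IsBlockUnion k (cube α)) (Xr : ι → Finset (Balaban1983to89.Site P 0))
    {lam : ι → Balaban1983to89.Site P 0 → Balaban1983to89.Site P 0 → ℝ} {ζ'' : Balaban1983to89.Site P 0 → Balaban1983to89.Site P 0 → ℝ}
    (hlam : ∀ x y, ∑ α, |lam α x y| ≤ 1) (hlamsymm : ∀ α x₁ x₂, lam α x₂ x₁ = lam α x₁ x₂) (hζ : ∀ x y, 0 ≤ ζ'' x y ∧ ζ'' x y ≤ 1)
    (hζsymm : ∀ x₁ x₂, ζ'' x₂ x₁ = ζ'' x₁ x₂) {δ₀ c₀ : ℝ} (hδ₀ : 0 < δ₀) (hc₀ : 0 ≤ c₀)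
    (hGΩ : ∀ x ∈ X₀, ∀ (f : Balaban1983to89.Site P 0 → ℂ) (F D : ℝ), (∀ y, ‖f y‖ ≤ F) → 0 ≤ D →
      (∀ y, f y ≠ 0 → D ≤ B5Ineq137Torus.T P 0 x y) →
      ‖(gBox (B1RG242Torus.α P a k * (P.L : ℝ) ^ (k * P.d)) P.eps⁻¹ U k Ω *ᵥ f) x‖ ≤
        P.spacing k ^ 2 * (c₀ * Real.exp (-(δ₀ * (((P.L : ℝ) ^ k)⁻¹ * D))) * F))
    (hC : ∀ α, ∀ x ∈ Xr α, ∀ (f : Balaban1983to89.Site P 0 → ℂ) (F D Db Df : ℝ), (∀ y, ‖f y‖ ≤ F) → (∀ y, y ∉ cube α → f y = 0) →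
      0 ≤ D → (∀ y, f y ≠ 0 → D ≤ B5Ineq137Torus.T P 0 x y) → 0 ≤ Db → (∀ w, w ∉ cube α → Db ≤ B5Ineq137Torus.T P 0 x w) →
      0 ≤ Df → (∀ y, f y ≠ 0 → ∀ w, w ∉ cube α → Df ≤ B5Ineq137Torus.T P 0 y w) →
      ‖(gBox (B1RG242Torus.α P a k * (P.L : ℝ) ^ (k * P.d)) P.eps⁻¹ U k (cube α) *ᵥ f) x -
          (gBox (B1RG242Torus.α P a k * (P.L : ℝ) ^ (k * P.d)) P.eps⁻¹ U k Ω *ᵥ f) x‖ ≤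
        P.spacing k ^ 2 * (c₀ * Real.exp (-(δ₀ * (((P.L : ℝ) ^ k)⁻¹ * D))) * Real.exp (-(δ₀ * (((P.L : ℝ) ^ k)⁻¹ * (Db + Df)))) * F))
    {R R₁ : ℝ} (hR : 0 ≤ R) (m : ℕ) (Λ : Finset (Balaban1983to89.Site P (0 + k)))
    (hrows : ∀ y₁ ∈ Λ,
      (∀ x ∈ blockK k y₁, x ∈ X₀) ∧
      (∀ x ∈ blockK k y₁, ∀ y, ζ'' x y ≠ 0 → ∑ α, lam α x y = 1) ∧
      (∀ x ∈ blockK k y₁, ∀ α y, ζ'' x y * lam α x y ≠ 0 → x ∈ Xr α ∧ y ∈ cube α ∧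
          ∀ w, w ∉ cube α → R ≤ B5Ineq137Torus.T P 0 x w ∧ R ≤ B5Ineq137Torus.T P 0 y w) ∧
      (∀ x ∈ blockK k y₁, ∀ y, B5Ineq137Torus.T P 0 x y ≤ R₁ → ζ'' x y = 1) ∧
      ∃ S : Finset ι, S.card ≤ m ∧ ∀ x ∈ blockK k y₁, ∀ α y, ζ'' x y * lam α x y ≠ 0 → α ∈ S)
    (hΛ : ∀ b : PBond P (0 + k), (b.src ∈ Λ ∨ b.tgt ∈ Λ) → b ∈ starB (innerK k Ω))
    {T₁ δ₁ σ : ℝ} (hInt : ∀ b : PBond P (0 + k), blkIter 1 b.src = blkIter 1 b.tgt → ‖toC (lineIter U k b) - 1‖ ≤ T₁)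
    (hTree : ∀ y : Balaban1983to89.Site P (0 + k), ‖holCK (lineIter U k) 1 y - 1‖ ≤ δ₁)
    (hσ : 2 * (((P.L : ℝ) - 1) * P.L) * P.d * T₁ ^ 2 + 2 * δ₁ ^ 2 ≤ σ) {κ' : ℝ} (hκ' : 0 ≤ κ')
    (hE : 4 / 3 * (P.d : ℝ) ^ 4 * (((P.L : ℝ) ^ k) ^ 2 * θ) ^ 2 +
        B1.aSeq a P.L k ^ 2 * (c₀ * Real.exp (δ₀ / 2) * latticeConst P.d (δ₀ / 2)) *
          ((m : ℝ) * Real.exp (-(δ₀ * (((P.L : ℝ) ^ k)⁻¹ * (2 * R)))) + Real.exp (-(δ₀ / 2 * (((P.L : ℝ) ^ k)⁻¹ * R₁)))) <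
      c240 P (min (a / (9 * (P.d + 1))) (1 / 12)) κ' * (1 - σ)) (Es N : ℝ) :
    (realify (compress Λ (op240 (deltaLocT (B1RG242Torus.α P a k * (P.L : ℝ) ^ (k * P.d)) P.eps⁻¹ U k cube lam ζ'')
        ((B1RG242Torus.α P a k * (P.L : ℝ) ^ (k * P.d)) / B1.aSeq a P.L k * κ') (lineIter U k)))).PosDef ∧
      Z49 (realify (compress Λ (op240 (deltaLocT (B1RG242Torus.α P a k * (P.L : ℝ) ^ (k * P.d)) P.eps⁻¹ U k cube lam ζ'')
          ((B1RG242Torus.α P a k * (P.L : ℝ) ^ (k * P.d)) / B1.aSeq a P.L k * κ') (lineIter U k)))) Es N =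
        Real.exp (-(Es * N)) * (Real.sqrt (2 * Real.pi) ^ Fintype.card (↥Λ × Fin 2) /
          Real.sqrt (realify (compress Λ (op240 (deltaLocT (B1RG242Torus.α P a k * (P.L : ℝ) ^ (k * P.d)) P.eps⁻¹ U k cube lam ζ'')
            ((B1RG242Torus.α P a k * (P.L : ℝ) ^ (k * P.d)) / B1.aSeq a P.L k * κ') (lineIter U k)))).det) ∧
      0 < Z49 (realify (compress Λ (op240 (deltaLocT (B1RG242Torus.α P a k * (P.L : ℝ) ^ (k * P.d)) P.eps⁻¹ U k cube lam ζ'')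
          ((B1RG242Torus.α P a k * (P.L : ℝ) ^ (k * P.d)) / B1.aSeq a P.L k * κ') (lineIter U k)))) Es N := by
  have hk : 0 + k ≤ P.m + P.K := (Nat.le_succ _).trans hk'
  set A : ℝ := B1RG242Torus.α P a k * (P.L : ℝ) ^ (k * P.d) with hAdef
  set ak : ℝ := B1.aSeq a P.L k with hakdef
  have hak : 0 < ak := B1.aSeq_pos ha (B1RG242Torus.one_lt_cast_L P) hk1
  have hα : 0 < B1RG242Torus.α P a k := mul_pos hak (inv_pos.mpr (pow_pos (P.spacing_pos k) 2))
  have hA0 : 0 < A := mul_pos hα (pow_pos P.cast_L_pos _)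
  have hAak : 0 < A / ak := div_pos hA0 hak
  set γ₀ : ℝ := min (a / (9 * ((P.d : ℝ) + 1))) (1 / 12) with hγ₀def
  have hγ₀0 : 0 ≤ γ₀ := le_min (by positivity) (by norm_num)
  set E₀ : ℝ := 4 / 3 * (P.d : ℝ) ^ 4 * (((P.L : ℝ) ^ k) ^ 2 * θ) ^ 2 +
      ak ^ 2 * (c₀ * Real.exp (δ₀ / 2) * latticeConst P.d (δ₀ / 2)) *
        ((m : ℝ) * Real.exp (-(δ₀ * (((P.L : ℝ) ^ k)⁻¹ * (2 * R)))) + Real.exp (-(δ₀ / 2 * (((P.L : ℝ) ^ k)⁻¹ * R₁)))) with hE₀def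
  have hΔ : (deltaLocT A P.eps⁻¹ U k cube lam ζ'').IsHermitian :=
    deltaLocT_conjTranspose hk (inv_ne_zero P.eps_pos.ne') hA0 U hcube hlamsymm hζsymm
  have hγ : 0 ≤ A / ak * γ₀ := mul_nonneg hAak.le hγ₀0
  have hκ : 0 ≤ A / ak * κ' := mul_nonneg hAak.le hκ'
  have hE' : A / ak * E₀ < c240 P (A / ak * γ₀) (A / ak * κ') * (1 - σ) := by
    rw [c240_smul P hAak.le, mul_assoc]
    exact mul_lt_mul_of_pos_left hE hAak
  have h238 : ∀ φ : Balaban1983to89.Site P (0 + k) → ℂ, (∀ x ∉ Λ, φ x = 0) →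
      A / ak * γ₀ * ∑ b : PBond P (0 + k), ‖toC (lineIter U k b) * φ b.tgt - φ b.src‖ ^ 2 -
          A / ak * E₀ * ∑ x, ‖φ x‖ ^ 2 ≤ (star φ ⬝ᵥ (deltaLocT A P.eps⁻¹ U k cube lam ζ'' *ᵥ φ)).re := by
    intro φ hφ
    have h5 := ineq238_gen hk1 hk ha U hθ hΩ X₀ cube Xr hlam hζ hδ₀ hc₀ hGΩ hC hR m (fun ψ => ∀ x ∉ Λ, ψ x = 0)
      (fun ψ hψ y₁ hy₁ => hrows y₁ (by by_contra h; exact hy₁ (hψ y₁ h)))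
      (fun ψ hψ b hb => hΛ b (hb.elim (fun h => Or.inl (by by_contra h'; exact h (hψ _ h')))
        (fun h => Or.inr (by by_contra h'; exact h (hψ _ h'))))) φ hφ
    rw [← hAdef, ← hakdef] at h5
    have e : A / ak * γ₀ * ∑ b : PBond P (0 + k), ‖toC (lineIter U k b) * φ b.tgt - φ b.src‖ ^ 2 - A / ak * E₀ * ∑ x, ‖φ x‖ ^ 2 =
        A / ak * (γ₀ * ∑ b : PBond P (0 + k), ‖toC (lineIter U k b) * φ b.tgt - φ b.src‖ ^ 2 - E₀ * ∑ x, ‖φ x‖ ^ 2) := by ring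
    rw [e]
    exact h5
  have h := Z49_smallField_eq (Λ := Λ) hk' (lineIter U k) hInt hTree hσ hΔ hγ hκ hE' h238 Es N
  exact ⟨h.1, h.2, Z49_pos _ h.1 Es N⟩

/-- **(2.41) FROM THE ROW-RESTRICTED INPUTS WITH TORUS-EXTERIOR DEPTHS**: as `decay241_of_inputs`, for `Λ` whose block rows lie in `X₀` and
satisfy (i), (ii″), (iii) with multiplicity `≤ m` (so in particular the activity hypothesis of `decay236_gen`); `0 ≤ R`.
[cite: BalabanImbrieJaffe1988, (2.41) p.264] -/
theorem decay241_gen {k : ℕ} (hk1 : 1 ≤ k) (hk' : 0 + k + 1 ≤ P.m + P.K) {a : ℝ} (ha : 0 < a) (U : GaugeField P 0 U1) {θ : ℝ}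
    (hθ : ∀ (x : Balaban1983to89.Site P 0) (μ ν : Fin P.d), ‖plaqC U x μ ν - 1‖ ≤ θ)
    {Ω : Finset (Balaban1983to89.Site P 0)} (hΩ : IsBlockUnion k Ω) (X₀ : Finset (Balaban1983to89.Site P 0)) {ι : Type*} [Fintype ι]
    (cube Xr : ι → Finset (Balaban1983to89.Site P 0))
    {lam : ι → Balaban1983to89.Site P 0 → Balaban1983to89.Site P 0 → ℝ} {ζ'' : Balaban1983to89.Site P 0 → Balaban1983to89.Site P 0 → ℝ}
    (hlam : ∀ x y, ∑ α, |lam α x y| ≤ 1) (hζ : ∀ x y, 0 ≤ ζ'' x y ∧ ζ'' x y ≤ 1) {δ₀ c₀ : ℝ} (hδ₀ : 0 < δ₀) (hc₀ : 0 ≤ c₀)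
    (hGΩ : ∀ x ∈ X₀, ∀ (f : Balaban1983to89.Site P 0 → ℂ) (F D : ℝ), (∀ y, ‖f y‖ ≤ F) → 0 ≤ D →
      (∀ y, f y ≠ 0 → D ≤ B5Ineq137Torus.T P 0 x y) →
      ‖(gBox (B1RG242Torus.α P a k * (P.L : ℝ) ^ (k * P.d)) P.eps⁻¹ U k Ω *ᵥ f) x‖ ≤
        P.spacing k ^ 2 * (c₀ * Real.exp (-(δ₀ * (((P.L : ℝ) ^ k)⁻¹ * D))) * F))
    (hG : ∀ α, ∀ x ∈ Xr α, ∀ (f : Balaban1983to89.Site P 0 → ℂ) (F D : ℝ), (∀ y, ‖f y‖ ≤ F) → 0 ≤ D →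
      (∀ y, f y ≠ 0 → D ≤ B5Ineq137Torus.T P 0 x y) →
      ‖(gBox (B1RG242Torus.α P a k * (P.L : ℝ) ^ (k * P.d)) P.eps⁻¹ U k (cube α) *ᵥ f) x‖ ≤
        P.spacing k ^ 2 * (c₀ * Real.exp (-(δ₀ * (((P.L : ℝ) ^ k)⁻¹ * D))) * F))
    (hC : ∀ α, ∀ x ∈ Xr α, ∀ (f : Balaban1983to89.Site P 0 → ℂ) (F D Db Df : ℝ), (∀ y, ‖f y‖ ≤ F) → (∀ y, y ∉ cube α → f y = 0) →
      0 ≤ D → (∀ y, f y ≠ 0 → D ≤ B5Ineq137Torus.T P 0 x y) → 0 ≤ Db → (∀ w, w ∉ cube α → Db ≤ B5Ineq137Torus.T P 0 x w) →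
      0 ≤ Df → (∀ y, f y ≠ 0 → ∀ w, w ∉ cube α → Df ≤ B5Ineq137Torus.T P 0 y w) →
      ‖(gBox (B1RG242Torus.α P a k * (P.L : ℝ) ^ (k * P.d)) P.eps⁻¹ U k (cube α) *ᵥ f) x -
          (gBox (B1RG242Torus.α P a k * (P.L : ℝ) ^ (k * P.d)) P.eps⁻¹ U k Ω *ᵥ f) x‖ ≤
        P.spacing k ^ 2 * (c₀ * Real.exp (-(δ₀ * (((P.L : ℝ) ^ k)⁻¹ * D))) * Real.exp (-(δ₀ * (((P.L : ℝ) ^ k)⁻¹ * (Db + Df)))) * F))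
    {R R₁ : ℝ} (hR : 0 ≤ R) (m : ℕ) (Λ : Finset (Balaban1983to89.Site P (0 + k)))
    (hrows : ∀ y₁ ∈ Λ,
      (∀ x ∈ blockK k y₁, x ∈ X₀) ∧
      (∀ x ∈ blockK k y₁, ∀ y, ζ'' x y ≠ 0 → ∑ α, lam α x y = 1) ∧
      (∀ x ∈ blockK k y₁, ∀ α y, ζ'' x y * lam α x y ≠ 0 → x ∈ Xr α ∧ y ∈ cube α ∧
          ∀ w, w ∉ cube α → R ≤ B5Ineq137Torus.T P 0 x w ∧ R ≤ B5Ineq137Torus.T P 0 y w) ∧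
      (∀ x ∈ blockK k y₁, ∀ y, B5Ineq137Torus.T P 0 x y ≤ R₁ → ζ'' x y = 1) ∧
      ∃ S : Finset ι, S.card ≤ m ∧ ∀ x ∈ blockK k y₁, ∀ α y, ζ'' x y * lam α x y ≠ 0 → α ∈ S)
    (hΛ : ∀ b : PBond P (0 + k), (b.src ∈ Λ ∨ b.tgt ∈ Λ) → b ∈ starB (innerK k Ω))
    {T₁ δ₁ σ : ℝ} (hInt : ∀ b : PBond P (0 + k), blkIter 1 b.src = blkIter 1 b.tgt → ‖toC (lineIter U k b) - 1‖ ≤ T₁)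
    (hTree : ∀ y : Balaban1983to89.Site P (0 + k), ‖holCK (lineIter U k) 1 y - 1‖ ≤ δ₁)
    (hσ : 2 * (((P.L : ℝ) - 1) * P.L) * P.d * T₁ ^ 2 + 2 * δ₁ ^ 2 ≤ σ) {κ' : ℝ} (hκ' : 0 ≤ κ')
    (hE : 4 / 3 * (P.d : ℝ) ^ 4 * (((P.L : ℝ) ^ k) ^ 2 * θ) ^ 2 +
        B1.aSeq a P.L k ^ 2 * (c₀ * Real.exp (δ₀ / 2) * latticeConst P.d (δ₀ / 2)) *
          ((m : ℝ) * Real.exp (-(δ₀ * (((P.L : ℝ) ^ k)⁻¹ * (2 * R)))) + Real.exp (-(δ₀ / 2 * (((P.L : ℝ) ^ k)⁻¹ * R₁)))) <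
      c240 P (min (a / (9 * (P.d + 1))) (1 / 12)) κ' * (1 - σ))
    {ϑ : ℝ} (hϑ0 : 0 ≤ ϑ) (hϑ : ϑ ≤ δ₀ / 4)
    (hsmall : ϑ * ((4 / δ₀) * (2 * latticeConst P.d (δ₀ / 2)) *
        (B1.aSeq a P.L k * (1 + m * B1.aSeq a P.L k * (c₀ * Real.exp δ₀)) +
          κ' * (((P.L : ℝ) ^ P.d)⁻¹) ^ 2 * Real.exp (δ₀ * ((P.L : ℝ) - 1)))) ≤
      (c240 P (min (a / (9 * (P.d + 1))) (1 / 12)) κ' * (1 - σ) -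
        (4 / 3 * (P.d : ℝ) ^ 4 * (((P.L : ℝ) ^ k) ^ 2 * θ) ^ 2 +
          B1.aSeq a P.L k ^ 2 * (c₀ * Real.exp (δ₀ / 2) * latticeConst P.d (δ₀ / 2)) *
            ((m : ℝ) * Real.exp (-(δ₀ * (((P.L : ℝ) ^ k)⁻¹ * (2 * R)))) + Real.exp (-(δ₀ / 2 * (((P.L : ℝ) ^ k)⁻¹ * R₁)))))) / 2)
    (x₁ x₂ : ↥Λ) :
    ‖(compress Λ (op240 (deltaLocT (B1RG242Torus.α P a k * (P.L : ℝ) ^ (k * P.d)) P.eps⁻¹ U k cube lam ζ'')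
        ((B1RG242Torus.α P a k * (P.L : ℝ) ^ (k * P.d)) / B1.aSeq a P.L k * κ') (lineIter U k)))⁻¹ x₁ x₂‖ ≤
      ((B1RG242Torus.α P a k * (P.L : ℝ) ^ (k * P.d)) / B1.aSeq a P.L k)⁻¹ *
        (4 / (c240 P (min (a / (9 * (P.d + 1))) (1 / 12)) κ' * (1 - σ) -
          (4 / 3 * (P.d : ℝ) ^ 4 * (((P.L : ℝ) ^ k) ^ 2 * θ) ^ 2 +
            B1.aSeq a P.L k ^ 2 * (c₀ * Real.exp (δ₀ / 2) * latticeConst P.d (δ₀ / 2)) *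
              ((m : ℝ) * Real.exp (-(δ₀ * (((P.L : ℝ) ^ k)⁻¹ * (2 * R)))) + Real.exp (-(δ₀ / 2 * (((P.L : ℝ) ^ k)⁻¹ * R₁))))))) *
        Real.exp (-(ϑ * B5Ineq137Torus.T P (0 + k) x₁ x₂)) := by
  have hk : 0 + k ≤ P.m + P.K := (Nat.le_succ _).trans hk'
  set A : ℝ := B1RG242Torus.α P a k * (P.L : ℝ) ^ (k * P.d) with hAdef
  set ak : ℝ := B1.aSeq a P.L k with hakdef
  have hak : 0 < ak := B1.aSeq_pos ha (B1RG242Torus.one_lt_cast_L P) hk1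
  have hα : 0 < B1RG242Torus.α P a k := mul_pos hak (inv_pos.mpr (pow_pos (P.spacing_pos k) 2))
  have hA0 : 0 < A := mul_pos hα (pow_pos P.cast_L_pos _)
  have hAak : 0 < A / ak := div_pos hA0 hak
  set γ₀ : ℝ := min (a / (9 * ((P.d : ℝ) + 1))) (1 / 12) with hγ₀def
  have hγ₀0 : 0 ≤ γ₀ := le_min (by positivity) (by norm_num)
  set E₀ : ℝ := 4 / 3 * (P.d : ℝ) ^ 4 * (((P.L : ℝ) ^ k) ^ 2 * θ) ^ 2 +
      ak ^ 2 * (c₀ * Real.exp (δ₀ / 2) * latticeConst P.d (δ₀ / 2)) *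
        ((m : ℝ) * Real.exp (-(δ₀ * (((P.L : ℝ) ^ k)⁻¹ * (2 * R)))) + Real.exp (-(δ₀ / 2 * (((P.L : ℝ) ^ k)⁻¹ * R₁)))) with hE₀def
  have hγ : 0 ≤ A / ak * γ₀ := mul_nonneg hAak.le hγ₀0
  have hκ : 0 ≤ A / ak * κ' := mul_nonneg hAak.le hκ'
  have hE' : A / ak * E₀ < c240 P (A / ak * γ₀) (A / ak * κ') * (1 - σ) := by
    rw [c240_smul P hAak.le, mul_assoc]
    exact mul_lt_mul_of_pos_left hE hAak
  have hgap : c240 P (A / ak * γ₀) (A / ak * κ') * (1 - σ) - A / ak * E₀ = A / ak * (c240 P γ₀ κ' * (1 - σ) - E₀) := by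
    rw [c240_smul P hAak.le]; ring
  have h238 : ∀ φ : Balaban1983to89.Site P (0 + k) → ℂ, (∀ x ∉ Λ, φ x = 0) →
      A / ak * γ₀ * ∑ b : PBond P (0 + k), ‖toC (lineIter U k b) * φ b.tgt - φ b.src‖ ^ 2 -
          A / ak * E₀ * ∑ x, ‖φ x‖ ^ 2 ≤ (star φ ⬝ᵥ (deltaLocT A P.eps⁻¹ U k cube lam ζ'' *ᵥ φ)).re := by
    intro φ hφ
    have h5 := ineq238_gen hk1 hk ha U hθ hΩ X₀ cube Xr hlam hζ hδ₀ hc₀ hGΩ hC hR m (fun ψ => ∀ x ∉ Λ, ψ x = 0)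
      (fun ψ hψ y₁ hy₁ => hrows y₁ (by by_contra h; exact hy₁ (hψ y₁ h)))
      (fun ψ hψ b hb => hΛ b (hb.elim (fun h => Or.inl (by by_contra h'; exact h (hψ _ h')))
        (fun h => Or.inr (by by_contra h'; exact h (hψ _ h'))))) φ hφ
    rw [← hAdef, ← hakdef] at h5
    have e : A / ak * γ₀ * ∑ b : PBond P (0 + k), ‖toC (lineIter U k b) * φ b.tgt - φ b.src‖ ^ 2 - A / ak * E₀ * ∑ x, ‖φ x‖ ^ 2 =
        A / ak * (γ₀ * ∑ b : PBond P (0 + k), ‖toC (lineIter U k b) * φ b.tgt - φ b.src‖ ^ 2 - E₀ * ∑ x, ‖φ x‖ ^ 2) := by ring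
    rw [e]
    exact h5
  set cΔ : ℝ := A * (1 + m * ak * (c₀ * Real.exp δ₀)) with hcΔdef
  have hcΔ : 0 ≤ cΔ := by positivity
  have hker : ∀ y₁ ∈ Λ, ∀ y₂ ∈ Λ, ‖deltaLocT A P.eps⁻¹ U k cube lam ζ'' y₁ y₂‖ ≤
      cΔ * Real.exp (-(δ₀ * B5Ineq137Torus.T P (0 + k) y₁ y₂)) := by
    intro y₁ hy₁ y₂ _
    obtain ⟨-, -, hdeep, -, S, hSm, hS⟩ := hrows y₁ hy₁
    have h36 := decay236_gen hk1 hk ha P.eps⁻¹ U cube Xr hlam (fun x y => abs_le.2 ⟨by linarith [(hζ x y).1], (hζ x y).2⟩) hδ₀.le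
      hc₀ hG y₁ y₂ (fun x hx α y hαy => (hdeep x hx α y hαy).1) S hS
    rw [← hAdef, ← hakdef] at h36
    have hind : (if y₁ = y₂ then (1 : ℝ) else 0) ≤ Real.exp (-(δ₀ * B5Ineq137Torus.T P (0 + k) y₁ y₂)) := by
      split_ifs with h
      · rw [h, B5Ineq137Torus.T_self, mul_zero, neg_zero, Real.exp_zero]
      · exact Real.exp_nonneg _
    have hSm' : (S.card : ℝ) ≤ m := by exact_mod_cast hSm
    calc ‖deltaLocT A P.eps⁻¹ U k cube lam ζ'' y₁ y₂‖
        ≤ A * ((if y₁ = y₂ then 1 else 0) + S.card * ak * (c₀ * Real.exp δ₀) * Real.exp (-(δ₀ * B5Ineq137Torus.T P (0 + k) y₁ y₂))) := h36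
      _ ≤ A * (Real.exp (-(δ₀ * B5Ineq137Torus.T P (0 + k) y₁ y₂)) +
            m * ak * (c₀ * Real.exp δ₀) * Real.exp (-(δ₀ * B5Ineq137Torus.T P (0 + k) y₁ y₂))) :=
          mul_le_mul_of_nonneg_left (add_le_add hind (mul_le_mul_of_nonneg_right
            (mul_le_mul_of_nonneg_right (mul_le_mul_of_nonneg_right hSm' hak.le) (by positivity)) (Real.exp_nonneg _))) hA0.le
      _ = cΔ * Real.exp (-(δ₀ * B5Ineq137Torus.T P (0 + k) y₁ y₂)) := by rw [hcΔdef]; ring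
  have hW : weightC (fun t => 2 * latticeConst P.d t) (cΔ + A / ak * κ' * (((P.L : ℝ) ^ P.d)⁻¹) ^ 2 * Real.exp (δ₀ * ((P.L : ℝ) - 1))) δ₀ =
      A / ak * ((4 / δ₀) * (2 * latticeConst P.d (δ₀ / 2)) *
        (ak * (1 + m * ak * (c₀ * Real.exp δ₀)) + κ' * (((P.L : ℝ) ^ P.d)⁻¹) ^ 2 * Real.exp (δ₀ * ((P.L : ℝ) - 1)))) := by
    rw [weightC, hcΔdef]
    field_simp
  have hsmall' : ϑ * weightC (fun t => 2 * latticeConst P.d t)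
      (cΔ + A / ak * κ' * (((P.L : ℝ) ^ P.d)⁻¹) ^ 2 * Real.exp (δ₀ * ((P.L : ℝ) - 1))) δ₀ ≤
      (c240 P (A / ak * γ₀) (A / ak * κ') * (1 - σ) - A / ak * E₀) / 2 := by
    rw [hW, hgap]
    have h1 := mul_le_mul_of_nonneg_left hsmall hAak.le
    linarith [h1]
  have h := decay241_smallField (Λ := Λ) hk' (lineIter U k) hInt hTree hσ hγ hκ hE' h238 hcΔ hδ₀ hker hϑ0 hϑ hsmall' x₁ x₂
  rw [hgap] at h
  refine h.trans (le_of_eq ?_)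
  rw [hAdef, hakdef]
  field_simp

end Gen

end

end Literature.MathematicalPhysics.QuantumFieldTheory.BalabanImbrieJaffe1984to88.BIJ88DeltaLocClose235General
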